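import Mathlib
import HarnessLib
import HarnessLib.Audit
import Summits.QuantumFields.YangMills.Theses.PencilRigidity
import Summits.QuantumFields.YangMills.Theorems.PencilRigidityCurvatureKernelBoundReduction
import Summits.QuantumFields.YangMills.Theorems.PencilRigidityCurvatureKernelBoundOffDiagonalVanishing
import Summits.QuantumFields.YangMills.Theorems.PencilRigidityCurvatureKernelBoundDegenerateAxialGrowth
import Summits.QuantumFields.YangMills.Theorems.PencilRigidityCurvatureKernelBoundLatticeTruncatedTwoPointBound
import Summits.QuantumFields.YangMills.Theorems.PencilRigidityCurvatureKernelBoundBoundedRenormalisationAxialGrowth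
import Summits.QuantumFields.YangMills.Theorems.PencilRigidityCurvatureKernelBoundLatticeWindowPairOfOne
import Summits.QuantumFields.YangMills.Theorems.PencilRigidityCurvatureKernelBoundLatticeWindowTransfer
import Summits.QuantumFields.YangMills.Theorems.PencilRigidityCurvatureKernelBoundReductionDFree
import Summits.QuantumFields.YangMills.Theorems.PencilRigidityCurvatureKernelBoundPartitionBump
import Summits.QuantumFields.YangMills.Theorems.PencilRigidityCurvatureKernelBoundLocalRepresentation
import Summits.QuantumFields.YangMills.Theorems.PencilRigidityCurvatureKernelBoundKernelExistence
import Summits.QuantumFields.YangMills.Theorems.PencilRigidityCurvatureKernelBoundTwoPointLocalBoundScaling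
import Summits.QuantumFields.YangMills.Theorems.PencilRigidityCurvatureKernelBoundTwoPointLocalBoundSemiDegenerate
import Summits.QuantumFields.YangMills.Theorems.PencilRigidityCurvatureKernelBoundHalfSpaceKernel
import Summits.QuantumFields.YangMills.Theorems.PencilRigidityCurvatureKernelBoundOddTorusCovCauchySchwarz
import Summits.QuantumFields.YangMills.Theorems.PencilRigidityCurvatureKernelBoundCovAxisNormalisation
import Summits.QuantumFields.YangMills.Theorems.PencilRigidityCurvatureKernelBoundAxisDominationOfForm
import Summits.QuantumFields.YangMills.Theorems.PencilRigidityCurvatureKernelBoundSmearedOfPointwise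
import Summits.QuantumFields.YangMills.Theorems.PencilRigidityCurvatureKernelBoundSmearedToLocalDecay
import Summits.QuantumFields.YangMills.Theorems.PencilRigidityCurvatureKernelBoundSemiDegenerateLocalDecay
import Summits.QuantumFields.YangMills.Theorems.PencilRigidityCurvatureKernelBoundCruxToLocalDecay
import Summits.QuantumFields.YangMills.Theorems.PencilRigidityCurvatureKernelBoundKernelExistenceOfLocalDecay
import Summits.QuantumFields.YangMills.Theorems.PencilRigidityCurvatureKernelBoundAxialGrowthOfLocalDecay
import Summits.QuantumFields.YangMills.Theorems.PencilRigidityCurvatureKernelBoundIffLocalDecay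
import Summits.QuantumFields.YangMills.Theorems.PencilRigidityCurvatureKernelBoundAxialGrowthOfLocalDecayDatum
import Summits.QuantumFields.YangMills.Theorems.PencilRigidityCurvatureKernelBoundKernelConclusionOfWitnessLocalDecay
import Summits.QuantumFields.YangMills.Theorems.PencilRigidityCurvatureKernelBoundSmearedBoundEventuallyOfCrux
import Literature.MathematicalPhysics.QuantumFieldTheory.SpeciesTimeReflection
import Literature.MathematicalPhysics.QuantumFieldTheory.WilsonAxisSymmetry

/-!
# Skeleton v17 — line `sixteen-charts-analytic-kernel`, crux stmt-QuantumFields-11687 (`PencilRigidity.CurvatureKernelBound`)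

Skeleton v17 = v16 + the c5 wave-2 RECORD theorems, all LANDED and imported: `CurvatureKernelBoundIffLocalDecay` (crux ↔ T as a tree
theorem, p131429), `AxialGrowthOfLocalDecayDatum` (per-datum I₂, p131551), the EXISTENCE-LEG FOLDS `KernelConclusionOfWitnessLocalDecay`
(W₁-datum + its two-point local decay ⇒ the kernel conclusion for it) and `KernelConclusionOfWitnessSmeared` (W₁-datum + the smeared
lattice window bound of its scheme ⇒ the kernel conclusion for it) (p131920), and the scale-by-scale NECESSITY of the smeared lattice bound
`SmearedBoundEventuallyOfCrux` (crux ⇒ ∀ (s, ρ, f) ∀ᶠ k: |LS₂ − LS₁LS₁| ≤ C s^(η−10)(‖f₀‖₁‖f₁‖₁ + ρ⁸M₀M₁) + δ, p131636): E^sm exceeds the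
crux EXACTLY by the quantifier swap `∃ᶠ k ∀ (s, ρ, f)` (k-uniformity through the window). `sorry` ONLY in E^sm `SmearedLatticeWindowBound`.

Skeleton v16 = v15 with ALL SIX provable stubs LANDED and imported (J `SmearedOfPointwise` p130360, L′ `SmearedToLocalDecay` p130432,
B₂′ `SemiDegenerateLocalDecay` p130341, N′ `CruxToLocalDecay` p130438, I₁ `KernelExistenceOfLocalDecay` p130518, I₂ `AxialGrowthOfLocalDecay` p131106):
`sorry` ONLY in the ONE open stub E^sm `SmearedLatticeWindowBound`; `curvatureKernelBound_iff_twoPointLocalDecay : crux ↔ T` is now a theorem over tree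
declarations. v15 (continuation line LEAD prover-line-stmt-QuantumFields-11687-c5-0, 2026-08-16) — THE EXACT CONTINUUM RESIDUE AND ONE SIGN-FREE LATTICE STUB.
* T `TwoPointLocalDecay` (continuum, D-free, sign-free, lattice-free): for `W₁`-data, the local two-point bounds of H/X
  (`‖S₁ 2 (f₀⊗f₁)‖ ≤ A ‖f₀‖₁‖f₁‖₁ + B r⁸ ‖f₀‖∞‖f₁‖∞` for real tensors in `r`-balls about `∓s e₀`) hold with `A + B ≤ C s^(η−10)`.
  NEW provable stubs I₁ `KernelExistenceOfLocalDecay` (T → kernel existence, via X `KernelExistence`), I₂ `AxialGrowthOfLocalDecay`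
  (T → E: bump localisation at `∓(s/2)e₀` + evenness `KernelIsometryInvariance` (R = −1)), glued by G `CurvatureKernelBoundReductionDFree`, and N′ `CruxToLocalDecay` (crux → T: `|K| ≤ 2C s^(η−10)`
  on the window `s ≤ ‖ξ‖`) make the crux EQUIVALENT to T (`curvatureKernelBound_iff_twoPointLocalDecay`).
* E^sm `SmearedLatticeWindowBound` (the ONE open stub; lattice, sign-free, no reflection positivity): in the scaling branch
  (non-factorising, `|c_k| → ∞`), frequently in `k`, for all physical scales `a_k R₀ ≤ s ≤ θ` and real `f₀, f₁` supported in
  `ρ`-balls (`ρ ≤ s/2`) about `∓s e₀`: `|LS₂(f₀,f₁) − LS₁(f₀)LS₁(f₁)| ≤ C s^(η−10) R_k(f₀) R_k(f₁)`, `R_k(f) = a_k⁴ Σ_{x∈box} |f(a_k x)|`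
  — the SMEARED renormalised truncated plaquette two-point function (it already carries `c_k²`), i.e. exactly what passes to the
  limit; weaker than the pointwise E‴₁ (J `SmearedOfPointwise`: E‴₁ → E^sm per scheme, by `abs_truncated_le_of_cov_le`), hence than
  `E⁗ ∧ N` (v14 glue kept: `(F ∧ P ∧ A ∧ E⁗ ∧ N) → E‴₁ → E^sm`); the sign split of `β_k` and N disappear from the residue.
* L′ `SmearedToLocalDecay` (provable: lattice tie at n = 2, 1, `S₁ 1 = κ∫`, lattice point count) and B₂′ `SemiDegenerateLocalDecay`
  (provable: B₂ with its constants exported, `η = 10`) give T in the two branches; `CurvatureKernelBound_of hI₁ hI₂ hB₂′ hL′ hE^sm`.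
Registered stubs v15: KernelExistenceOfLocalDecay, AxialGrowthOfLocalDecay, CruxToLocalDecay, SemiDegenerateLocalDecay, SmearedToLocalDecay, SmearedOfPointwise (provable; ALL LANDED in v16) and
SmearedLatticeWindowBound (OPEN; the only registered stub of v16). E⁗ `AxisWindowBound`, N `NegativeCouplingWindowBound`, E‴₁ stay as statements with their landed glue.

HISTORY (v14): Skeleton v14 = v13 with its three provable stubs LANDED and imported (F p127937, P p128179, A p128805): `sorry` ONLY in the two OPEN stubs E⁗, N.
v13 (continuation line LEAD prover-line-stmt-QuantumFields-11687-c4-0, 2026-08-16) — THE AXIS-CURRENCY RESHAPE of the open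
core. v12's single stub E‴₁ `LatticeKernelWindowBound` (k-uniform UV window bound on the renormalised truncated plaquette covariance
`c_k² Cov_k(Q_0, Q_z)` in the scaling branch) is now GLUED (`latticeKernelWindowBound_of`, kernel-checked) from five registered stubs:
* F `OddTorusCovCauchySchwarz` (provable now): Osterwalder–Seiler SITE-reflection positivity of Wilson's measure on the ODD torus
  `2S+1`, `β ≥ 0`, as a positive-semidefinite centred form `Cov(X∘Θ', Y)` on bounded observables of the closed positive half, with its
  2×2 Cauchy–Schwarz (engines in tree: `wilsonExpectation_negReflect_nonneg_odd`, `wilsonMeasure_map_negReflect_eq`,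
  `covariance_rp_cauchySchwarz`);
* P `CovAxisNormalisation` (provable now): hypercubic bookkeeping — `Cov(Q_0,Q_z) = Cov(Q_0,Q_{z'})` with `z'₀ = |z_i|` (axis transposition
  and sign: `integral_comp_configPerm_wilsonMeasure`, `curvature_F_perm_torusLift`, lifted translation invariance);
* A `AxisDominationOfForm` (provable now, the lead's): THE TIME AXIS IS EXTREMAL — from F, for `z₀ = n`, `3 ≤ n ≤ L`, `β ≥ 0`:
  `Cov(Q_0,Q_z)² ≤ lCC(Q,Q^θ,2⌈n/2⌉) · lCC(Q^θ,Q,2⌊n/2⌋)`, both factors `≥ 0`, where `Q^θ = r.curvature.timeReflect` is the time-reflected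
  corner density and `lCC = latticeConnectedCorr` is EXACTLY the axis time-correlation of W₁'s own `HasLatticeMassGap` clause;
* E⁗ `AxisWindowBound` (OPEN; the UV core in axis currency, branch `β_k ≥ 0` frequently): `c_k² |lCC_k(Q^θ,Q,m)|, c_k² |lCC_k(Q,Q^θ,m)|
  ≤ C (a_k m)^(η−10)` for `R₀ ≤ m ≤ L_k`, `a_k m ≤ θ`, frequently in `k` — a RENORMALISED short-distance sharpening of the constant in
  `HasLatticeMassGap` for two observables on the scheme's torus; transfer-matrix (completely monotone) sequences; AF predicts `η = 2`;
* N `NegativeCouplingWindowBound` (OPEN; no RP available): E‴₁ on the branch `β_k < 0` eventually — EMPTY once W₁ carries the summit's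
  `HasWeakCouplingLimit` (`β_k → +∞`), which the lead recommends to the planner.
Glue: sign split of `β_k`; sup-norm coordinate `n = ‖z‖_∞` (`n ≤ ‖z‖ ≤ 2n`), P, A, E⁗ at `m ∈ {2⌊n/2⌋, 2⌈n/2⌉}`, `(c²Cov)² ≤ (c²lCC₁)(c²lCC₂)`,
rpow bookkeeping `window_bound_transfer` (`η ↦ min η 1`, constants `θ^(η−η') 4^(10−η')`), `a_k L_k → ∞` for `m ≤ L_k`.
`CurvatureKernelBound_of` is v12's (D-free) and consumes the glued E‴₁: `(F ∧ P ∧ A ∧ E⁗ ∧ N) → E‴₁ → crux`, `crux → E″` unchanged.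

HISTORY (v12 and earlier):

Skeleton v12 = v11 with ALL SEVEN provable stubs LANDED and imported (P p121726, H HalfSpaceKernel, R p121770, X p122869, B₁ p122732, B₂ p121958, G p121673): `sorry` ONLY in E‴₁ `Stub.LatticeKernelWindowBound`. v11 (continuation line LEAD prover-line-stmt-QuantumFields-11687-c3-0, 2026-08-16) — THE D-FREE TRANSFER. v10's stub D
(`DiagonalMirrorRPR`, route item stmt-QuantumFields-10604) is REMOVED from the composition: the existence of a kernel continuous off `0`
representing `S₁ 2` on `⁰𝒮` — the only place D entered (`mirrorChartRegularity`) — is now derived from the LATTICE (local `L¹ ⊗ L¹ + r⁸ L^∞ ⊗ L^∞`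
bounds on `S₁ 2` near the time axis, in every branch of `W₁`: factorising / bounded `c_k` / scaling via E‴₁) + axis reflection positivity
(E2) + translations + proper signed permutations, through the tree's OS Hilbert space (`OSReconstructionNoE1`: `e^{-tH}`, `U(a⃗)`):
`HalfSpaceKernel` (weak cluster point `Ψ` of bounded bump vectors; `K(ξ) = ⟪Ψ, e^{-(|ξ₀|-2s)H} U(-ξ⃗) Ψ⟫`, continuous on `{ξ₀ < 0}`;
identification by an EXACT smooth partition of unity `PartitionBump`, Riemann sums of translated bumps, equicontinuity),
`LocalRepresentation` (tensor representation ⇒ local representation: `TensorRegularity` + pinning, as in `OffDiagonalVanishing`),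
`KernelExistence` (frames, evenness, patching `LocalKernelPatching`, polynomial a-priori bound, `OffDiagonalExtension`),
`TwoPointLocalBoundScaling` / `TwoPointLocalBoundSemiDegenerate` (the lattice local bounds per branch),
`CurvatureKernelBoundReductionDFree` (= the landed `CurvatureKernelBoundReduction` with the kernel-existence hypothesis in place of D).
Registered stubs after v11: these seven (all provable now) + E‴₁ `LatticeKernelWindowBound` (open UV core, unchanged).
Given nothing else: `E‴₁ → crux` and `crux → E″` (`curvatureKernelBound_of_latticeKernelWindowBound_dfree`).

## History (v1–v10)

Skeleton v10 (continuation line LEAD prover-line-stmt-QuantumFields-11687-c2-0, 2026-08-16). v10: L3 `LatticeWindowTransfer` LANDED (p115832, lemmas p115444) and imported; `sorry` ONLY in D (`DiagonalMirrorRPR`, route item stmt-QuantumFields-10604) and E‴₁ (`LatticeKernelWindowBound`, open). v9 = v8 + the open core restated in ONE lattice variable: E‴₁ `LatticeKernelWindowBound` (`c_k² |Cov_k(Q_0, Q_z)|`, i.e. block-filtration's `LocalLatticeKernelBound` verbatim up to the branch hypotheses, the frequent-in-`k` quantifier and the cut-off `R₀`) is the registered open stub; the pair form E‴ consumed by L3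 follows from it by the LANDED glue `LatticeWindowPairOfOne` (torus translation invariance, p111636).

STATE OF THE LINE. All model-blind and semi-degenerate content is LANDED (tree theorems, namespace
`Summit.QuantumFields.YangMills.Theorems.CurvatureKernel`): A1 `ChartDerivativeBounds` p76695, A2 `TensorRegularity` p86092,
A3 `KernelOffDiagonal` p93075, A4 `OffDiagonalExtension` p94939, B `AxisEnvelope` p96207, C `LatticeReality` p71949, the glue
`CurvatureKernelBoundReduction : D → E → crux`, `AxialGrowthNecessary : crux → E`, `curvatureKernelBound_iff_axialGrowth` (p96516),
the per-inhabitant glue `KernelConclusionOfWitness` p101783, and the branch theorems S1 `OffDiagonalVanishing` p105325,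
S2 `DegenerateAxialGrowth` p107087, L1 `LatticeTruncatedTwoPointBound` p107709, L2 `BoundedRenormalisationAxialGrowth` p108836 —
v8 IMPORTS all of them (v7-interim had to `sorry` S1/S2/L1/L2 pending the farm build). After v7 the crux was, given D, EQUIVALENT to
E″ = `AxialGrowthScaling`: the axial UV bound `‖K(s e₀)‖ ≤ C s^(η−10)` on `(0,1]` for every continuous kernel representing `S₁ 2` on
`⁰𝒮`, for `W₁`-data that are NON-factorising and have `|c_k| → ∞` (the scaling branch proper).

v8 RESHAPES E″ at the lattice/continuum seam:
* `LatticeWindowTransfer` (L3, provable now, size M–L; the lead's stub): `W₁` ∧ [LATTICE WINDOW BOUND] ⇒ the axial bound for every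
  continuous representing kernel. The window bound is a FREQUENT-in-`k`, `k`-uniform estimate on the renormalised truncated plaquette
  covariance of Wilson's torus measure at step `k`: `c_k² |Cov_k(Q_x, Q_y)| ≤ C (a_k‖x−y‖)^(η−10)` for all sites `x, y` of the box with
  `R₀ ≤ ‖x−y‖` (a fixed number of lattice spacings: lattice artefacts at the cut-off scale are not constrained) and `a_k‖x−y‖ ≤ θ`
  (a physical ball), `Q_x(U) = r.curvature.F (configShift (−x) (torusLift side_k U))` the integrand of `latticeSchwinger`. Route: as L2 —
  bumps `g ⊗ h` of radius `ε ≤ s/4` at `s e₀` and `0`; the truncated lattice two-point function is the double sum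
  `c_k² a_k⁸ Σ_x Σ_y g(a_k x) h(a_k y) Cov_k(Q_x, Q_y)` (L1's expansion), every contributing pair has `a_k‖x−y‖ ∈ [s/2, 3s/2]`, so
  along the good subsequence `|LS₂ − LS₁LS₁| ≤ C 2¹⁰(3/2)^η s^(η−10) R_k(g) R_k(h) ≤ C' s^(η−10) (3ε)⁸`; the lattice tie (`n = 2, 1`),
  `S₁ 1 = κ∫`, bump localisation of the continuous kernel and division by `(∫g)(∫h) ≥ ((ε/2)⁴v₁)²` give
  `‖K(s e₀)‖ ≤ ‖κ‖² + 1 + C″ s^(η−10)` for `s ≤ min(1, 2θ/3)`; on `[min(1,2θ/3), 1]` continuity bounds `K`; `η ↦ min η 10`.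
* `LatticeWindowBound` (E‴, the OPEN core, YM-specific): `W₁` ∧ non-factorising ∧ `|c_k| → ∞` ⇒ the lattice window bound. This is
  the block-filtration line's C⁺ `LocalLatticeKernelBound` restricted to the scaling branch (disprover's rule G2: at `β ≡ 0` with
  `c_k = a_k⁻⁵` — a `W₁`-inhabitant — every branch-free uniform lattice bound fails while the crux holds), stated in the tree's vocabulary;
  it is the currency in which a Bałaban-type UV construction, the block-filtration ladder or the axis-extremal majorant would deliver.
  Asymptotic freedom predicts it with `η = 2` (`c_k ≍ a_k⁻⁴`, `Cov_k(Q_0,Q_z) ≍ β_k⁻²‖z‖⁻⁸`).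

Composition (kernel-checked, no `sorry` outside `Stub.*`): E″ := L3 ∘ E‴; E′ from the landed L1, L2 and E″; E from the landed
S1, S2 and E′; `CurvatureKernelBound_of hD hL3 hE‴ := CurvatureKernelBoundReduction hD (axialGrowth_of … )`; conversely the crux
implies E″ (`AxialGrowthNecessary`), so given D (and L3) the crux sits between E‴ and E″:
`E‴ → crux` and `crux → E″` (`curvatureKernelBound_of_latticeWindowBound`, `axialGrowthScaling_of_curvatureKernelBound`).
Registered stubs: `Stub.DiagonalMirrorRPR` (D = route item stmt-QuantumFields-10604, consumed by name), `Stub.LatticeWindowTransfer`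
`Stub.LatticeKernelWindowBound` (E‴₁); L3 `LatticeWindowTransfer` is a tree theorem (p115832).
-/

namespace Summit.QuantumFields.YangMills.Cruxes.CurvatureKernelBound.SixteenChartsAnalyticKernel

open scoped BigOperators Topology ComplexConjugate
open Filter Set Function TopologicalSpace MeasureTheory
open Literature.MathematicalPhysics.QuantumLattice Literature.MathematicalPhysics.AQFT Literature.MathematicalPhysics.QuantumFieldTheory

/-! ## The statements (precise `Prop`s; the sorried `Stub.<Name>` below are the REGISTERED stubs) -/

/-- **E · AxialGrowth** (the residual UV datum; glued below). For every compact simple `G`, `r`, `sch` and one-species `S₁` with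
the curvature package `W₁`, EVERY kernel continuous off `0` representing `S₁ 2` on `⁰𝒮` obeys `‖K(s e₀)‖ ≤ C s^(η−10)` on `(0,1]`.
Given D it is EQUIVALENT to the crux (`curvatureKernelBound_iff_axialGrowth`). [JaffeWitten2000 §6.5 fn. 2] -/
def AxialGrowth : Prop :=
  open Literature.MathematicalPhysics.QuantumLattice Literature.MathematicalPhysics.AQFT Literature.MathematicalPhysics.QuantumFieldTheory in ∀ (G : Type) [Group G] [TopologicalSpace G] [IsTopologicalGroup G] [CompactSpace G] [MeasurableSpace G] [BorelSpace G], IsCompactSimpleLieGroup G → ∀ (r : LatticeRep G) (sch : SpeciesScheme (YMSpecies G)) (S₁ : SchwingerFamily (EuclideanSpace ℝ (Fin 4))), ((∀ (n : ℕ), n ≠ 0 → ∀ (f : Fin n → SchwartzMap (EuclideanSpace ℝ (Fin 4)) ℝ) (F : SchwartzMap (Fin n → (EuclideanSpace ℝ (Fin 4))) ℂ), IsTensorOf F (fun i => ofRealTest (f i)) → IsOffDiagonal F → Filter.Tendsto (fun k : ℕ => ((latticeSchwinger r.ρ sch (fun s => s.F) k n (fun _ => r.curvature) f : ℝ) : ℂ))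 Filter.atTop (nhds (S₁ n F))) ∧ (S₁.toLabelled.IsNormalized ∧ S₁.toLabelled.IsHermitian ∧ S₁.toLabelled.HasLinearGrowth ∧ S₁.toLabelled.IsReflectionPositive ∧ S₁.toLabelled.IsSymmetric ∧ S₁.toLabelled.HasClusterProperty) ∧ (∀ (n : ℕ) (a : (EuclideanSpace ℝ (Fin 4))) (F : SchwartzMap (Fin n → (EuclideanSpace ℝ (Fin 4))) ℂ), IsOffDiagonal F → S₁ n (translateMulti a F) = S₁ n F) ∧ (∀ (R : (EuclideanSpace ℝ (Fin 4)) ≃ₗᵢ[ℝ] (EuclideanSpace ℝ (Fin 4))), LinearMap.det (R.toLinearEquiv : (EuclideanSpace ℝ (Fin 4)) →ₗ[ℝ] (EuclideanSpace ℝ (Fin 4))) = 1 → (∀ i : Fin 4, ∃ j : Fin 4, R (EuclideanSpace.single i 1) = EuclideanSpace.single j 1 ∨ R (EuclideanSpace.single i 1) = -EuclideanSpace.single j 1) → ∀ (n : ℕ) (F : SchwartzMap (Fin n → (EuclideanSpace ℝ (Fin 4))) ℂ), IsOffDiagonal F → S₁ n (linActMulti R F) = S₁ n F) ∧ (∃ Δ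 : ℝ, 0 < Δ ∧ S₁.toLabelled.HasMassGap Δ ∧ HasLatticeMassGap r sch Δ)) → ∀ (K : (EuclideanSpace ℝ (Fin 4)) → ℂ), ContinuousOn K {x : (EuclideanSpace ℝ (Fin 4)) | x ≠ 0} → (∀ F : SchwartzMap (Fin 2 → (EuclideanSpace ℝ (Fin 4))) ℂ, IsOffDiagonal F → MeasureTheory.Integrable (fun x : Fin 2 → (EuclideanSpace ℝ (Fin 4)) => K (x 0 - x 1) * F x) ∧ S₁ 2 F = ∫ x : Fin 2 → (EuclideanSpace ℝ (Fin 4)), K (x 0 - x 1) * F x) → ∃ C η : ℝ, 0 < η ∧ ∀ s : ℝ, 0 < s → s ≤ 1 → ‖K (EuclideanSpace.single 0 s)‖ ≤ C * s ^ (η - 10)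

/-- **E′ · AxialGrowthNondegenerate**: E restricted to `W₁`-data whose two-point function does not factorise on some real
off-diagonal tensor. [JaffeWitten2000 §6.5 fn. 2] -/
def AxialGrowthNondegenerate : Prop :=
  open Literature.MathematicalPhysics.QuantumLattice Literature.MathematicalPhysics.AQFT Literature.MathematicalPhysics.QuantumFieldTheory in ∀ (G : Type) [Group G] [TopologicalSpace G] [IsTopologicalGroup G] [CompactSpace G] [MeasurableSpace G] [BorelSpace G], IsCompactSimpleLieGroup G → ∀ (r : LatticeRep G) (sch : SpeciesScheme (YMSpecies G)) (S₁ : SchwingerFamily (EuclideanSpace ℝ (Fin 4))), ((∀ (n : ℕ), n ≠ 0 → ∀ (f : Fin n → SchwartzMap (EuclideanSpace ℝ (Fin 4)) ℝ) (F : SchwartzMap (Fin n → (EuclideanSpace ℝ (Fin 4))) ℂ), IsTensorOf F (fun i => ofRealTest (f i)) → IsOffDiagonal F → Filter.Tendsto (fun k : ℕ => ((latticeSchwinger r.ρ sch (fun s => s.F) k n (fun _ => r.curvature) f : ℝ) : ℂ)) Filter.atTop (nhds (S₁ n F))) ∧ (S₁.toLabelled.IsNormalized ∧ S₁.toLabelled.IsHermitian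 ∧ S₁.toLabelled.HasLinearGrowth ∧ S₁.toLabelled.IsReflectionPositive ∧ S₁.toLabelled.IsSymmetric ∧ S₁.toLabelled.HasClusterProperty) ∧ (∀ (n : ℕ) (a : (EuclideanSpace ℝ (Fin 4))) (F : SchwartzMap (Fin n → (EuclideanSpace ℝ (Fin 4))) ℂ), IsOffDiagonal F → S₁ n (translateMulti a F) = S₁ n F) ∧ (∀ (R : (EuclideanSpace ℝ (Fin 4)) ≃ₗᵢ[ℝ] (EuclideanSpace ℝ (Fin 4))), LinearMap.det (R.toLinearEquiv : (EuclideanSpace ℝ (Fin 4)) →ₗ[ℝ] (EuclideanSpace ℝ (Fin 4))) = 1 → (∀ i : Fin 4, ∃ j : Fin 4, R (EuclideanSpace.single i 1) = EuclideanSpace.single j 1 ∨ R (EuclideanSpace.single i 1) = -EuclideanSpace.single j 1) → ∀ (n : ℕ) (F : SchwartzMap (Fin n → (EuclideanSpace ℝ (Fin 4))) ℂ), IsOffDiagonal F → S₁ n (linActMulti R F) = S₁ n F) ∧ (∃ Δ : ℝ, 0 < Δ ∧ S₁.toLabelled.HasMassGap Δ ∧ HasLatticeMassGap r sch Δ)) →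 (∃ (f : Fin 2 → SchwartzMap (EuclideanSpace ℝ (Fin 4)) ℝ) (F : SchwartzMap (Fin 2 → (EuclideanSpace ℝ (Fin 4))) ℂ) (F₀ F₁ : SchwartzMap (Fin 1 → (EuclideanSpace ℝ (Fin 4))) ℂ), IsTensorOf F (fun i => ofRealTest (f i)) ∧ IsOffDiagonal F ∧ IsTensorOf F₀ (fun _ => ofRealTest (f 0)) ∧ IsTensorOf F₁ (fun _ => ofRealTest (f 1)) ∧ S₁ 2 F ≠ S₁ 1 F₀ * S₁ 1 F₁) → ∀ (K : (EuclideanSpace ℝ (Fin 4)) → ℂ), ContinuousOn K {x : (EuclideanSpace ℝ (Fin 4)) | x ≠ 0} → (∀ F : SchwartzMap (Fin 2 → (EuclideanSpace ℝ (Fin 4))) ℂ, IsOffDiagonal F → MeasureTheory.Integrable (fun x : Fin 2 → (EuclideanSpace ℝ (Fin 4)) => K (x 0 - x 1) * F x) ∧ S₁ 2 F = ∫ x : Fin 2 → (EuclideanSpace ℝ (Fin 4)), K (x 0 - x 1) * F x) → ∃ C η : ℝ, 0 < η ∧ ∀ s : ℝ, 0 < s → s ≤ 1 → ‖K (EuclideanSpace.single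 0 s)‖ ≤ C * s ^ (η - 10)

/-- **E″ · AxialGrowthScaling**: E for `W₁`-data that are non-factorising AND have `|c_k| → ∞` (the scaling branch proper).
No longer a stub in v8: glued from L3 and E‴. [JaffeWitten2000 §6.5 fn. 2; Balaban1989LargeFieldII] -/
def AxialGrowthScaling : Prop :=
  open Literature.MathematicalPhysics.QuantumLattice Literature.MathematicalPhysics.AQFT Literature.MathematicalPhysics.QuantumFieldTheory in ∀ (G : Type) [Group G] [TopologicalSpace G] [IsTopologicalGroup G] [CompactSpace G] [MeasurableSpace G] [BorelSpace G], IsCompactSimpleLieGroup G → ∀ (r : LatticeRep G) (sch : SpeciesScheme (YMSpecies G)) (S₁ : SchwingerFamily (EuclideanSpace ℝ (Fin 4))), ((∀ (n : ℕ), n ≠ 0 → ∀ (f : Fin n → SchwartzMap (EuclideanSpace ℝ (Fin 4)) ℝ) (F : SchwartzMap (Fin n → (EuclideanSpace ℝ (Fin 4))) ℂ), IsTensorOf F (fun i => ofRealTest (f i)) → IsOffDiagonal F → Filter.Tendsto (fun k : ℕ => ((latticeSchwinger r.ρ sch (fun s => s.F) k n (fun _ => r.curvature) f : ℝ) : ℂ))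 Filter.atTop (nhds (S₁ n F))) ∧ (S₁.toLabelled.IsNormalized ∧ S₁.toLabelled.IsHermitian ∧ S₁.toLabelled.HasLinearGrowth ∧ S₁.toLabelled.IsReflectionPositive ∧ S₁.toLabelled.IsSymmetric ∧ S₁.toLabelled.HasClusterProperty) ∧ (∀ (n : ℕ) (a : (EuclideanSpace ℝ (Fin 4))) (F : SchwartzMap (Fin n → (EuclideanSpace ℝ (Fin 4))) ℂ), IsOffDiagonal F → S₁ n (translateMulti a F) = S₁ n F) ∧ (∀ (R : (EuclideanSpace ℝ (Fin 4)) ≃ₗᵢ[ℝ] (EuclideanSpace ℝ (Fin 4))), LinearMap.det (R.toLinearEquiv : (EuclideanSpace ℝ (Fin 4)) →ₗ[ℝ] (EuclideanSpace ℝ (Fin 4))) = 1 → (∀ i : Fin 4, ∃ j : Fin 4, R (EuclideanSpace.single i 1) = EuclideanSpace.single j 1 ∨ R (EuclideanSpace.single i 1) = -EuclideanSpace.single j 1) → ∀ (n : ℕ) (F : SchwartzMap (Fin n → (EuclideanSpace ℝ (Fin 4))) ℂ), IsOffDiagonal F → S₁ n (linActMulti R F) = S₁ n F) ∧ (∃ Δ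 : ℝ, 0 < Δ ∧ S₁.toLabelled.HasMassGap Δ ∧ HasLatticeMassGap r sch Δ)) → (∃ (f : Fin 2 → SchwartzMap (EuclideanSpace ℝ (Fin 4)) ℝ) (F : SchwartzMap (Fin 2 → (EuclideanSpace ℝ (Fin 4))) ℂ) (F₀ F₁ : SchwartzMap (Fin 1 → (EuclideanSpace ℝ (Fin 4))) ℂ), IsTensorOf F (fun i => ofRealTest (f i)) ∧ IsOffDiagonal F ∧ IsTensorOf F₀ (fun _ => ofRealTest (f 0)) ∧ IsTensorOf F₁ (fun _ => ofRealTest (f 1)) ∧ S₁ 2 F ≠ S₁ 1 F₀ * S₁ 1 F₁) → Filter.Tendsto (fun k : ℕ => |sch.c r.curvature k|) Filter.atTop Filter.atTop → ∀ (K : (EuclideanSpace ℝ (Fin 4)) → ℂ), ContinuousOn K {x : (EuclideanSpace ℝ (Fin 4)) | x ≠ 0} → (∀ F : SchwartzMap (Fin 2 → (EuclideanSpace ℝ (Fin 4))) ℂ, IsOffDiagonal F → MeasureTheory.Integrable (fun x : Fin 2 → (EuclideanSpace ℝ (Fin 4)) => K (x 0 - x 1) * F x) ∧ S₁ 2 F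 = ∫ x : Fin 2 → (EuclideanSpace ℝ (Fin 4)), K (x 0 - x 1) * F x) → ∃ C η : ℝ, 0 < η ∧ ∀ s : ℝ, 0 < s → s ≤ 1 → ‖K (EuclideanSpace.single 0 s)‖ ≤ C * s ^ (η - 10)

/-- **L3 · LatticeWindowTransfer** (provable now, size M–L; the lead's stub). `W₁` and a frequent-in-`k`, `k`-uniform window
bound `c_k² |Cov_k(Q_x,Q_y)| ≤ C (a_k‖x−y‖)^(η−10)` (`R₀ ≤ ‖x−y‖`, `a_k‖x−y‖ ≤ θ`) on the truncated plaquette covariance of Wilson's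
torus measure imply the axial bound for every continuous kernel representing `S₁ 2` on `⁰𝒮`. [folklore] -/
def LatticeWindowTransfer : Prop :=
  open Literature.MathematicalPhysics.QuantumLattice Literature.MathematicalPhysics.AQFT Literature.MathematicalPhysics.QuantumFieldTheory in ∀ (G : Type) [Group G] [TopologicalSpace G] [IsTopologicalGroup G] [CompactSpace G] [MeasurableSpace G] [BorelSpace G], IsCompactSimpleLieGroup G → ∀ (r : LatticeRep G) (sch : SpeciesScheme (YMSpecies G)) (S₁ : SchwingerFamily (EuclideanSpace ℝ (Fin 4))), ((∀ (n : ℕ), n ≠ 0 → ∀ (f : Fin n → SchwartzMap (EuclideanSpace ℝ (Fin 4)) ℝ) (F : SchwartzMap (Fin n → (EuclideanSpace ℝ (Fin 4))) ℂ), IsTensorOf F (fun i => ofRealTest (f i)) → IsOffDiagonal F → Filter.Tendsto (fun k : ℕ => ((latticeSchwinger r.ρ sch (fun s => s.F) k n (fun _ => r.curvature) f : ℝ) : ℂ)) Filter.atTop (nhds (S₁ n F))) ∧ (S₁.toLabelled.IsNormalized ∧ S₁.toLabelled.IsHermitian ∧ S₁.toLabelled.HasLinearGrowth ∧ S₁.toLabelled.IsReflectionPositive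 ∧ S₁.toLabelled.IsSymmetric ∧ S₁.toLabelled.HasClusterProperty) ∧ (∀ (n : ℕ) (a : (EuclideanSpace ℝ (Fin 4))) (F : SchwartzMap (Fin n → (EuclideanSpace ℝ (Fin 4))) ℂ), IsOffDiagonal F → S₁ n (translateMulti a F) = S₁ n F) ∧ (∀ (R : (EuclideanSpace ℝ (Fin 4)) ≃ₗᵢ[ℝ] (EuclideanSpace ℝ (Fin 4))), LinearMap.det (R.toLinearEquiv : (EuclideanSpace ℝ (Fin 4)) →ₗ[ℝ] (EuclideanSpace ℝ (Fin 4))) = 1 → (∀ i : Fin 4, ∃ j : Fin 4, R (EuclideanSpace.single i 1) = EuclideanSpace.single j 1 ∨ R (EuclideanSpace.single i 1) = -EuclideanSpace.single j 1) → ∀ (n : ℕ) (F : SchwartzMap (Fin n → (EuclideanSpace ℝ (Fin 4))) ℂ), IsOffDiagonal F → S₁ n (linActMulti R F) = S₁ n F) ∧ (∃ Δ : ℝ, 0 < Δ ∧ S₁.toLabelled.HasMassGap Δ ∧ HasLatticeMassGap r sch Δ)) → (∃ (C η θ R₀ : ℝ), 0 < η ∧ 0 < θ ∧ ∃ᶠ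 k in Filter.atTop, ∀ x y : Literature.Probability.LatticeModels.Site 4, x ∈ Literature.Probability.LatticeModels.box 4 (sch.L k) → y ∈ Literature.Probability.LatticeModels.box 4 (sch.L k) → R₀ ≤ ‖siteToE x - siteToE y‖ → sch.a k * ‖siteToE x - siteToE y‖ ≤ θ → (sch.c r.curvature k) ^ 2 * |(∫ U, r.curvature.F (configShift (-x) (torusLift (sch.side k) U)) * r.curvature.F (configShift (-y) (torusLift (sch.side k) U)) ∂(wilsonMeasure r.ρ (sch.β k) : MeasureTheory.Measure (GaugeConfig 4 (sch.side k) G))) - (∫ U, r.curvature.F (configShift (-x) (torusLift (sch.side k) U)) ∂(wilsonMeasure r.ρ (sch.β k) : MeasureTheory.Measure (GaugeConfig 4 (sch.side k) G))) * (∫ U, r.curvature.F (configShift (-y) (torusLift (sch.side k) U)) ∂(wilsonMeasure r.ρ (sch.β k) : MeasureTheory.Measure (GaugeConfig 4 (sch.side k) G)))| ≤ C * (sch.a k * ‖siteToE x - siteToE y‖) ^ (η - 10)) → ∀ (K : (EuclideanSpace ℝ (Fin 4)) → ℂ), ContinuousOn K {x : (EuclideanSpace ℝ (Fin 4)) | x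 ≠ 0} → (∀ F : SchwartzMap (Fin 2 → (EuclideanSpace ℝ (Fin 4))) ℂ, IsOffDiagonal F → MeasureTheory.Integrable (fun x : Fin 2 → (EuclideanSpace ℝ (Fin 4)) => K (x 0 - x 1) * F x) ∧ S₁ 2 F = ∫ x : Fin 2 → (EuclideanSpace ℝ (Fin 4)), K (x 0 - x 1) * F x) → ∃ C η : ℝ, 0 < η ∧ ∀ s : ℝ, 0 < s → s ≤ 1 → ‖K (EuclideanSpace.single 0 s)‖ ≤ C * s ^ (η - 10)

/-- **E‴ · LatticeWindowBound** (YM-specific; the OPEN core after v8): for non-factorising `W₁`-data with `|c_k| → ∞`, the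
renormalised truncated plaquette covariance of Wilson's torus measure obeys, frequently in `k`, the uniform window bound
`c_k² |Cov_k(Q_x,Q_y)| ≤ C (a_k‖x−y‖)^(η−10)` for `R₀ ≤ ‖x−y‖`, `a_k‖x−y‖ ≤ θ` — a short-distance estimate on 4D lattice
Yang–Mills through the whole scaling window at `β_k → ∞` (asymptotic freedom predicts `η = 2`).
[JaffeWitten2000 §6.5 fn. 2; Balaban1989LargeFieldII; MagnenRivasseauSeneor1993] -/
def LatticeWindowBound : Prop :=
  open Literature.MathematicalPhysics.QuantumLattice Literature.MathematicalPhysics.AQFT Literature.MathematicalPhysics.QuantumFieldTheory in ∀ (G : Type) [Group G] [TopologicalSpace G] [IsTopologicalGroup G] [CompactSpace G] [MeasurableSpace G] [BorelSpace G], IsCompactSimpleLieGroup G → ∀ (r : LatticeRep G) (sch : SpeciesScheme (YMSpecies G)) (S₁ : SchwingerFamily (EuclideanSpace ℝ (Fin 4))), ((∀ (n : ℕ), n ≠ 0 → ∀ (f : Fin n → SchwartzMap (EuclideanSpace ℝ (Fin 4)) ℝ) (F : SchwartzMap (Fin n → (EuclideanSpace ℝ (Fin 4))) ℂ), IsTensorOf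 F (fun i => ofRealTest (f i)) → IsOffDiagonal F → Filter.Tendsto (fun k : ℕ => ((latticeSchwinger r.ρ sch (fun s => s.F) k n (fun _ => r.curvature) f : ℝ) : ℂ)) Filter.atTop (nhds (S₁ n F))) ∧ (S₁.toLabelled.IsNormalized ∧ S₁.toLabelled.IsHermitian ∧ S₁.toLabelled.HasLinearGrowth ∧ S₁.toLabelled.IsReflectionPositive ∧ S₁.toLabelled.IsSymmetric ∧ S₁.toLabelled.HasClusterProperty) ∧ (∀ (n : ℕ) (a : (EuclideanSpace ℝ (Fin 4))) (F : SchwartzMap (Fin n → (EuclideanSpace ℝ (Fin 4))) ℂ), IsOffDiagonal F → S₁ n (translateMulti a F) = S₁ n F) ∧ (∀ (R : (EuclideanSpace ℝ (Fin 4)) ≃ₗᵢ[ℝ] (EuclideanSpace ℝ (Fin 4))), LinearMap.det (R.toLinearEquiv : (EuclideanSpace ℝ (Fin 4)) →ₗ[ℝ] (EuclideanSpace ℝ (Fin 4))) = 1 → (∀ i : Fin 4, ∃ j : Fin 4, R (EuclideanSpace.single i 1) = EuclideanSpace.single j 1 ∨ R (EuclideanSpace.single i 1) = -EuclideanSpace.single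 j 1) → ∀ (n : ℕ) (F : SchwartzMap (Fin n → (EuclideanSpace ℝ (Fin 4))) ℂ), IsOffDiagonal F → S₁ n (linActMulti R F) = S₁ n F) ∧ (∃ Δ : ℝ, 0 < Δ ∧ S₁.toLabelled.HasMassGap Δ ∧ HasLatticeMassGap r sch Δ)) → (∃ (f : Fin 2 → SchwartzMap (EuclideanSpace ℝ (Fin 4)) ℝ) (F : SchwartzMap (Fin 2 → (EuclideanSpace ℝ (Fin 4))) ℂ) (F₀ F₁ : SchwartzMap (Fin 1 → (EuclideanSpace ℝ (Fin 4))) ℂ), IsTensorOf F (fun i => ofRealTest (f i)) ∧ IsOffDiagonal F ∧ IsTensorOf F₀ (fun _ => ofRealTest (f 0)) ∧ IsTensorOf F₁ (fun _ => ofRealTest (f 1)) ∧ S₁ 2 F ≠ S₁ 1 F₀ * S₁ 1 F₁) → Filter.Tendsto (fun k : ℕ => |sch.c r.curvature k|) Filter.atTop Filter.atTop → (∃ (C η θ R₀ : ℝ), 0 < η ∧ 0 < θ ∧ ∃ᶠ k in Filter.atTop, ∀ x y : Literature.Probability.LatticeModels.Site 4, x ∈ Literature.Probability.LatticeModels.box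 4 (sch.L k) → y ∈ Literature.Probability.LatticeModels.box 4 (sch.L k) → R₀ ≤ ‖siteToE x - siteToE y‖ → sch.a k * ‖siteToE x - siteToE y‖ ≤ θ → (sch.c r.curvature k) ^ 2 * |(∫ U, r.curvature.F (configShift (-x) (torusLift (sch.side k) U)) * r.curvature.F (configShift (-y) (torusLift (sch.side k) U)) ∂(wilsonMeasure r.ρ (sch.β k) : MeasureTheory.Measure (GaugeConfig 4 (sch.side k) G))) - (∫ U, r.curvature.F (configShift (-x) (torusLift (sch.side k) U)) ∂(wilsonMeasure r.ρ (sch.β k) : MeasureTheory.Measure (GaugeConfig 4 (sch.side k) G))) * (∫ U, r.curvature.F (configShift (-y) (torusLift (sch.side k) U)) ∂(wilsonMeasure r.ρ (sch.β k) : MeasureTheory.Measure (GaugeConfig 4 (sch.side k) G)))| ≤ C * (sch.a k * ‖siteToE x - siteToE y‖) ^ (η - 10))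

/-- **E‴₁ · LatticeKernelWindowBound** (YM-specific; the OPEN core after v9, ONE lattice variable): for non-factorising `W₁`-data with
`|c_k| → ∞`, frequently in `k`, `c_k² |Cov_k(Q_0, Q_z)| ≤ C (a_k‖z‖)^(η−10)` for every `z ≠ 0` in the box with `R₀ ≤ ‖z‖`,
`a_k‖z‖ ≤ θ` — `Q_0 = r.curvature.F ∘ torusLift`, `Q_z = r.curvature.F ∘ configShift (−z) ∘ torusLift`, Wilson's torus measure at
step `k`. [JaffeWitten2000 §6.5 fn. 2; Balaban1989LargeFieldII; MagnenRivasseauSeneor1993] -/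
def LatticeKernelWindowBound : Prop :=
  open Literature.MathematicalPhysics.QuantumLattice Literature.MathematicalPhysics.AQFT Literature.MathematicalPhysics.QuantumFieldTheory in ∀ (G : Type) [Group G] [TopologicalSpace G] [IsTopologicalGroup G] [CompactSpace G] [MeasurableSpace G] [BorelSpace G], IsCompactSimpleLieGroup G → ∀ (r : LatticeRep G) (sch : SpeciesScheme (YMSpecies G)) (S₁ : SchwingerFamily (EuclideanSpace ℝ (Fin 4))), ((∀ (n : ℕ), n ≠ 0 → ∀ (f : Fin n → SchwartzMap (EuclideanSpace ℝ (Fin 4)) ℝ) (F : SchwartzMap (Fin n → (EuclideanSpace ℝ (Fin 4))) ℂ), IsTensorOf F (fun i => ofRealTest (f i)) → IsOffDiagonal F → Filter.Tendsto (fun k : ℕ => ((latticeSchwinger r.ρ sch (fun s => s.F) k n (fun _ => r.curvature) f : ℝ) : ℂ)) Filter.atTop (nhds (S₁ n F))) ∧ (S₁.toLabelled.IsNormalized ∧ S₁.toLabelled.IsHermitian ∧ S₁.toLabelled.HasLinearGrowth ∧ S₁.toLabelled.IsReflectionPositive ∧ S₁.toLabelled.IsSymmetric ∧ S₁.toLabelled.HasClusterProperty)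 ∧ (∀ (n : ℕ) (a : (EuclideanSpace ℝ (Fin 4))) (F : SchwartzMap (Fin n → (EuclideanSpace ℝ (Fin 4))) ℂ), IsOffDiagonal F → S₁ n (translateMulti a F) = S₁ n F) ∧ (∀ (R : (EuclideanSpace ℝ (Fin 4)) ≃ₗᵢ[ℝ] (EuclideanSpace ℝ (Fin 4))), LinearMap.det (R.toLinearEquiv : (EuclideanSpace ℝ (Fin 4)) →ₗ[ℝ] (EuclideanSpace ℝ (Fin 4))) = 1 → (∀ i : Fin 4, ∃ j : Fin 4, R (EuclideanSpace.single i 1) = EuclideanSpace.single j 1 ∨ R (EuclideanSpace.single i 1) = -EuclideanSpace.single j 1) → ∀ (n : ℕ) (F : SchwartzMap (Fin n → (EuclideanSpace ℝ (Fin 4))) ℂ), IsOffDiagonal F → S₁ n (linActMulti R F) = S₁ n F) ∧ (∃ Δ : ℝ, 0 < Δ ∧ S₁.toLabelled.HasMassGap Δ ∧ HasLatticeMassGap r sch Δ)) → (∃ (f : Fin 2 → SchwartzMap (EuclideanSpace ℝ (Fin 4)) ℝ) (F : SchwartzMap (Fin 2 → (EuclideanSpace ℝ (Fin 4))) ℂ)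 (F₀ F₁ : SchwartzMap (Fin 1 → (EuclideanSpace ℝ (Fin 4))) ℂ), IsTensorOf F (fun i => ofRealTest (f i)) ∧ IsOffDiagonal F ∧ IsTensorOf F₀ (fun _ => ofRealTest (f 0)) ∧ IsTensorOf F₁ (fun _ => ofRealTest (f 1)) ∧ S₁ 2 F ≠ S₁ 1 F₀ * S₁ 1 F₁) → Filter.Tendsto (fun k : ℕ => |sch.c r.curvature k|) Filter.atTop Filter.atTop → (∃ (C η θ R₀ : ℝ), 0 < η ∧ 0 < θ ∧ ∃ᶠ k in Filter.atTop, ∀ z : Literature.Probability.LatticeModels.Site 4, z ∈ Literature.Probability.LatticeModels.box 4 (sch.L k) → z ≠ 0 → R₀ ≤ ‖siteToE z‖ → sch.a k * ‖siteToE z‖ ≤ θ → (sch.c r.curvature k) ^ 2 * |(∫ U, r.curvature.F (torusLift (sch.side k) U) * r.curvature.F (configShift (-z) (torusLift (sch.side k) U)) ∂(wilsonMeasure r.ρ (sch.β k) : MeasureTheory.Measure (GaugeConfig 4 (sch.side k) G))) - (∫ U, r.curvature.F (torusLift (sch.side k) U) ∂(wilsonMeasure r.ρ (sch.β k) : MeasureTheory.Measure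 (GaugeConfig 4 (sch.side k) G))) * (∫ U, r.curvature.F (configShift (-z) (torusLift (sch.side k) U)) ∂(wilsonMeasure r.ρ (sch.β k) : MeasureTheory.Measure (GaugeConfig 4 (sch.side k) G)))| ≤ C * (sch.a k * ‖siteToE z‖) ^ (η - 10))

/-- **Glue · LatticeWindowPairOfOne** (LANDED p111636): the one-variable window bound implies the pair form (torus translation
invariance of Wilson's state in lifted form). [folklore] -/
def LatticeWindowPairOfOne : Prop :=
  open Literature.MathematicalPhysics.QuantumLattice Literature.MathematicalPhysics.AQFT Literature.MathematicalPhysics.QuantumFieldTheory in ∀ (G : Type) [Group G] [TopologicalSpace G] [IsTopologicalGroup G] [CompactSpace G] [MeasurableSpace G] [BorelSpace G] (r : LatticeRep G) (sch : SpeciesScheme (YMSpecies G)), (∃ (C η θ R₀ : ℝ), 0 < η ∧ 0 < θ ∧ ∃ᶠ k in Filter.atTop, ∀ z : Literature.Probability.LatticeModels.Site 4, z ∈ Literature.Probability.LatticeModels.box 4 (sch.L k) → z ≠ 0 → R₀ ≤ ‖siteToE z‖ → sch.a k * ‖siteToE z‖ ≤ θ → (sch.c r.curvature k) ^ 2 *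 |(∫ U, r.curvature.F (torusLift (sch.side k) U) * r.curvature.F (configShift (-z) (torusLift (sch.side k) U)) ∂(wilsonMeasure r.ρ (sch.β k) : MeasureTheory.Measure (GaugeConfig 4 (sch.side k) G))) - (∫ U, r.curvature.F (torusLift (sch.side k) U) ∂(wilsonMeasure r.ρ (sch.β k) : MeasureTheory.Measure (GaugeConfig 4 (sch.side k) G))) * (∫ U, r.curvature.F (configShift (-z) (torusLift (sch.side k) U)) ∂(wilsonMeasure r.ρ (sch.β k) : MeasureTheory.Measure (GaugeConfig 4 (sch.side k) G)))| ≤ C * (sch.a k * ‖siteToE z‖) ^ (η - 10)) → (∃ (C η θ R₀ : ℝ), 0 < η ∧ 0 < θ ∧ ∃ᶠ k in Filter.atTop, ∀ x y : Literature.Probability.LatticeModels.Site 4, x ∈ Literature.Probability.LatticeModels.box 4 (sch.L k) → y ∈ Literature.Probability.LatticeModels.box 4 (sch.L k) → R₀ ≤ ‖siteToE x - siteToE y‖ → sch.a k * ‖siteToE x - siteToE y‖ ≤ θ → (sch.c r.curvature k) ^ 2 * |(∫ U, r.curvature.F (configShift (-x) (torusLift (sch.side k) U)) * r.curvature.F (configShift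 (-y) (torusLift (sch.side k) U)) ∂(wilsonMeasure r.ρ (sch.β k) : MeasureTheory.Measure (GaugeConfig 4 (sch.side k) G))) - (∫ U, r.curvature.F (configShift (-x) (torusLift (sch.side k) U)) ∂(wilsonMeasure r.ρ (sch.β k) : MeasureTheory.Measure (GaugeConfig 4 (sch.side k) G))) * (∫ U, r.curvature.F (configShift (-y) (torusLift (sch.side k) U)) ∂(wilsonMeasure r.ρ (sch.β k) : MeasureTheory.Measure (GaugeConfig 4 (sch.side k) G)))| ≤ C * (sch.a k * ‖siteToE x - siteToE y‖) ^ (η - 10))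


/-! ## v11 statements (the D-free transfer) -/

/-- **P · PartitionBump** (pure analysis, provable now): an exact smooth partition of unity on `ℝ⁴` by integer translates of ONE
bump `ϖ = Π_μ ψ(x_μ)`, `ψ(t) = smoothTransition (t+1) − smoothTransition t` (telescoping). [folklore] -/
def PartitionBump : Prop :=
  (∃ ϖ : (EuclideanSpace ℝ (Fin 4)) → ℝ, ContDiff ℝ (⊤ : ℕ∞) ϖ ∧ (∀ x, 0 ≤ ϖ x) ∧ (∀ x, ϖ x ≤ 1) ∧ tsupport ϖ ⊆ Metric.closedBall (0 : (EuclideanSpace ℝ (Fin 4))) 2 ∧ 0 < ∫ x, ϖ x ∧ (∀ (N : ℕ) (y : (EuclideanSpace ℝ (Fin 4))), ∑ j ∈ Fintype.piFinset (fun _ : Fin 4 => Finset.Icc (-(N : ℤ)) N), ϖ (y - WithLp.toLp 2 (fun i => ((j i : ℤ) : ℝ))) ≤ 1) ∧ (∀ (N : ℕ) (y : (EuclideanSpace ℝ (Fin 4))), (∀ i : Fin 4, |y i| ≤ N) → ∑ j ∈ Fintype.piFinset (fun _ : Fin 4 => Finset.Icc (-(N : ℤ)) N), ϖ (y - WithLp.toLp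 2 (fun i => ((j i : ℤ) : ℝ))) = 1))

/-- **H · HalfSpaceKernel** (the T-core; provable now, the lead's stub): axis RP + translations + local two-point bounds near the
time axis at every base height `s ∈ (0,s₁)` ⇒ ONE kernel `K`, continuous on `{ξ₀ < 0}`, bounded on `{ξ₀ ≤ -2s}` by the constants at
height `s`, representing `S₁ 2` on complex tensors supported near every configuration `(z₀, z₁)` with `z₀⁰ < 0 < z₁⁰`. [OsterwalderSchrader1973 §4; folklore] -/
def HalfSpaceKernel : Prop :=
  open Literature.MathematicalPhysics.QuantumLattice Literature.MathematicalPhysics.AQFT Literature.MathematicalPhysics.QuantumFieldTheory in ∀ (S₁ : SchwingerFamily (EuclideanSpace ℝ (Fin 4))), S₁.toLabelled.IsReflectionPositive → (∀ (n : ℕ) (a : (EuclideanSpace ℝ (Fin 4))) (F : SchwartzMap (Fin n → (EuclideanSpace ℝ (Fin 4))) ℂ), IsOffDiagonal F → S₁ n (translateMulti a F) = S₁ n F) → ∀ (s₁ : ℝ), 0 < s₁ → (∀ (s : ℝ), 0 < s → s < s₁ → ∃ (r₀ A B : ℝ), 0 < r₀ ∧ 0 ≤ A ∧ 0 ≤ B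 ∧ (∀ (r : ℝ), 0 < r → r ≤ r₀ → ∀ (f : Fin 2 → SchwartzMap (EuclideanSpace ℝ (Fin 4)) ℝ) (F : SchwartzMap (Fin 2 → (EuclideanSpace ℝ (Fin 4))) ℂ) (M₀ M₁ : ℝ), IsTensorOf F (fun i => ofRealTest (f i)) → tsupport ((f 0 : SchwartzMap (EuclideanSpace ℝ (Fin 4)) ℝ) : (EuclideanSpace ℝ (Fin 4)) → ℝ) ⊆ Metric.closedBall (EuclideanSpace.single (0 : Fin 4) (-s)) r → tsupport ((f 1 : SchwartzMap (EuclideanSpace ℝ (Fin 4)) ℝ) : (EuclideanSpace ℝ (Fin 4)) → ℝ) ⊆ Metric.closedBall (EuclideanSpace.single (0 : Fin 4) s) r → (∀ x, |f 0 x| ≤ M₀) → (∀ x, |f 1 x| ≤ M₁) → ‖S₁ 2 F‖ ≤ A * (∫ x : (EuclideanSpace ℝ (Fin 4)), |f 0 x|) * (∫ x : (EuclideanSpace ℝ (Fin 4)), |f 1 x|) + B * r ^ 8 * M₀ * M₁)) → ∃ (K : (EuclideanSpace ℝ (Fin 4)) → ℂ) (c₀ : ℝ), 0 ≤ c₀ ∧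 ContinuousOn K {ξ : (EuclideanSpace ℝ (Fin 4)) | ξ 0 < 0} ∧ (∀ (s r₀ A B : ℝ), 0 < s → s < s₁ → 0 < r₀ → 0 ≤ A → 0 ≤ B → (∀ (r : ℝ), 0 < r → r ≤ r₀ → ∀ (f : Fin 2 → SchwartzMap (EuclideanSpace ℝ (Fin 4)) ℝ) (F : SchwartzMap (Fin 2 → (EuclideanSpace ℝ (Fin 4))) ℂ) (M₀ M₁ : ℝ), IsTensorOf F (fun i => ofRealTest (f i)) → tsupport ((f 0 : SchwartzMap (EuclideanSpace ℝ (Fin 4)) ℝ) : (EuclideanSpace ℝ (Fin 4)) → ℝ) ⊆ Metric.closedBall (EuclideanSpace.single (0 : Fin 4) (-s)) r → tsupport ((f 1 : SchwartzMap (EuclideanSpace ℝ (Fin 4)) ℝ) : (EuclideanSpace ℝ (Fin 4)) → ℝ) ⊆ Metric.closedBall (EuclideanSpace.single (0 : Fin 4) s) r → (∀ x, |f 0 x| ≤ M₀) → (∀ x, |f 1 x| ≤ M₁) → ‖S₁ 2 F‖ ≤ A * (∫ x : (EuclideanSpace ℝ (Fin 4)), |f 0 x|) * (∫ x : (EuclideanSpace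 ℝ (Fin 4)), |f 1 x|) + B * r ^ 8 * M₀ * M₁) → ∀ ξ : (EuclideanSpace ℝ (Fin 4)), ξ 0 ≤ -(2 * s) → ‖K ξ‖ ≤ A + c₀ * B) ∧ (∀ z : Fin 2 → (EuclideanSpace ℝ (Fin 4)), z 0 0 < 0 → 0 < z 1 0 → ∃ r : ℝ, 0 < r ∧ ∀ (f g : SchwartzMap (EuclideanSpace ℝ (Fin 4)) ℂ), tsupport (f : (EuclideanSpace ℝ (Fin 4)) → ℂ) ⊆ Metric.ball (z 0) r → tsupport (g : (EuclideanSpace ℝ (Fin 4)) → ℂ) ⊆ Metric.ball (z 1) r → ∀ F : SchwartzMap (Fin 2 → (EuclideanSpace ℝ (Fin 4))) ℂ, IsTensorOf F ![f, g] → MeasureTheory.Integrable (fun x : Fin 2 → (EuclideanSpace ℝ (Fin 4)) => K (x 0 - x 1) * F x) ∧ S₁ 2 F = ∫ x : Fin 2 → (EuclideanSpace ℝ (Fin 4)), K (x 0 - x 1) * F x)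

/-- **R · LocalRepresentation** (pure analysis, provable now): a CLM represented by a continuous kernel on the complex tensors supported in
a pair of balls is represented by it on every test function supported near the centre (`TensorRegularity` + pinning). [folklore] -/
def LocalRepresentation : Prop :=
  open Literature.MathematicalPhysics.QuantumLattice Literature.MathematicalPhysics.AQFT Literature.MathematicalPhysics.QuantumFieldTheory in ∀ (T : SchwartzMap (Fin 2 → (EuclideanSpace ℝ (Fin 4))) ℂ →L[ℂ] ℂ) (K : (EuclideanSpace ℝ (Fin 4)) → ℂ) (W : Set (EuclideanSpace ℝ (Fin 4))), IsOpen W → ContinuousOn K W → ∀ (z : Fin 2 → (EuclideanSpace ℝ (Fin 4))) (r : ℝ), 0 < r → (∀ x y : (EuclideanSpace ℝ (Fin 4)), x ∈ Metric.ball (z 0) r → y ∈ Metric.ball (z 1) r → x - y ∈ W) → (∀ (f g : SchwartzMap (EuclideanSpace ℝ (Fin 4)) ℂ), tsupport (f : (EuclideanSpace ℝ (Fin 4)) → ℂ) ⊆ Metric.ball (z 0) r → tsupport (g : (EuclideanSpace ℝ (Fin 4)) → ℂ) ⊆ Metric.ball (z 1) r → ∀ F : SchwartzMap (Fin 2 →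 (EuclideanSpace ℝ (Fin 4))) ℂ, IsTensorOf F ![f, g] → MeasureTheory.Integrable (fun x : Fin 2 → (EuclideanSpace ℝ (Fin 4)) => K (x 0 - x 1) * F x) ∧ T F = ∫ x : Fin 2 → (EuclideanSpace ℝ (Fin 4)), K (x 0 - x 1) * F x) → ∃ O : Set (Fin 2 → (EuclideanSpace ℝ (Fin 4))), IsOpen O ∧ z ∈ O ∧ ∀ F : SchwartzMap (Fin 2 → (EuclideanSpace ℝ (Fin 4))) ℂ, tsupport (F : (Fin 2 → (EuclideanSpace ℝ (Fin 4))) → ℂ) ⊆ O → MeasureTheory.Integrable (fun x : Fin 2 → (EuclideanSpace ℝ (Fin 4)) => K (x 0 - x 1) * F x) ∧ T F = ∫ x : Fin 2 → (EuclideanSpace ℝ (Fin 4)), K (x 0 - x 1) * F x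

/-- **X · KernelExistence** (provable now): H + R + proper signed permutations + polynomially controlled local bounds ⇒ a kernel
continuous on `ℝ⁴∖0` representing `S₁ 2` on all of `⁰𝒮₂` (frames, evenness, `LocalKernelPatching`, `OffDiagonalExtension`). [folklore] -/
def KernelExistence : Prop :=
  open Literature.MathematicalPhysics.QuantumLattice Literature.MathematicalPhysics.AQFT Literature.MathematicalPhysics.QuantumFieldTheory in (∀ (S₁ : SchwingerFamily (EuclideanSpace ℝ (Fin 4))), S₁.toLabelled.IsReflectionPositive → (∀ (n : ℕ) (a : (EuclideanSpace ℝ (Fin 4))) (F : SchwartzMap (Fin n → (EuclideanSpace ℝ (Fin 4))) ℂ), IsOffDiagonal F → S₁ n (translateMulti a F) = S₁ n F) → ∀ (s₁ : ℝ), 0 < s₁ → (∀ (s : ℝ), 0 < s → s < s₁ → ∃ (r₀ A B : ℝ), 0 < r₀ ∧ 0 ≤ A ∧ 0 ≤ B ∧ (∀ (r : ℝ), 0 < r → r ≤ r₀ → ∀ (f : Fin 2 → SchwartzMap (EuclideanSpace ℝ (Fin 4)) ℝ) (F : SchwartzMap (Fin 2 → (EuclideanSpace ℝ (Fin 4)))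 ℂ) (M₀ M₁ : ℝ), IsTensorOf F (fun i => ofRealTest (f i)) → tsupport ((f 0 : SchwartzMap (EuclideanSpace ℝ (Fin 4)) ℝ) : (EuclideanSpace ℝ (Fin 4)) → ℝ) ⊆ Metric.closedBall (EuclideanSpace.single (0 : Fin 4) (-s)) r → tsupport ((f 1 : SchwartzMap (EuclideanSpace ℝ (Fin 4)) ℝ) : (EuclideanSpace ℝ (Fin 4)) → ℝ) ⊆ Metric.closedBall (EuclideanSpace.single (0 : Fin 4) s) r → (∀ x, |f 0 x| ≤ M₀) → (∀ x, |f 1 x| ≤ M₁) → ‖S₁ 2 F‖ ≤ A * (∫ x : (EuclideanSpace ℝ (Fin 4)), |f 0 x|) * (∫ x : (EuclideanSpace ℝ (Fin 4)), |f 1 x|) + B * r ^ 8 * M₀ * M₁)) → ∃ (K : (EuclideanSpace ℝ (Fin 4)) → ℂ) (c₀ : ℝ), 0 ≤ c₀ ∧ ContinuousOn K {ξ : (EuclideanSpace ℝ (Fin 4)) | ξ 0 < 0} ∧ (∀ (s r₀ A B : ℝ), 0 < s → s < s₁ → 0 < r₀ → 0 ≤ A → 0 ≤ B → (∀ (r :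 ℝ), 0 < r → r ≤ r₀ → ∀ (f : Fin 2 → SchwartzMap (EuclideanSpace ℝ (Fin 4)) ℝ) (F : SchwartzMap (Fin 2 → (EuclideanSpace ℝ (Fin 4))) ℂ) (M₀ M₁ : ℝ), IsTensorOf F (fun i => ofRealTest (f i)) → tsupport ((f 0 : SchwartzMap (EuclideanSpace ℝ (Fin 4)) ℝ) : (EuclideanSpace ℝ (Fin 4)) → ℝ) ⊆ Metric.closedBall (EuclideanSpace.single (0 : Fin 4) (-s)) r → tsupport ((f 1 : SchwartzMap (EuclideanSpace ℝ (Fin 4)) ℝ) : (EuclideanSpace ℝ (Fin 4)) → ℝ) ⊆ Metric.closedBall (EuclideanSpace.single (0 : Fin 4) s) r → (∀ x, |f 0 x| ≤ M₀) → (∀ x, |f 1 x| ≤ M₁) → ‖S₁ 2 F‖ ≤ A * (∫ x : (EuclideanSpace ℝ (Fin 4)), |f 0 x|) * (∫ x : (EuclideanSpace ℝ (Fin 4)), |f 1 x|) + B * r ^ 8 * M₀ * M₁) → ∀ ξ : (EuclideanSpace ℝ (Fin 4)), ξ 0 ≤ -(2 * s) → ‖K ξ‖ ≤ A + c₀ *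 B) ∧ (∀ z : Fin 2 → (EuclideanSpace ℝ (Fin 4)), z 0 0 < 0 → 0 < z 1 0 → ∃ r : ℝ, 0 < r ∧ ∀ (f g : SchwartzMap (EuclideanSpace ℝ (Fin 4)) ℂ), tsupport (f : (EuclideanSpace ℝ (Fin 4)) → ℂ) ⊆ Metric.ball (z 0) r → tsupport (g : (EuclideanSpace ℝ (Fin 4)) → ℂ) ⊆ Metric.ball (z 1) r → ∀ F : SchwartzMap (Fin 2 → (EuclideanSpace ℝ (Fin 4))) ℂ, IsTensorOf F ![f, g] → MeasureTheory.Integrable (fun x : Fin 2 → (EuclideanSpace ℝ (Fin 4)) => K (x 0 - x 1) * F x) ∧ S₁ 2 F = ∫ x : Fin 2 → (EuclideanSpace ℝ (Fin 4)), K (x 0 - x 1) * F x)) → (∀ (T : SchwartzMap (Fin 2 → (EuclideanSpace ℝ (Fin 4))) ℂ →L[ℂ] ℂ) (K : (EuclideanSpace ℝ (Fin 4)) → ℂ) (W : Set (EuclideanSpace ℝ (Fin 4))), IsOpen W → ContinuousOn K W → ∀ (z : Fin 2 → (EuclideanSpace ℝ (Fin 4))) (r : ℝ), 0 < r → (∀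 x y : (EuclideanSpace ℝ (Fin 4)), x ∈ Metric.ball (z 0) r → y ∈ Metric.ball (z 1) r → x - y ∈ W) → (∀ (f g : SchwartzMap (EuclideanSpace ℝ (Fin 4)) ℂ), tsupport (f : (EuclideanSpace ℝ (Fin 4)) → ℂ) ⊆ Metric.ball (z 0) r → tsupport (g : (EuclideanSpace ℝ (Fin 4)) → ℂ) ⊆ Metric.ball (z 1) r → ∀ F : SchwartzMap (Fin 2 → (EuclideanSpace ℝ (Fin 4))) ℂ, IsTensorOf F ![f, g] → MeasureTheory.Integrable (fun x : Fin 2 → (EuclideanSpace ℝ (Fin 4)) => K (x 0 - x 1) * F x) ∧ T F = ∫ x : Fin 2 → (EuclideanSpace ℝ (Fin 4)), K (x 0 - x 1) * F x) → ∃ O : Set (Fin 2 → (EuclideanSpace ℝ (Fin 4))), IsOpen O ∧ z ∈ O ∧ ∀ F : SchwartzMap (Fin 2 → (EuclideanSpace ℝ (Fin 4))) ℂ, tsupport (F : (Fin 2 → (EuclideanSpace ℝ (Fin 4))) → ℂ) ⊆ O → MeasureTheory.Integrable (fun x : Fin 2 → (EuclideanSpace ℝ (Fin 4)) => K (x 0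 - x 1) * F x) ∧ T F = ∫ x : Fin 2 → (EuclideanSpace ℝ (Fin 4)), K (x 0 - x 1) * F x) → ∀ (S₁ : SchwingerFamily (EuclideanSpace ℝ (Fin 4))), S₁.toLabelled.IsReflectionPositive → (∀ (n : ℕ) (a : (EuclideanSpace ℝ (Fin 4))) (F : SchwartzMap (Fin n → (EuclideanSpace ℝ (Fin 4))) ℂ), IsOffDiagonal F → S₁ n (translateMulti a F) = S₁ n F) → (∀ (R : (EuclideanSpace ℝ (Fin 4)) ≃ₗᵢ[ℝ] (EuclideanSpace ℝ (Fin 4))), LinearMap.det (R.toLinearEquiv : (EuclideanSpace ℝ (Fin 4)) →ₗ[ℝ] (EuclideanSpace ℝ (Fin 4))) = 1 → (∀ i : Fin 4, ∃ j : Fin 4, R (EuclideanSpace.single i 1) = EuclideanSpace.single j 1 ∨ R (EuclideanSpace.single i 1) = -EuclideanSpace.single j 1) → ∀ (n : ℕ) (F : SchwartzMap (Fin n → (EuclideanSpace ℝ (Fin 4))) ℂ), IsOffDiagonal F → S₁ n (linActMulti R F) = S₁ n F) → (∃ (s₁ A₀ : ℝ) (p₀ : ℕ), 0 < s₁ ∧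 0 ≤ A₀ ∧ (∀ (s : ℝ), 0 < s → s < s₁ → ∃ (r₀ A B : ℝ), 0 < r₀ ∧ 0 ≤ A ∧ 0 ≤ B ∧ A + B ≤ A₀ * (1 + s⁻¹ ^ p₀) ∧ (∀ (r : ℝ), 0 < r → r ≤ r₀ → ∀ (f : Fin 2 → SchwartzMap (EuclideanSpace ℝ (Fin 4)) ℝ) (F : SchwartzMap (Fin 2 → (EuclideanSpace ℝ (Fin 4))) ℂ) (M₀ M₁ : ℝ), IsTensorOf F (fun i => ofRealTest (f i)) → tsupport ((f 0 : SchwartzMap (EuclideanSpace ℝ (Fin 4)) ℝ) : (EuclideanSpace ℝ (Fin 4)) → ℝ) ⊆ Metric.closedBall (EuclideanSpace.single (0 : Fin 4) (-s)) r → tsupport ((f 1 : SchwartzMap (EuclideanSpace ℝ (Fin 4)) ℝ) : (EuclideanSpace ℝ (Fin 4)) → ℝ) ⊆ Metric.closedBall (EuclideanSpace.single (0 : Fin 4) s) r → (∀ x, |f 0 x| ≤ M₀) → (∀ x, |f 1 x| ≤ M₁) → ‖S₁ 2 F‖ ≤ A * (∫ x : (EuclideanSpace ℝ (Fin 4)),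 |f 0 x|) * (∫ x : (EuclideanSpace ℝ (Fin 4)), |f 1 x|) + B * r ^ 8 * M₀ * M₁))) → ∃ K : (EuclideanSpace ℝ (Fin 4)) → ℂ, ContinuousOn K {x : (EuclideanSpace ℝ (Fin 4)) | x ≠ 0} ∧ ∀ F : SchwartzMap (Fin 2 → (EuclideanSpace ℝ (Fin 4))) ℂ, IsOffDiagonal F → MeasureTheory.Integrable (fun x : Fin 2 → (EuclideanSpace ℝ (Fin 4)) => K (x 0 - x 1) * F x) ∧ S₁ 2 F = ∫ x : Fin 2 → (EuclideanSpace ℝ (Fin 4)), K (x 0 - x 1) * F x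

/-- **B₁ · TwoPointLocalBoundScaling** (provable now): `W₁` + the pair lattice window bound ⇒ the local two-point bounds with
constants `≲ s⁻¹⁰` (lattice tie, `S₁ 1 = κ∫`, crude lattice point count). [folklore] -/
def TwoPointLocalBoundScaling : Prop :=
  open Literature.MathematicalPhysics.QuantumLattice Literature.MathematicalPhysics.AQFT Literature.MathematicalPhysics.QuantumFieldTheory in ∀ (G : Type) [Group G] [TopologicalSpace G] [IsTopologicalGroup G] [CompactSpace G] [MeasurableSpace G] [BorelSpace G], IsCompactSimpleLieGroup G → ∀ (r : LatticeRep G) (sch : SpeciesScheme (YMSpecies G)) (S₁ : SchwingerFamily (EuclideanSpace ℝ (Fin 4))), ((∀ (n : ℕ), n ≠ 0 → ∀ (f : Fin n → SchwartzMap (EuclideanSpace ℝ (Fin 4)) ℝ) (F : SchwartzMap (Fin n → (EuclideanSpace ℝ (Fin 4))) ℂ), IsTensorOf F (fun i => ofRealTest (f i)) → IsOffDiagonal F → Filter.Tendsto (fun k : ℕ => ((latticeSchwinger r.ρ sch (fun s => s.F) k n (fun _ => r.curvature) f : ℝ) : ℂ)) Filter.atTop (nhds (S₁ n F))) ∧ (S₁.toLabelled.IsNormalized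 ∧ S₁.toLabelled.IsHermitian ∧ S₁.toLabelled.HasLinearGrowth ∧ S₁.toLabelled.IsReflectionPositive ∧ S₁.toLabelled.IsSymmetric ∧ S₁.toLabelled.HasClusterProperty) ∧ (∀ (n : ℕ) (a : (EuclideanSpace ℝ (Fin 4))) (F : SchwartzMap (Fin n → (EuclideanSpace ℝ (Fin 4))) ℂ), IsOffDiagonal F → S₁ n (translateMulti a F) = S₁ n F) ∧ (∀ (R : (EuclideanSpace ℝ (Fin 4)) ≃ₗᵢ[ℝ] (EuclideanSpace ℝ (Fin 4))), LinearMap.det (R.toLinearEquiv : (EuclideanSpace ℝ (Fin 4)) →ₗ[ℝ] (EuclideanSpace ℝ (Fin 4))) = 1 → (∀ i : Fin 4, ∃ j : Fin 4, R (EuclideanSpace.single i 1) = EuclideanSpace.single j 1 ∨ R (EuclideanSpace.single i 1) = -EuclideanSpace.single j 1) → ∀ (n : ℕ) (F : SchwartzMap (Fin n → (EuclideanSpace ℝ (Fin 4))) ℂ), IsOffDiagonal F → S₁ n (linActMulti R F) = S₁ n F) ∧ (∃ Δ : ℝ, 0 < Δ ∧ S₁.toLabelled.HasMassGap Δ ∧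 HasLatticeMassGap r sch Δ)) → (∃ (C η θ R₀ : ℝ), 0 < η ∧ 0 < θ ∧ ∃ᶠ k in Filter.atTop, ∀ x y : Literature.Probability.LatticeModels.Site 4, x ∈ Literature.Probability.LatticeModels.box 4 (sch.L k) → y ∈ Literature.Probability.LatticeModels.box 4 (sch.L k) → R₀ ≤ ‖siteToE x - siteToE y‖ → sch.a k * ‖siteToE x - siteToE y‖ ≤ θ → (sch.c r.curvature k) ^ 2 * |(∫ U, r.curvature.F (configShift (-x) (torusLift (sch.side k) U)) * r.curvature.F (configShift (-y) (torusLift (sch.side k) U)) ∂(wilsonMeasure r.ρ (sch.β k) : MeasureTheory.Measure (GaugeConfig 4 (sch.side k) G))) - (∫ U, r.curvature.F (configShift (-x) (torusLift (sch.side k) U)) ∂(wilsonMeasure r.ρ (sch.β k) : MeasureTheory.Measure (GaugeConfig 4 (sch.side k) G))) * (∫ U, r.curvature.F (configShift (-y) (torusLift (sch.side k) U)) ∂(wilsonMeasure r.ρ (sch.β k) : MeasureTheory.Measure (GaugeConfig 4 (sch.side k) G)))| ≤ C * (sch.a k * ‖siteToE x - siteToE y‖) ^ (η - 10)) → ∃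 (s₁ A₀ : ℝ) (p₀ : ℕ), 0 < s₁ ∧ 0 ≤ A₀ ∧ (∀ (s : ℝ), 0 < s → s < s₁ → ∃ (r₀ A B : ℝ), 0 < r₀ ∧ 0 ≤ A ∧ 0 ≤ B ∧ A + B ≤ A₀ * (1 + s⁻¹ ^ p₀) ∧ (∀ (r : ℝ), 0 < r → r ≤ r₀ → ∀ (f : Fin 2 → SchwartzMap (EuclideanSpace ℝ (Fin 4)) ℝ) (F : SchwartzMap (Fin 2 → (EuclideanSpace ℝ (Fin 4))) ℂ) (M₀ M₁ : ℝ), IsTensorOf F (fun i => ofRealTest (f i)) → tsupport ((f 0 : SchwartzMap (EuclideanSpace ℝ (Fin 4)) ℝ) : (EuclideanSpace ℝ (Fin 4)) → ℝ) ⊆ Metric.closedBall (EuclideanSpace.single (0 : Fin 4) (-s)) r → tsupport ((f 1 : SchwartzMap (EuclideanSpace ℝ (Fin 4)) ℝ) : (EuclideanSpace ℝ (Fin 4)) → ℝ) ⊆ Metric.closedBall (EuclideanSpace.single (0 : Fin 4) s) r → (∀ x, |f 0 x| ≤ M₀) → (∀ x, |f 1 x| ≤ M₁) → ‖S₁ 2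 F‖ ≤ A * (∫ x : (EuclideanSpace ℝ (Fin 4)), |f 0 x|) * (∫ x : (EuclideanSpace ℝ (Fin 4)), |f 1 x|) + B * r ^ 8 * M₀ * M₁))

/-- **B₂ · TwoPointLocalBoundSemiDegenerate** (provable now): `W₁` + (factorising two-point function OR frequently bounded `c_k`) ⇒ the
local two-point bounds with bounded constants (landed S2 `twoPoint_eq_const_mul_integral` / L1 `LatticeTruncatedTwoPointBound`). [folklore] -/
def TwoPointLocalBoundSemiDegenerate : Prop :=
  open Literature.MathematicalPhysics.QuantumLattice Literature.MathematicalPhysics.AQFT Literature.MathematicalPhysics.QuantumFieldTheory in ∀ (G : Type) [Group G] [TopologicalSpace G] [IsTopologicalGroup G] [CompactSpace G] [MeasurableSpace G] [BorelSpace G], IsCompactSimpleLieGroup G → ∀ (r : LatticeRep G) (sch : SpeciesScheme (YMSpecies G)) (S₁ : SchwingerFamily (EuclideanSpace ℝ (Fin 4))), ((∀ (n : ℕ), n ≠ 0 → ∀ (f : Fin n → SchwartzMap (EuclideanSpace ℝ (Fin 4)) ℝ) (F : SchwartzMap (Fin n → (EuclideanSpace ℝ (Fin 4))) ℂ), IsTensorOf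 F (fun i => ofRealTest (f i)) → IsOffDiagonal F → Filter.Tendsto (fun k : ℕ => ((latticeSchwinger r.ρ sch (fun s => s.F) k n (fun _ => r.curvature) f : ℝ) : ℂ)) Filter.atTop (nhds (S₁ n F))) ∧ (S₁.toLabelled.IsNormalized ∧ S₁.toLabelled.IsHermitian ∧ S₁.toLabelled.HasLinearGrowth ∧ S₁.toLabelled.IsReflectionPositive ∧ S₁.toLabelled.IsSymmetric ∧ S₁.toLabelled.HasClusterProperty) ∧ (∀ (n : ℕ) (a : (EuclideanSpace ℝ (Fin 4))) (F : SchwartzMap (Fin n → (EuclideanSpace ℝ (Fin 4))) ℂ), IsOffDiagonal F → S₁ n (translateMulti a F) = S₁ n F) ∧ (∀ (R : (EuclideanSpace ℝ (Fin 4)) ≃ₗᵢ[ℝ] (EuclideanSpace ℝ (Fin 4))), LinearMap.det (R.toLinearEquiv : (EuclideanSpace ℝ (Fin 4)) →ₗ[ℝ] (EuclideanSpace ℝ (Fin 4))) = 1 → (∀ i : Fin 4, ∃ j : Fin 4, R (EuclideanSpace.single i 1) = EuclideanSpace.single j 1 ∨ R (EuclideanSpace.single i 1) = -EuclideanSpace.single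 j 1) → ∀ (n : ℕ) (F : SchwartzMap (Fin n → (EuclideanSpace ℝ (Fin 4))) ℂ), IsOffDiagonal F → S₁ n (linActMulti R F) = S₁ n F) ∧ (∃ Δ : ℝ, 0 < Δ ∧ S₁.toLabelled.HasMassGap Δ ∧ HasLatticeMassGap r sch Δ)) → ((∀ (f : Fin 2 → SchwartzMap (EuclideanSpace ℝ (Fin 4)) ℝ) (F : SchwartzMap (Fin 2 → (EuclideanSpace ℝ (Fin 4))) ℂ) (F₀ F₁ : SchwartzMap (Fin 1 → (EuclideanSpace ℝ (Fin 4))) ℂ), IsTensorOf F (fun i => ofRealTest (f i)) → IsOffDiagonal F → IsTensorOf F₀ (fun _ => ofRealTest (f 0)) → IsTensorOf F₁ (fun _ => ofRealTest (f 1)) → S₁ 2 F = S₁ 1 F₀ * S₁ 1 F₁) ∨ (∃ M : ℝ, ∃ᶠ k in Filter.atTop, |sch.c r.curvature k| ≤ M)) → ∃ (s₁ A₀ : ℝ) (p₀ : ℕ), 0 < s₁ ∧ 0 ≤ A₀ ∧ (∀ (s : ℝ), 0 < s → s < s₁ → ∃ (r₀ A B : ℝ), 0 < r₀ ∧ 0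 ≤ A ∧ 0 ≤ B ∧ A + B ≤ A₀ * (1 + s⁻¹ ^ p₀) ∧ (∀ (r : ℝ), 0 < r → r ≤ r₀ → ∀ (f : Fin 2 → SchwartzMap (EuclideanSpace ℝ (Fin 4)) ℝ) (F : SchwartzMap (Fin 2 → (EuclideanSpace ℝ (Fin 4))) ℂ) (M₀ M₁ : ℝ), IsTensorOf F (fun i => ofRealTest (f i)) → tsupport ((f 0 : SchwartzMap (EuclideanSpace ℝ (Fin 4)) ℝ) : (EuclideanSpace ℝ (Fin 4)) → ℝ) ⊆ Metric.closedBall (EuclideanSpace.single (0 : Fin 4) (-s)) r → tsupport ((f 1 : SchwartzMap (EuclideanSpace ℝ (Fin 4)) ℝ) : (EuclideanSpace ℝ (Fin 4)) → ℝ) ⊆ Metric.closedBall (EuclideanSpace.single (0 : Fin 4) s) r → (∀ x, |f 0 x| ≤ M₀) → (∀ x, |f 1 x| ≤ M₁) → ‖S₁ 2 F‖ ≤ A * (∫ x : (EuclideanSpace ℝ (Fin 4)), |f 0 x|) * (∫ x : (EuclideanSpace ℝ (Fin 4)), |f 1 x|) + B * r ^ 8 * M₀ * M₁))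

/-- **Kernel existence for `W₁`-data** (glued below from H, R, X, B₁, B₂, the landed glue `LatticeWindowPairOfOne` and E‴₁). -/
def KernelExistenceW1 : Prop :=
  open Literature.MathematicalPhysics.QuantumLattice Literature.MathematicalPhysics.AQFT Literature.MathematicalPhysics.QuantumFieldTheory in ∀ (G : Type) [Group G] [TopologicalSpace G] [IsTopologicalGroup G] [CompactSpace G] [MeasurableSpace G] [BorelSpace G], IsCompactSimpleLieGroup G → ∀ (r : LatticeRep G) (sch : SpeciesScheme (YMSpecies G)) (S₁ : SchwingerFamily (EuclideanSpace ℝ (Fin 4))), ((∀ (n : ℕ), n ≠ 0 → ∀ (f : Fin n → SchwartzMap (EuclideanSpace ℝ (Fin 4)) ℝ) (F : SchwartzMap (Fin n → (EuclideanSpace ℝ (Fin 4))) ℂ), IsTensorOf F (fun i => ofRealTest (f i)) → IsOffDiagonal F → Filter.Tendsto (fun k : ℕ => ((latticeSchwinger r.ρ sch (fun s => s.F) k n (fun _ => r.curvature) f : ℝ) : ℂ)) Filter.atTop (nhds (S₁ n F))) ∧ (S₁.toLabelled.IsNormalized ∧ S₁.toLabelled.IsHermitian ∧ S₁.toLabelled.HasLinearGrowth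 ∧ S₁.toLabelled.IsReflectionPositive ∧ S₁.toLabelled.IsSymmetric ∧ S₁.toLabelled.HasClusterProperty) ∧ (∀ (n : ℕ) (a : (EuclideanSpace ℝ (Fin 4))) (F : SchwartzMap (Fin n → (EuclideanSpace ℝ (Fin 4))) ℂ), IsOffDiagonal F → S₁ n (translateMulti a F) = S₁ n F) ∧ (∀ (R : (EuclideanSpace ℝ (Fin 4)) ≃ₗᵢ[ℝ] (EuclideanSpace ℝ (Fin 4))), LinearMap.det (R.toLinearEquiv : (EuclideanSpace ℝ (Fin 4)) →ₗ[ℝ] (EuclideanSpace ℝ (Fin 4))) = 1 → (∀ i : Fin 4, ∃ j : Fin 4, R (EuclideanSpace.single i 1) = EuclideanSpace.single j 1 ∨ R (EuclideanSpace.single i 1) = -EuclideanSpace.single j 1) → ∀ (n : ℕ) (F : SchwartzMap (Fin n → (EuclideanSpace ℝ (Fin 4))) ℂ), IsOffDiagonal F → S₁ n (linActMulti R F) = S₁ n F) ∧ (∃ Δ : ℝ, 0 < Δ ∧ S₁.toLabelled.HasMassGap Δ ∧ HasLatticeMassGap r sch Δ)) → ∃ K : (EuclideanSpace ℝ (Fin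 4)) → ℂ, ContinuousOn K {x : (EuclideanSpace ℝ (Fin 4)) | x ≠ 0} ∧ ∀ F : SchwartzMap (Fin 2 → (EuclideanSpace ℝ (Fin 4))) ℂ, IsOffDiagonal F → MeasureTheory.Integrable (fun x : Fin 2 → (EuclideanSpace ℝ (Fin 4)) => K (x 0 - x 1) * F x) ∧ S₁ 2 F = ∫ x : Fin 2 → (EuclideanSpace ℝ (Fin 4)), K (x 0 - x 1) * F x

/-- **G · CurvatureKernelBoundReductionDFree** (provable now): the landed `CurvatureKernelBoundReduction` with its use of D
(`mirrorChartRegularity`) replaced by the kernel-existence hypothesis. [folklore] -/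
def CurvatureKernelBoundReductionDFree : Prop :=
  open Literature.MathematicalPhysics.QuantumLattice Literature.MathematicalPhysics.AQFT Literature.MathematicalPhysics.QuantumFieldTheory in (∀ (G : Type) [Group G] [TopologicalSpace G] [IsTopologicalGroup G] [CompactSpace G] [MeasurableSpace G] [BorelSpace G], IsCompactSimpleLieGroup G → ∀ (r : LatticeRep G) (sch : SpeciesScheme (YMSpecies G)) (S₁ : SchwingerFamily (EuclideanSpace ℝ (Fin 4))), ((∀ (n : ℕ), n ≠ 0 → ∀ (f : Fin n → SchwartzMap (EuclideanSpace ℝ (Fin 4)) ℝ) (F : SchwartzMap (Fin n → (EuclideanSpace ℝ (Fin 4))) ℂ), IsTensorOf F (fun i => ofRealTest (f i)) → IsOffDiagonal F → Filter.Tendsto (fun k : ℕ => ((latticeSchwinger r.ρ sch (fun s => s.F) k n (fun _ => r.curvature) f : ℝ) : ℂ)) Filter.atTop (nhds (S₁ n F))) ∧ (S₁.toLabelled.IsNormalized ∧ S₁.toLabelled.IsHermitian ∧ S₁.toLabelled.HasLinearGrowth ∧ S₁.toLabelled.IsReflectionPositive ∧ S₁.toLabelled.IsSymmetric ∧ S₁.toLabelled.HasClusterProperty)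 ∧ (∀ (n : ℕ) (a : (EuclideanSpace ℝ (Fin 4))) (F : SchwartzMap (Fin n → (EuclideanSpace ℝ (Fin 4))) ℂ), IsOffDiagonal F → S₁ n (translateMulti a F) = S₁ n F) ∧ (∀ (R : (EuclideanSpace ℝ (Fin 4)) ≃ₗᵢ[ℝ] (EuclideanSpace ℝ (Fin 4))), LinearMap.det (R.toLinearEquiv : (EuclideanSpace ℝ (Fin 4)) →ₗ[ℝ] (EuclideanSpace ℝ (Fin 4))) = 1 → (∀ i : Fin 4, ∃ j : Fin 4, R (EuclideanSpace.single i 1) = EuclideanSpace.single j 1 ∨ R (EuclideanSpace.single i 1) = -EuclideanSpace.single j 1) → ∀ (n : ℕ) (F : SchwartzMap (Fin n → (EuclideanSpace ℝ (Fin 4))) ℂ), IsOffDiagonal F → S₁ n (linActMulti R F) = S₁ n F) ∧ (∃ Δ : ℝ, 0 < Δ ∧ S₁.toLabelled.HasMassGap Δ ∧ HasLatticeMassGap r sch Δ)) → ∃ K : (EuclideanSpace ℝ (Fin 4)) → ℂ, ContinuousOn K {x : (EuclideanSpace ℝ (Fin 4)) | x ≠ 0} ∧ ∀ F : SchwartzMap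 (Fin 2 → (EuclideanSpace ℝ (Fin 4))) ℂ, IsOffDiagonal F → MeasureTheory.Integrable (fun x : Fin 2 → (EuclideanSpace ℝ (Fin 4)) => K (x 0 - x 1) * F x) ∧ S₁ 2 F = ∫ x : Fin 2 → (EuclideanSpace ℝ (Fin 4)), K (x 0 - x 1) * F x) → (∀ (G : Type) [Group G] [TopologicalSpace G] [IsTopologicalGroup G] [CompactSpace G] [MeasurableSpace G] [BorelSpace G], IsCompactSimpleLieGroup G → ∀ (r : LatticeRep G) (sch : SpeciesScheme (YMSpecies G)) (S₁ : SchwingerFamily (EuclideanSpace ℝ (Fin 4))), ((∀ (n : ℕ), n ≠ 0 → ∀ (f : Fin n → SchwartzMap (EuclideanSpace ℝ (Fin 4)) ℝ) (F : SchwartzMap (Fin n → (EuclideanSpace ℝ (Fin 4))) ℂ), IsTensorOf F (fun i => ofRealTest (f i)) → IsOffDiagonal F → Filter.Tendsto (fun k : ℕ => ((latticeSchwinger r.ρ sch (fun s => s.F) k n (fun _ => r.curvature) f : ℝ) : ℂ)) Filter.atTop (nhds (S₁ n F))) ∧ (S₁.toLabelled.IsNormalized ∧ S₁.toLabelled.IsHermitian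 ∧ S₁.toLabelled.HasLinearGrowth ∧ S₁.toLabelled.IsReflectionPositive ∧ S₁.toLabelled.IsSymmetric ∧ S₁.toLabelled.HasClusterProperty) ∧ (∀ (n : ℕ) (a : (EuclideanSpace ℝ (Fin 4))) (F : SchwartzMap (Fin n → (EuclideanSpace ℝ (Fin 4))) ℂ), IsOffDiagonal F → S₁ n (translateMulti a F) = S₁ n F) ∧ (∀ (R : (EuclideanSpace ℝ (Fin 4)) ≃ₗᵢ[ℝ] (EuclideanSpace ℝ (Fin 4))), LinearMap.det (R.toLinearEquiv : (EuclideanSpace ℝ (Fin 4)) →ₗ[ℝ] (EuclideanSpace ℝ (Fin 4))) = 1 → (∀ i : Fin 4, ∃ j : Fin 4, R (EuclideanSpace.single i 1) = EuclideanSpace.single j 1 ∨ R (EuclideanSpace.single i 1) = -EuclideanSpace.single j 1) → ∀ (n : ℕ) (F : SchwartzMap (Fin n → (EuclideanSpace ℝ (Fin 4))) ℂ), IsOffDiagonal F → S₁ n (linActMulti R F) = S₁ n F) ∧ (∃ Δ : ℝ, 0 < Δ ∧ S₁.toLabelled.HasMassGap Δ ∧ HasLatticeMassGap r sch Δ)) →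 ∀ (K : (EuclideanSpace ℝ (Fin 4)) → ℂ), ContinuousOn K {x : (EuclideanSpace ℝ (Fin 4)) | x ≠ 0} → (∀ F : SchwartzMap (Fin 2 → (EuclideanSpace ℝ (Fin 4))) ℂ, IsOffDiagonal F → MeasureTheory.Integrable (fun x : Fin 2 → (EuclideanSpace ℝ (Fin 4)) => K (x 0 - x 1) * F x) ∧ S₁ 2 F = ∫ x : Fin 2 → (EuclideanSpace ℝ (Fin 4)), K (x 0 - x 1) * F x) → ∃ C η : ℝ, 0 < η ∧ ∀ s : ℝ, 0 < s → s ≤ 1 → ‖K (EuclideanSpace.single 0 s)‖ ≤ C * s ^ (η - 10)) → Summit.QuantumFields.YangMills.Theses.PencilRigidity.CurvatureKernelBound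


/-! ## v13 statements (the AXIS-CURRENCY reshape, lead c4) -/

/-- **F · OddTorusCovCauchySchwarz** (provable now; Osterwalder–Seiler site-reflection positivity of Wilson's measure on the ODD torus
`(ℤ/(2S+1))⁴`, `β ≥ 0`, in covariance form): for real bounded measurable `F, H` depending only on the links of the closed positive half
of `Θ' = GaugeConfig.negReflect` (`t ↦ −t`; base time `≤ S`, `< S` for temporal links), the centred form `(X, Y) ↦ Cov(X∘Θ', Y)` is
positive semidefinite with the 2×2 Cauchy–Schwarz (discriminant) inequality. Engines: tree `wilsonExpectation_negReflect_nonneg_odd`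
(Theorems/ParabolicTrajectory…StubNegReflectRP), `wilsonMeasure_map_negReflect_eq` (SpeciesTimeReflection), abstract
`covariance_rp_cauchySchwarz` (Theorems/FradkinShenkerFlow…RPCauchySchwarz). [OsterwalderSeiler1978 §2; folklore] -/
def OddTorusCovCauchySchwarz : Prop :=
  open Literature.MathematicalPhysics.QuantumLattice Literature.MathematicalPhysics.AQFT Literature.MathematicalPhysics.QuantumFieldTheory in ∀ (G : Type) [Group G] [TopologicalSpace G] [IsTopologicalGroup G] [CompactSpace G] [MeasurableSpace G] [BorelSpace G] (N : ℕ) (ρ : G →* Matrix (Fin N) (Fin N) ℂ), Continuous ρ → ∀ (β : ℝ), 0 ≤ β → ∀ (S : ℕ), 1 ≤ S → ∀ (F H : GaugeConfig 4 (2 * S + 1) G → ℝ), Measurable F → Measurable H → (∃ C : ℝ, ∀ U, |F U| ≤ C) → (∃ C : ℝ, ∀ U, |H U| ≤ C) → DependsOn F {e : Edge 4 (2 * S + 1) | (e.1 0).val ≤ S ∧ (e.2 = 0 → (e.1 0).val < S)} → DependsOn H {e : Edge 4 (2 * S + 1) | (e.1 0).val ≤ S ∧ (e.2 = 0 → (e.1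 0).val < S)} → 0 ≤ ((∫ U, F U.negReflect * F U ∂(wilsonMeasure ρ β : MeasureTheory.Measure (GaugeConfig 4 (2 * S + 1) G))) - (∫ U, F U ∂(wilsonMeasure ρ β : MeasureTheory.Measure (GaugeConfig 4 (2 * S + 1) G))) * (∫ U, F U ∂(wilsonMeasure ρ β : MeasureTheory.Measure (GaugeConfig 4 (2 * S + 1) G)))) ∧ 0 ≤ ((∫ U, H U.negReflect * H U ∂(wilsonMeasure ρ β : MeasureTheory.Measure (GaugeConfig 4 (2 * S + 1) G))) - (∫ U, H U ∂(wilsonMeasure ρ β : MeasureTheory.Measure (GaugeConfig 4 (2 * S + 1) G))) * (∫ U, H U ∂(wilsonMeasure ρ β : MeasureTheory.Measure (GaugeConfig 4 (2 * S + 1) G)))) ∧ ((∫ U, F U.negReflect * H U ∂(wilsonMeasure ρ β : MeasureTheory.Measure (GaugeConfig 4 (2 * S + 1) G))) - (∫ U, F U ∂(wilsonMeasure ρ β : MeasureTheory.Measure (GaugeConfig 4 (2 * S + 1) G))) * (∫ U, H U ∂(wilsonMeasure ρ β : MeasureTheory.Measure (GaugeConfig 4 (2 * S + 1) G)))) ^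 2 ≤ ((∫ U, F U.negReflect * F U ∂(wilsonMeasure ρ β : MeasureTheory.Measure (GaugeConfig 4 (2 * S + 1) G))) - (∫ U, F U ∂(wilsonMeasure ρ β : MeasureTheory.Measure (GaugeConfig 4 (2 * S + 1) G))) * (∫ U, F U ∂(wilsonMeasure ρ β : MeasureTheory.Measure (GaugeConfig 4 (2 * S + 1) G)))) * ((∫ U, H U.negReflect * H U ∂(wilsonMeasure ρ β : MeasureTheory.Measure (GaugeConfig 4 (2 * S + 1) G))) - (∫ U, H U ∂(wilsonMeasure ρ β : MeasureTheory.Measure (GaugeConfig 4 (2 * S + 1) G))) * (∫ U, H U ∂(wilsonMeasure ρ β : MeasureTheory.Measure (GaugeConfig 4 (2 * S + 1) G))))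

/-- **P · CovAxisNormalisation** (provable now; hypercubic bookkeeping): the plaquette–plaquette covariance `Cov(Q_0, Q_z)` of Wilson's
measure on the odd torus `2L+1` (lifted form) is unchanged when `z` is replaced by a site `z'` whose TIME component is `n = |z_i|`
(axis transposition `(0 i)`: tree `integral_comp_configPerm_wilsonMeasure`, `LatticeRep.curvature_F_perm_torusLift`; sign: torus
translation by `−z` and symmetry of the covariance, tree `integral_comp_configShift_torusLift`). [folklore] -/
def CovAxisNormalisation : Prop :=
  open Literature.MathematicalPhysics.QuantumLattice Literature.MathematicalPhysics.AQFT Literature.MathematicalPhysics.QuantumFieldTheory in ∀ (G : Type) [Group G] [TopologicalSpace G] [IsTopologicalGroup G] [CompactSpace G] [MeasurableSpace G] [BorelSpace G] (r : LatticeRep G) (β : ℝ) (L : ℕ) (z : Literature.Probability.LatticeModels.Site 4) (i : Fin 4) (n : ℕ), (z i = n ∨ z i = -n) → ∃ z' : Literature.Probability.LatticeModels.Site 4, z' 0 = n ∧ ((∫ U, r.curvature.F (torusLift (2 * L + 1) U) * r.curvature.F (configShift (-z) (torusLift (2 * L + 1) U)) ∂(wilsonMeasure r.ρ β : MeasureTheory.Measure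 (GaugeConfig 4 (2 * L + 1) G))) - (∫ U, r.curvature.F (torusLift (2 * L + 1) U) ∂(wilsonMeasure r.ρ β : MeasureTheory.Measure (GaugeConfig 4 (2 * L + 1) G))) * (∫ U, r.curvature.F (configShift (-z) (torusLift (2 * L + 1) U)) ∂(wilsonMeasure r.ρ β : MeasureTheory.Measure (GaugeConfig 4 (2 * L + 1) G)))) = ((∫ U, r.curvature.F (torusLift (2 * L + 1) U) * r.curvature.F (configShift (-z') (torusLift (2 * L + 1) U)) ∂(wilsonMeasure r.ρ β : MeasureTheory.Measure (GaugeConfig 4 (2 * L + 1) G))) - (∫ U, r.curvature.F (torusLift (2 * L + 1) U) ∂(wilsonMeasure r.ρ β : MeasureTheory.Measure (GaugeConfig 4 (2 * L + 1) G))) * (∫ U, r.curvature.F (configShift (-z') (torusLift (2 * L + 1) U)) ∂(wilsonMeasure r.ρ β : MeasureTheory.Measure (GaugeConfig 4 (2 * L + 1) G))))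

/-- **A · AxisDomination** (provable now from F; THE TIME AXIS IS EXTREMAL): for `β ≥ 0`, `z` with time component `n`, `3 ≤ n ≤ L`, on
the odd torus `2L+1`: `Cov(Q_0,Q_z)² ≤ lCC(Q, Q^θ, 2⌈n/2⌉) · lCC(Q^θ, Q, 2⌊n/2⌋)` with both axis covariances `≥ 0`, where
`Q = r.curvature.F` (Wilson's corner action density), `Q^θ = r.curvature.timeReflect.F` (its site-time-reflected variant, tree
`LocalGaugeObservable.timeReflect`) and `lCC = latticeConnectedCorr` is EXACTLY the axis time-correlation of W₁'s `HasLatticeMassGap`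
clause. Proof: 2×2 Cauchy–Schwarz of F for `Q_{(−⌈n/2⌉,0)}` (lower slab) and `Q_{(⌊n/2⌋, z⃗)}` (upper slab), reflection identity
`(Q_u ∘ lift) ∘ Θ' = Q^θ_{θ₀u} ∘ lift` (tree `torusLift_negReflect`, `cfgReflect_configShift`) and torus translations. [OsterwalderSeiler1978 §2; folklore] -/
def AxisDomination : Prop :=
  open Literature.MathematicalPhysics.QuantumLattice Literature.MathematicalPhysics.AQFT Literature.MathematicalPhysics.QuantumFieldTheory in ∀ (G : Type) [Group G] [TopologicalSpace G] [IsTopologicalGroup G] [CompactSpace G] [MeasurableSpace G] [BorelSpace G] (r : LatticeRep G) (β : ℝ), 0 ≤ β → ∀ (L : ℕ) (z : Literature.Probability.LatticeModels.Site 4) (n : ℕ), z 0 = n → 3 ≤ n → n ≤ L → 0 ≤ latticeConnectedCorr r.ρ β (2 * L + 1) r.curvature.timeReflect.F r.curvature.F (2 * (n / 2)) ∧ 0 ≤ latticeConnectedCorr r.ρ β (2 * L + 1) r.curvature.F r.curvature.timeReflect.F (2 * ((n + 1) / 2)) ∧ ((∫ U, r.curvature.F (torusLift (2 * L + 1) U)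 * r.curvature.F (configShift (-z) (torusLift (2 * L + 1) U)) ∂(wilsonMeasure r.ρ β : MeasureTheory.Measure (GaugeConfig 4 (2 * L + 1) G))) - (∫ U, r.curvature.F (torusLift (2 * L + 1) U) ∂(wilsonMeasure r.ρ β : MeasureTheory.Measure (GaugeConfig 4 (2 * L + 1) G))) * (∫ U, r.curvature.F (configShift (-z) (torusLift (2 * L + 1) U)) ∂(wilsonMeasure r.ρ β : MeasureTheory.Measure (GaugeConfig 4 (2 * L + 1) G)))) ^ 2 ≤ latticeConnectedCorr r.ρ β (2 * L + 1) r.curvature.F r.curvature.timeReflect.F (2 * ((n + 1) / 2)) * latticeConnectedCorr r.ρ β (2 * L + 1) r.curvature.timeReflect.F r.curvature.F (2 * (n / 2))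

/-- **A from F** (the lead's stub): the RP form implies axis domination. -/
def AxisDominationOfForm : Prop :=
  OddTorusCovCauchySchwarz → AxisDomination

/-- **E⁗ · AxisWindowBound** (YM-specific; the OPEN core in AXIS currency, branch `β_k ≥ 0` frequently): for non-factorising `W₁`-data
with `|c_k| → ∞` and `β_k ≥ 0` frequently, there are `C, η > 0, θ > 0, R₀` such that, frequently in `k` (at steps with `β_k ≥ 0`), for all
lattice time separations `m` with `R₀ ≤ m`, `a_k m ≤ θ`, `m ≤ L_k`:
`c_k² |latticeConnectedCorr(Q^θ, Q, m)| ≤ C (a_k m)^(η−10)` and the same for `(Q, Q^θ)` — a RENORMALISED short-distance sharpening, for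
the two observables `Q, Q^θ` on the scheme's own torus `2L_k+1`, of the constant in W₁'s clause `HasLatticeMassGap` (which bounds the
same quantity by `C_{A,B} e^{−Δ a_k m}` WITHOUT the factor `c_k²`). Each `m ↦ lCC(Q^θ,Q,m)` is a reflection-positive (transfer-matrix)
sequence; asymptotic freedom predicts `η = 2` (`c_k ≍ a_k⁻⁴`, `lCC ≍ β_k⁻² m⁻⁸`). This is the UV construction of 4D lattice Yang–Mills
in the scaling branch. [JaffeWitten2000 §6.5 fn. 2; Balaban1989LargeFieldII; OsterwalderSeiler1978 §2] -/
def AxisWindowBound : Prop :=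
  open Literature.MathematicalPhysics.QuantumLattice Literature.MathematicalPhysics.AQFT Literature.MathematicalPhysics.QuantumFieldTheory in ∀ (G : Type) [Group G] [TopologicalSpace G] [IsTopologicalGroup G] [CompactSpace G] [MeasurableSpace G] [BorelSpace G], IsCompactSimpleLieGroup G → ∀ (r : LatticeRep G) (sch : SpeciesScheme (YMSpecies G)) (S₁ : SchwingerFamily (EuclideanSpace ℝ (Fin 4))), ((∀ (n : ℕ), n ≠ 0 → ∀ (f : Fin n → SchwartzMap (EuclideanSpace ℝ (Fin 4)) ℝ) (F : SchwartzMap (Fin n → (EuclideanSpace ℝ (Fin 4))) ℂ), IsTensorOf F (fun i => ofRealTest (f i)) → IsOffDiagonal F → Filter.Tendsto (fun k : ℕ => ((latticeSchwinger r.ρ sch (fun s => s.F) k n (fun _ => r.curvature) f : ℝ) : ℂ)) Filter.atTop (nhds (S₁ n F))) ∧ (S₁.toLabelled.IsNormalized ∧ S₁.toLabelled.IsHermitian ∧ S₁.toLabelled.HasLinearGrowth ∧ S₁.toLabelled.IsReflectionPositive ∧ S₁.toLabelled.IsSymmetric ∧ S₁.toLabelled.HasClusterProperty) ∧ (∀ (n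 : ℕ) (a : (EuclideanSpace ℝ (Fin 4))) (F : SchwartzMap (Fin n → (EuclideanSpace ℝ (Fin 4))) ℂ), IsOffDiagonal F → S₁ n (translateMulti a F) = S₁ n F) ∧ (∀ (R : (EuclideanSpace ℝ (Fin 4)) ≃ₗᵢ[ℝ] (EuclideanSpace ℝ (Fin 4))), LinearMap.det (R.toLinearEquiv : (EuclideanSpace ℝ (Fin 4)) →ₗ[ℝ] (EuclideanSpace ℝ (Fin 4))) = 1 → (∀ i : Fin 4, ∃ j : Fin 4, R (EuclideanSpace.single i 1) = EuclideanSpace.single j 1 ∨ R (EuclideanSpace.single i 1) = -EuclideanSpace.single j 1) → ∀ (n : ℕ) (F : SchwartzMap (Fin n → (EuclideanSpace ℝ (Fin 4))) ℂ), IsOffDiagonal F → S₁ n (linActMulti R F) = S₁ n F) ∧ (∃ Δ : ℝ, 0 < Δ ∧ S₁.toLabelled.HasMassGap Δ ∧ HasLatticeMassGap r sch Δ)) → (∃ (f : Fin 2 → SchwartzMap (EuclideanSpace ℝ (Fin 4)) ℝ) (F : SchwartzMap (Fin 2 → (EuclideanSpace ℝ (Fin 4))) ℂ) (F₀ F₁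 : SchwartzMap (Fin 1 → (EuclideanSpace ℝ (Fin 4))) ℂ), IsTensorOf F (fun i => ofRealTest (f i)) ∧ IsOffDiagonal F ∧ IsTensorOf F₀ (fun _ => ofRealTest (f 0)) ∧ IsTensorOf F₁ (fun _ => ofRealTest (f 1)) ∧ S₁ 2 F ≠ S₁ 1 F₀ * S₁ 1 F₁) → Filter.Tendsto (fun k : ℕ => |sch.c r.curvature k|) Filter.atTop Filter.atTop → (∃ᶠ k in Filter.atTop, 0 ≤ sch.β k) → (∃ (C η θ R₀ : ℝ), 0 < η ∧ 0 < θ ∧ ∃ᶠ k in Filter.atTop, 0 ≤ sch.β k ∧ ∀ m : ℕ, R₀ ≤ (m : ℝ) → sch.a k * (m : ℝ) ≤ θ → m ≤ sch.L k → (sch.c r.curvature k) ^ 2 * |latticeConnectedCorr r.ρ (sch.β k) (2 * sch.L k + 1) r.curvature.timeReflect.F r.curvature.F m| ≤ C * (sch.a k * (m : ℝ)) ^ (η - 10) ∧ (sch.c r.curvature k) ^ 2 * |latticeConnectedCorr r.ρ (sch.β k) (2 * sch.L k + 1) r.curvature.F r.curvature.timeReflect.F m| ≤ C * (sch.a k *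 (m : ℝ)) ^ (η - 10))

/-- **N · NegativeCouplingWindowBound** (YM-specific; OPEN; the branch WITHOUT reflection positivity): E‴₁ `LatticeKernelWindowBound`
restricted to schemes with `β_k < 0` eventually (no Osterwalder–Seiler positivity on the odd torus for `β < 0` and general `G`; the
branch is EMPTY once W₁ carries the summit's `SpeciesScheme.HasWeakCouplingLimit`, `β_k → +∞`). [JaffeWitten2000 §6.5 fn. 2] -/
def NegativeCouplingWindowBound : Prop :=
  open Literature.MathematicalPhysics.QuantumLattice Literature.MathematicalPhysics.AQFT Literature.MathematicalPhysics.QuantumFieldTheory in ∀ (G : Type) [Group G] [TopologicalSpace G] [IsTopologicalGroup G] [CompactSpace G] [MeasurableSpace G] [BorelSpace G], IsCompactSimpleLieGroup G → ∀ (r : LatticeRep G) (sch : SpeciesScheme (YMSpecies G)) (S₁ : SchwingerFamily (EuclideanSpace ℝ (Fin 4))), ((∀ (n : ℕ), n ≠ 0 → ∀ (f : Fin n → SchwartzMap (EuclideanSpace ℝ (Fin 4)) ℝ) (F : SchwartzMap (Fin n → (EuclideanSpace ℝ (Fin 4))) ℂ), IsTensorOf F (fun i => ofRealTest (f i)) →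 IsOffDiagonal F → Filter.Tendsto (fun k : ℕ => ((latticeSchwinger r.ρ sch (fun s => s.F) k n (fun _ => r.curvature) f : ℝ) : ℂ)) Filter.atTop (nhds (S₁ n F))) ∧ (S₁.toLabelled.IsNormalized ∧ S₁.toLabelled.IsHermitian ∧ S₁.toLabelled.HasLinearGrowth ∧ S₁.toLabelled.IsReflectionPositive ∧ S₁.toLabelled.IsSymmetric ∧ S₁.toLabelled.HasClusterProperty) ∧ (∀ (n : ℕ) (a : (EuclideanSpace ℝ (Fin 4))) (F : SchwartzMap (Fin n → (EuclideanSpace ℝ (Fin 4))) ℂ), IsOffDiagonal F → S₁ n (translateMulti a F) = S₁ n F) ∧ (∀ (R : (EuclideanSpace ℝ (Fin 4)) ≃ₗᵢ[ℝ] (EuclideanSpace ℝ (Fin 4))), LinearMap.det (R.toLinearEquiv : (EuclideanSpace ℝ (Fin 4)) →ₗ[ℝ] (EuclideanSpace ℝ (Fin 4))) = 1 → (∀ i : Fin 4, ∃ j : Fin 4, R (EuclideanSpace.single i 1) = EuclideanSpace.single j 1 ∨ R (EuclideanSpace.single i 1) = -EuclideanSpace.single j 1) → ∀ (n : ℕ)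 (F : SchwartzMap (Fin n → (EuclideanSpace ℝ (Fin 4))) ℂ), IsOffDiagonal F → S₁ n (linActMulti R F) = S₁ n F) ∧ (∃ Δ : ℝ, 0 < Δ ∧ S₁.toLabelled.HasMassGap Δ ∧ HasLatticeMassGap r sch Δ)) → (∃ (f : Fin 2 → SchwartzMap (EuclideanSpace ℝ (Fin 4)) ℝ) (F : SchwartzMap (Fin 2 → (EuclideanSpace ℝ (Fin 4))) ℂ) (F₀ F₁ : SchwartzMap (Fin 1 → (EuclideanSpace ℝ (Fin 4))) ℂ), IsTensorOf F (fun i => ofRealTest (f i)) ∧ IsOffDiagonal F ∧ IsTensorOf F₀ (fun _ => ofRealTest (f 0)) ∧ IsTensorOf F₁ (fun _ => ofRealTest (f 1)) ∧ S₁ 2 F ≠ S₁ 1 F₀ * S₁ 1 F₁) → Filter.Tendsto (fun k : ℕ => |sch.c r.curvature k|) Filter.atTop Filter.atTop → (∀ᶠ k in Filter.atTop, sch.β k < 0) → (∃ (C η θ R₀ : ℝ), 0 < η ∧ 0 < θ ∧ ∃ᶠ k in Filter.atTop, ∀ z : Literature.Probability.LatticeModels.Site 4, z ∈ Literature.Probability.LatticeModels.box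 4 (sch.L k) → z ≠ 0 → R₀ ≤ ‖siteToE z‖ → sch.a k * ‖siteToE z‖ ≤ θ → (sch.c r.curvature k) ^ 2 * |(∫ U, r.curvature.F (torusLift (sch.side k) U) * r.curvature.F (configShift (-z) (torusLift (sch.side k) U)) ∂(wilsonMeasure r.ρ (sch.β k) : MeasureTheory.Measure (GaugeConfig 4 (sch.side k) G))) - (∫ U, r.curvature.F (torusLift (sch.side k) U) ∂(wilsonMeasure r.ρ (sch.β k) : MeasureTheory.Measure (GaugeConfig 4 (sch.side k) G))) * (∫ U, r.curvature.F (configShift (-z) (torusLift (sch.side k) U)) ∂(wilsonMeasure r.ρ (sch.β k) : MeasureTheory.Measure (GaugeConfig 4 (sch.side k) G)))| ≤ C * (sch.a k * ‖siteToE z‖) ^ (η - 10))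


/-! ## v15 statements (the exact continuum residue T and the sign-free smeared lattice stub E^sm, lead c5) -/

/-- **T · TwoPointLocalDecay** (continuum; the EXACT residue of the crux, D-free and sign-free): for `W₁`-data the local
two-point bounds of H/X near the time axis hold at every height `s ∈ (0, s₁)` with constants `A + B ≤ C s^(η−10)`.
Equivalent to the crux (I and N′ below). [JaffeWitten2000 §6.5 fn. 2; OsterwalderSchrader1973 §4] -/
def TwoPointLocalDecay : Prop :=
  open Literature.MathematicalPhysics.QuantumLattice Literature.MathematicalPhysics.AQFT Literature.MathematicalPhysics.QuantumFieldTheory in ∀ (G : Type) [Group G] [TopologicalSpace G] [IsTopologicalGroup G] [CompactSpace G] [MeasurableSpace G] [BorelSpace G], IsCompactSimpleLieGroup G → ∀ (r : LatticeRep G) (sch : SpeciesScheme (YMSpecies G)) (S₁ : SchwingerFamily (EuclideanSpace ℝ (Fin 4))), ((∀ (n : ℕ), n ≠ 0 → ∀ (f : Fin n → SchwartzMap (EuclideanSpace ℝ (Fin 4)) ℝ) (F : SchwartzMap (Fin n → (EuclideanSpace ℝ (Fin 4))) ℂ), IsTensorOf F (fun i => ofRealTest (f i)) → IsOffDiagonal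 F → Filter.Tendsto (fun k : ℕ => ((latticeSchwinger r.ρ sch (fun s => s.F) k n (fun _ => r.curvature) f : ℝ) : ℂ)) Filter.atTop (nhds (S₁ n F))) ∧ (S₁.toLabelled.IsNormalized ∧ S₁.toLabelled.IsHermitian ∧ S₁.toLabelled.HasLinearGrowth ∧ S₁.toLabelled.IsReflectionPositive ∧ S₁.toLabelled.IsSymmetric ∧ S₁.toLabelled.HasClusterProperty) ∧ (∀ (n : ℕ) (a : (EuclideanSpace ℝ (Fin 4))) (F : SchwartzMap (Fin n → (EuclideanSpace ℝ (Fin 4))) ℂ), IsOffDiagonal F → S₁ n (translateMulti a F) = S₁ n F) ∧ (∀ (R : (EuclideanSpace ℝ (Fin 4)) ≃ₗᵢ[ℝ] (EuclideanSpace ℝ (Fin 4))), LinearMap.det (R.toLinearEquiv : (EuclideanSpace ℝ (Fin 4)) →ₗ[ℝ] (EuclideanSpace ℝ (Fin 4))) = 1 → (∀ i : Fin 4, ∃ j : Fin 4, R (EuclideanSpace.single i 1) = EuclideanSpace.single j 1 ∨ R (EuclideanSpace.single i 1) = -EuclideanSpace.single j 1) → ∀ (n : ℕ) (F : SchwartzMap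 (Fin n → (EuclideanSpace ℝ (Fin 4))) ℂ), IsOffDiagonal F → S₁ n (linActMulti R F) = S₁ n F) ∧ (∃ Δ : ℝ, 0 < Δ ∧ S₁.toLabelled.HasMassGap Δ ∧ HasLatticeMassGap r sch Δ)) → ∃ (C η s₁ : ℝ), 0 < η ∧ 0 < s₁ ∧ (∀ (s : ℝ), 0 < s → s < s₁ → ∃ (r₀ A B : ℝ), 0 < r₀ ∧ 0 ≤ A ∧ 0 ≤ B ∧ A + B ≤ C * s ^ (η - 10) ∧ (∀ (r : ℝ), 0 < r → r ≤ r₀ → ∀ (f : Fin 2 → SchwartzMap (EuclideanSpace ℝ (Fin 4)) ℝ) (F : SchwartzMap (Fin 2 → (EuclideanSpace ℝ (Fin 4))) ℂ) (M₀ M₁ : ℝ), IsTensorOf F (fun i => ofRealTest (f i)) → tsupport ((f 0 : SchwartzMap (EuclideanSpace ℝ (Fin 4)) ℝ) : (EuclideanSpace ℝ (Fin 4)) → ℝ) ⊆ Metric.closedBall (EuclideanSpace.single (0 : Fin 4) (-s)) r → tsupport ((f 1 : SchwartzMap (EuclideanSpace ℝ (Fin 4)) ℝ) : (EuclideanSpace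 ℝ (Fin 4)) → ℝ) ⊆ Metric.closedBall (EuclideanSpace.single (0 : Fin 4) s) r → (∀ x, |f 0 x| ≤ M₀) → (∀ x, |f 1 x| ≤ M₁) → ‖S₁ 2 F‖ ≤ A * (∫ x : (EuclideanSpace ℝ (Fin 4)), |f 0 x|) * (∫ x : (EuclideanSpace ℝ (Fin 4)), |f 1 x|) + B * r ^ 8 * M₀ * M₁))

/-- **I₁ · KernelExistenceOfLocalDecay** (provable now): T → kernel existence for `W₁`-data — T's constants are polynomially
controlled (`C s^(η−10) ≤ C (1 + s⁻¹ ^ 10)` on `(0,1)`), so X `KernelExistence` (with the landed H `HalfSpaceKernel`, P `PartitionBump`,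
R `LocalRepresentation`) yields a kernel continuous on `ℝ⁴∖0` representing `S₁ 2` on `⁰𝒮₂`. [folklore] -/
def KernelExistenceOfLocalDecay : Prop :=
  open Literature.MathematicalPhysics.QuantumLattice Literature.MathematicalPhysics.AQFT Literature.MathematicalPhysics.QuantumFieldTheory in (∀ (G : Type) [Group G] [TopologicalSpace G] [IsTopologicalGroup G] [CompactSpace G] [MeasurableSpace G] [BorelSpace G], IsCompactSimpleLieGroup G → ∀ (r : LatticeRep G) (sch : SpeciesScheme (YMSpecies G)) (S₁ : SchwingerFamily (EuclideanSpace ℝ (Fin 4))), ((∀ (n : ℕ), n ≠ 0 → ∀ (f : Fin n → SchwartzMap (EuclideanSpace ℝ (Fin 4)) ℝ) (F : SchwartzMap (Fin n → (EuclideanSpace ℝ (Fin 4))) ℂ), IsTensorOf F (fun i => ofRealTest (f i)) → IsOffDiagonal F → Filter.Tendsto (fun k : ℕ => ((latticeSchwinger r.ρ sch (fun s => s.F) k n (fun _ => r.curvature) f : ℝ) : ℂ)) Filter.atTop (nhds (S₁ n F))) ∧ (S₁.toLabelled.IsNormalized ∧ S₁.toLabelled.IsHermitian ∧ S₁.toLabelled.HasLinearGrowth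 ∧ S₁.toLabelled.IsReflectionPositive ∧ S₁.toLabelled.IsSymmetric ∧ S₁.toLabelled.HasClusterProperty) ∧ (∀ (n : ℕ) (a : (EuclideanSpace ℝ (Fin 4))) (F : SchwartzMap (Fin n → (EuclideanSpace ℝ (Fin 4))) ℂ), IsOffDiagonal F → S₁ n (translateMulti a F) = S₁ n F) ∧ (∀ (R : (EuclideanSpace ℝ (Fin 4)) ≃ₗᵢ[ℝ] (EuclideanSpace ℝ (Fin 4))), LinearMap.det (R.toLinearEquiv : (EuclideanSpace ℝ (Fin 4)) →ₗ[ℝ] (EuclideanSpace ℝ (Fin 4))) = 1 → (∀ i : Fin 4, ∃ j : Fin 4, R (EuclideanSpace.single i 1) = EuclideanSpace.single j 1 ∨ R (EuclideanSpace.single i 1) = -EuclideanSpace.single j 1) → ∀ (n : ℕ) (F : SchwartzMap (Fin n → (EuclideanSpace ℝ (Fin 4))) ℂ), IsOffDiagonal F → S₁ n (linActMulti R F) = S₁ n F) ∧ (∃ Δ : ℝ, 0 < Δ ∧ S₁.toLabelled.HasMassGap Δ ∧ HasLatticeMassGap r sch Δ)) → ∃ (C η s₁ : ℝ), 0 < η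 ∧ 0 < s₁ ∧ (∀ (s : ℝ), 0 < s → s < s₁ → ∃ (r₀ A B : ℝ), 0 < r₀ ∧ 0 ≤ A ∧ 0 ≤ B ∧ A + B ≤ C * s ^ (η - 10) ∧ (∀ (r : ℝ), 0 < r → r ≤ r₀ → ∀ (f : Fin 2 → SchwartzMap (EuclideanSpace ℝ (Fin 4)) ℝ) (F : SchwartzMap (Fin 2 → (EuclideanSpace ℝ (Fin 4))) ℂ) (M₀ M₁ : ℝ), IsTensorOf F (fun i => ofRealTest (f i)) → tsupport ((f 0 : SchwartzMap (EuclideanSpace ℝ (Fin 4)) ℝ) : (EuclideanSpace ℝ (Fin 4)) → ℝ) ⊆ Metric.closedBall (EuclideanSpace.single (0 : Fin 4) (-s)) r → tsupport ((f 1 : SchwartzMap (EuclideanSpace ℝ (Fin 4)) ℝ) : (EuclideanSpace ℝ (Fin 4)) → ℝ) ⊆ Metric.closedBall (EuclideanSpace.single (0 : Fin 4) s) r → (∀ x, |f 0 x| ≤ M₀) → (∀ x, |f 1 x| ≤ M₁) → ‖S₁ 2 F‖ ≤ A * (∫ x : (EuclideanSpace ℝ (Fin 4)), |f 0 x|) *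 (∫ x : (EuclideanSpace ℝ (Fin 4)), |f 1 x|) + B * r ^ 8 * M₀ * M₁))) → ∀ (G : Type) [Group G] [TopologicalSpace G] [IsTopologicalGroup G] [CompactSpace G] [MeasurableSpace G] [BorelSpace G], IsCompactSimpleLieGroup G → ∀ (r : LatticeRep G) (sch : SpeciesScheme (YMSpecies G)) (S₁ : SchwingerFamily (EuclideanSpace ℝ (Fin 4))), ((∀ (n : ℕ), n ≠ 0 → ∀ (f : Fin n → SchwartzMap (EuclideanSpace ℝ (Fin 4)) ℝ) (F : SchwartzMap (Fin n → (EuclideanSpace ℝ (Fin 4))) ℂ), IsTensorOf F (fun i => ofRealTest (f i)) → IsOffDiagonal F → Filter.Tendsto (fun k : ℕ => ((latticeSchwinger r.ρ sch (fun s => s.F) k n (fun _ => r.curvature) f : ℝ) : ℂ)) Filter.atTop (nhds (S₁ n F))) ∧ (S₁.toLabelled.IsNormalized ∧ S₁.toLabelled.IsHermitian ∧ S₁.toLabelled.HasLinearGrowth ∧ S₁.toLabelled.IsReflectionPositive ∧ S₁.toLabelled.IsSymmetric ∧ S₁.toLabelled.HasClusterProperty) ∧ (∀ (n : ℕ) (a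 : (EuclideanSpace ℝ (Fin 4))) (F : SchwartzMap (Fin n → (EuclideanSpace ℝ (Fin 4))) ℂ), IsOffDiagonal F → S₁ n (translateMulti a F) = S₁ n F) ∧ (∀ (R : (EuclideanSpace ℝ (Fin 4)) ≃ₗᵢ[ℝ] (EuclideanSpace ℝ (Fin 4))), LinearMap.det (R.toLinearEquiv : (EuclideanSpace ℝ (Fin 4)) →ₗ[ℝ] (EuclideanSpace ℝ (Fin 4))) = 1 → (∀ i : Fin 4, ∃ j : Fin 4, R (EuclideanSpace.single i 1) = EuclideanSpace.single j 1 ∨ R (EuclideanSpace.single i 1) = -EuclideanSpace.single j 1) → ∀ (n : ℕ) (F : SchwartzMap (Fin n → (EuclideanSpace ℝ (Fin 4))) ℂ), IsOffDiagonal F → S₁ n (linActMulti R F) = S₁ n F) ∧ (∃ Δ : ℝ, 0 < Δ ∧ S₁.toLabelled.HasMassGap Δ ∧ HasLatticeMassGap r sch Δ)) → ∃ K : (EuclideanSpace ℝ (Fin 4)) → ℂ, ContinuousOn K {x : (EuclideanSpace ℝ (Fin 4)) | x ≠ 0} ∧ ∀ F : SchwartzMap (Fin 2 → (EuclideanSpace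 ℝ (Fin 4))) ℂ, IsOffDiagonal F → MeasureTheory.Integrable (fun x : Fin 2 → (EuclideanSpace ℝ (Fin 4)) => K (x 0 - x 1) * F x) ∧ S₁ 2 F = ∫ x : Fin 2 → (EuclideanSpace ℝ (Fin 4)), K (x 0 - x 1) * F x

/-- **I₂ · AxialGrowthOfLocalDecay** (provable now; the lead's stub): T → E `AxialGrowth` — every kernel continuous off `0`
representing `S₁ 2` on `⁰𝒮₂` obeys `‖K(s e₀)‖ ≤ C' s^(η−10)` on `(0,1]`: bump localisation at the pair of centres `∓(s/2)e₀`
(oscillation `1`, radii `≤ r₀(s/2)`), T's bound with `‖g‖₁ ≥ (ε/2)⁴ v₁`, evenness of representing kernels (`KernelIsometryInvariance`,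
`R = −1`, `det(−1) = 1` in `d = 4`, from W₁'s proper signed permutations) and continuity on the compact axial segment `[2s₁', 1]`. [folklore] -/
def AxialGrowthOfLocalDecay : Prop :=
  open Literature.MathematicalPhysics.QuantumLattice Literature.MathematicalPhysics.AQFT Literature.MathematicalPhysics.QuantumFieldTheory in (∀ (G : Type) [Group G] [TopologicalSpace G] [IsTopologicalGroup G] [CompactSpace G] [MeasurableSpace G] [BorelSpace G], IsCompactSimpleLieGroup G → ∀ (r : LatticeRep G) (sch : SpeciesScheme (YMSpecies G)) (S₁ : SchwingerFamily (EuclideanSpace ℝ (Fin 4))), ((∀ (n : ℕ), n ≠ 0 → ∀ (f : Fin n → SchwartzMap (EuclideanSpace ℝ (Fin 4)) ℝ) (F : SchwartzMap (Fin n → (EuclideanSpace ℝ (Fin 4))) ℂ), IsTensorOf F (fun i => ofRealTest (f i)) → IsOffDiagonal F → Filter.Tendsto (fun k : ℕ => ((latticeSchwinger r.ρ sch (fun s => s.F) k n (fun _ => r.curvature) f : ℝ) : ℂ)) Filter.atTop (nhds (S₁ n F))) ∧ (S₁.toLabelled.IsNormalized ∧ S₁.toLabelled.IsHermitian ∧ S₁.toLabelled.HasLinearGrowth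 ∧ S₁.toLabelled.IsReflectionPositive ∧ S₁.toLabelled.IsSymmetric ∧ S₁.toLabelled.HasClusterProperty) ∧ (∀ (n : ℕ) (a : (EuclideanSpace ℝ (Fin 4))) (F : SchwartzMap (Fin n → (EuclideanSpace ℝ (Fin 4))) ℂ), IsOffDiagonal F → S₁ n (translateMulti a F) = S₁ n F) ∧ (∀ (R : (EuclideanSpace ℝ (Fin 4)) ≃ₗᵢ[ℝ] (EuclideanSpace ℝ (Fin 4))), LinearMap.det (R.toLinearEquiv : (EuclideanSpace ℝ (Fin 4)) →ₗ[ℝ] (EuclideanSpace ℝ (Fin 4))) = 1 → (∀ i : Fin 4, ∃ j : Fin 4, R (EuclideanSpace.single i 1) = EuclideanSpace.single j 1 ∨ R (EuclideanSpace.single i 1) = -EuclideanSpace.single j 1) → ∀ (n : ℕ) (F : SchwartzMap (Fin n → (EuclideanSpace ℝ (Fin 4))) ℂ), IsOffDiagonal F → S₁ n (linActMulti R F) = S₁ n F) ∧ (∃ Δ : ℝ, 0 < Δ ∧ S₁.toLabelled.HasMassGap Δ ∧ HasLatticeMassGap r sch Δ)) → ∃ (C η s₁ : ℝ), 0 < η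 ∧ 0 < s₁ ∧ (∀ (s : ℝ), 0 < s → s < s₁ → ∃ (r₀ A B : ℝ), 0 < r₀ ∧ 0 ≤ A ∧ 0 ≤ B ∧ A + B ≤ C * s ^ (η - 10) ∧ (∀ (r : ℝ), 0 < r → r ≤ r₀ → ∀ (f : Fin 2 → SchwartzMap (EuclideanSpace ℝ (Fin 4)) ℝ) (F : SchwartzMap (Fin 2 → (EuclideanSpace ℝ (Fin 4))) ℂ) (M₀ M₁ : ℝ), IsTensorOf F (fun i => ofRealTest (f i)) → tsupport ((f 0 : SchwartzMap (EuclideanSpace ℝ (Fin 4)) ℝ) : (EuclideanSpace ℝ (Fin 4)) → ℝ) ⊆ Metric.closedBall (EuclideanSpace.single (0 : Fin 4) (-s)) r → tsupport ((f 1 : SchwartzMap (EuclideanSpace ℝ (Fin 4)) ℝ) : (EuclideanSpace ℝ (Fin 4)) → ℝ) ⊆ Metric.closedBall (EuclideanSpace.single (0 : Fin 4) s) r → (∀ x, |f 0 x| ≤ M₀) → (∀ x, |f 1 x| ≤ M₁) → ‖S₁ 2 F‖ ≤ A * (∫ x : (EuclideanSpace ℝ (Fin 4)), |f 0 x|) *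 (∫ x : (EuclideanSpace ℝ (Fin 4)), |f 1 x|) + B * r ^ 8 * M₀ * M₁))) → ∀ (G : Type) [Group G] [TopologicalSpace G] [IsTopologicalGroup G] [CompactSpace G] [MeasurableSpace G] [BorelSpace G], IsCompactSimpleLieGroup G → ∀ (r : LatticeRep G) (sch : SpeciesScheme (YMSpecies G)) (S₁ : SchwingerFamily (EuclideanSpace ℝ (Fin 4))), ((∀ (n : ℕ), n ≠ 0 → ∀ (f : Fin n → SchwartzMap (EuclideanSpace ℝ (Fin 4)) ℝ) (F : SchwartzMap (Fin n → (EuclideanSpace ℝ (Fin 4))) ℂ), IsTensorOf F (fun i => ofRealTest (f i)) → IsOffDiagonal F → Filter.Tendsto (fun k : ℕ => ((latticeSchwinger r.ρ sch (fun s => s.F) k n (fun _ => r.curvature) f : ℝ) : ℂ)) Filter.atTop (nhds (S₁ n F))) ∧ (S₁.toLabelled.IsNormalized ∧ S₁.toLabelled.IsHermitian ∧ S₁.toLabelled.HasLinearGrowth ∧ S₁.toLabelled.IsReflectionPositive ∧ S₁.toLabelled.IsSymmetric ∧ S₁.toLabelled.HasClusterProperty) ∧ (∀ (n : ℕ) (a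 : (EuclideanSpace ℝ (Fin 4))) (F : SchwartzMap (Fin n → (EuclideanSpace ℝ (Fin 4))) ℂ), IsOffDiagonal F → S₁ n (translateMulti a F) = S₁ n F) ∧ (∀ (R : (EuclideanSpace ℝ (Fin 4)) ≃ₗᵢ[ℝ] (EuclideanSpace ℝ (Fin 4))), LinearMap.det (R.toLinearEquiv : (EuclideanSpace ℝ (Fin 4)) →ₗ[ℝ] (EuclideanSpace ℝ (Fin 4))) = 1 → (∀ i : Fin 4, ∃ j : Fin 4, R (EuclideanSpace.single i 1) = EuclideanSpace.single j 1 ∨ R (EuclideanSpace.single i 1) = -EuclideanSpace.single j 1) → ∀ (n : ℕ) (F : SchwartzMap (Fin n → (EuclideanSpace ℝ (Fin 4))) ℂ), IsOffDiagonal F → S₁ n (linActMulti R F) = S₁ n F) ∧ (∃ Δ : ℝ, 0 < Δ ∧ S₁.toLabelled.HasMassGap Δ ∧ HasLatticeMassGap r sch Δ)) → ∀ (K : (EuclideanSpace ℝ (Fin 4)) → ℂ), ContinuousOn K {x : (EuclideanSpace ℝ (Fin 4)) | x ≠ 0} → (∀ F : SchwartzMap (Fin 2 → (EuclideanSpace ℝ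 (Fin 4))) ℂ, IsOffDiagonal F → MeasureTheory.Integrable (fun x : Fin 2 → (EuclideanSpace ℝ (Fin 4)) => K (x 0 - x 1) * F x) ∧ S₁ 2 F = ∫ x : Fin 2 → (EuclideanSpace ℝ (Fin 4)), K (x 0 - x 1) * F x) → ∃ C η : ℝ, 0 < η ∧ ∀ s : ℝ, 0 < s → s ≤ 1 → ‖K (EuclideanSpace.single 0 s)‖ ≤ C * s ^ (η - 10)

/-- **N′ · CruxToLocalDecay** (provable now): crux → T — a real kernel with `|K(ξ)| ≤ C(1 + ‖ξ‖^(η−10))` gives, on tensors supported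
in `r`-balls about `∓s e₀` (`r ≤ s/2`, so `s ≤ ‖x₀ − x₁‖`), `‖S₁ 2 F‖ ≤ 2 max C 0 · s^(η−10) ‖f₀‖₁ ‖f₁‖₁` (`s ≤ 1`). [folklore] -/
def CruxToLocalDecay : Prop :=
  open Literature.MathematicalPhysics.QuantumLattice Literature.MathematicalPhysics.AQFT Literature.MathematicalPhysics.QuantumFieldTheory in Summit.QuantumFields.YangMills.Theses.PencilRigidity.CurvatureKernelBound → ∀ (G : Type) [Group G] [TopologicalSpace G] [IsTopologicalGroup G] [CompactSpace G] [MeasurableSpace G] [BorelSpace G], IsCompactSimpleLieGroup G → ∀ (r : LatticeRep G) (sch : SpeciesScheme (YMSpecies G)) (S₁ : SchwingerFamily (EuclideanSpace ℝ (Fin 4))), ((∀ (n : ℕ), n ≠ 0 → ∀ (f : Fin n → SchwartzMap (EuclideanSpace ℝ (Fin 4)) ℝ) (F : SchwartzMap (Fin n → (EuclideanSpace ℝ (Fin 4))) ℂ), IsTensorOf F (fun i => ofRealTest (f i)) → IsOffDiagonal F → Filter.Tendsto (fun k : ℕ => ((latticeSchwinger r.ρ sch (fun s => s.F) k n (fun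 _ => r.curvature) f : ℝ) : ℂ)) Filter.atTop (nhds (S₁ n F))) ∧ (S₁.toLabelled.IsNormalized ∧ S₁.toLabelled.IsHermitian ∧ S₁.toLabelled.HasLinearGrowth ∧ S₁.toLabelled.IsReflectionPositive ∧ S₁.toLabelled.IsSymmetric ∧ S₁.toLabelled.HasClusterProperty) ∧ (∀ (n : ℕ) (a : (EuclideanSpace ℝ (Fin 4))) (F : SchwartzMap (Fin n → (EuclideanSpace ℝ (Fin 4))) ℂ), IsOffDiagonal F → S₁ n (translateMulti a F) = S₁ n F) ∧ (∀ (R : (EuclideanSpace ℝ (Fin 4)) ≃ₗᵢ[ℝ] (EuclideanSpace ℝ (Fin 4))), LinearMap.det (R.toLinearEquiv : (EuclideanSpace ℝ (Fin 4)) →ₗ[ℝ] (EuclideanSpace ℝ (Fin 4))) = 1 → (∀ i : Fin 4, ∃ j : Fin 4, R (EuclideanSpace.single i 1) = EuclideanSpace.single j 1 ∨ R (EuclideanSpace.single i 1) = -EuclideanSpace.single j 1) → ∀ (n : ℕ) (F : SchwartzMap (Fin n → (EuclideanSpace ℝ (Fin 4))) ℂ), IsOffDiagonal F → S₁ n (linActMulti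 R F) = S₁ n F) ∧ (∃ Δ : ℝ, 0 < Δ ∧ S₁.toLabelled.HasMassGap Δ ∧ HasLatticeMassGap r sch Δ)) → ∃ (C η s₁ : ℝ), 0 < η ∧ 0 < s₁ ∧ (∀ (s : ℝ), 0 < s → s < s₁ → ∃ (r₀ A B : ℝ), 0 < r₀ ∧ 0 ≤ A ∧ 0 ≤ B ∧ A + B ≤ C * s ^ (η - 10) ∧ (∀ (r : ℝ), 0 < r → r ≤ r₀ → ∀ (f : Fin 2 → SchwartzMap (EuclideanSpace ℝ (Fin 4)) ℝ) (F : SchwartzMap (Fin 2 → (EuclideanSpace ℝ (Fin 4))) ℂ) (M₀ M₁ : ℝ), IsTensorOf F (fun i => ofRealTest (f i)) → tsupport ((f 0 : SchwartzMap (EuclideanSpace ℝ (Fin 4)) ℝ) : (EuclideanSpace ℝ (Fin 4)) → ℝ) ⊆ Metric.closedBall (EuclideanSpace.single (0 : Fin 4) (-s)) r → tsupport ((f 1 : SchwartzMap (EuclideanSpace ℝ (Fin 4)) ℝ) : (EuclideanSpace ℝ (Fin 4)) → ℝ) ⊆ Metric.closedBall (EuclideanSpace.single (0 : Fin 4) s)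 r → (∀ x, |f 0 x| ≤ M₀) → (∀ x, |f 1 x| ≤ M₁) → ‖S₁ 2 F‖ ≤ A * (∫ x : (EuclideanSpace ℝ (Fin 4)), |f 0 x|) * (∫ x : (EuclideanSpace ℝ (Fin 4)), |f 1 x|) + B * r ^ 8 * M₀ * M₁))

/-- **B₂′ · SemiDegenerateLocalDecay** (provable now): B₂ `TwoPointLocalBoundSemiDegenerate` with its `s`-independent constants
exported — in the factorising branch `A = ‖κ‖², B = 0`; in the bounded-`c_k` branch `A = ‖κ‖²`, `B` from L1 — so T holds with
`η = 10`. [folklore] -/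
def SemiDegenerateLocalDecay : Prop :=
  open Literature.MathematicalPhysics.QuantumLattice Literature.MathematicalPhysics.AQFT Literature.MathematicalPhysics.QuantumFieldTheory in ∀ (G : Type) [Group G] [TopologicalSpace G] [IsTopologicalGroup G] [CompactSpace G] [MeasurableSpace G] [BorelSpace G], IsCompactSimpleLieGroup G → ∀ (r : LatticeRep G) (sch : SpeciesScheme (YMSpecies G)) (S₁ : SchwingerFamily (EuclideanSpace ℝ (Fin 4))), ((∀ (n : ℕ), n ≠ 0 → ∀ (f : Fin n → SchwartzMap (EuclideanSpace ℝ (Fin 4)) ℝ) (F : SchwartzMap (Fin n → (EuclideanSpace ℝ (Fin 4))) ℂ), IsTensorOf F (fun i => ofRealTest (f i)) → IsOffDiagonal F → Filter.Tendsto (fun k : ℕ => ((latticeSchwinger r.ρ sch (fun s => s.F) k n (fun _ => r.curvature) f : ℝ) : ℂ)) Filter.atTop (nhds (S₁ n F))) ∧ (S₁.toLabelled.IsNormalized ∧ S₁.toLabelled.IsHermitian ∧ S₁.toLabelled.HasLinearGrowth ∧ S₁.toLabelled.IsReflectionPositive ∧ S₁.toLabelled.IsSymmetric ∧ S₁.toLabelled.HasClusterProperty)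 ∧ (∀ (n : ℕ) (a : (EuclideanSpace ℝ (Fin 4))) (F : SchwartzMap (Fin n → (EuclideanSpace ℝ (Fin 4))) ℂ), IsOffDiagonal F → S₁ n (translateMulti a F) = S₁ n F) ∧ (∀ (R : (EuclideanSpace ℝ (Fin 4)) ≃ₗᵢ[ℝ] (EuclideanSpace ℝ (Fin 4))), LinearMap.det (R.toLinearEquiv : (EuclideanSpace ℝ (Fin 4)) →ₗ[ℝ] (EuclideanSpace ℝ (Fin 4))) = 1 → (∀ i : Fin 4, ∃ j : Fin 4, R (EuclideanSpace.single i 1) = EuclideanSpace.single j 1 ∨ R (EuclideanSpace.single i 1) = -EuclideanSpace.single j 1) → ∀ (n : ℕ) (F : SchwartzMap (Fin n → (EuclideanSpace ℝ (Fin 4))) ℂ), IsOffDiagonal F → S₁ n (linActMulti R F) = S₁ n F) ∧ (∃ Δ : ℝ, 0 < Δ ∧ S₁.toLabelled.HasMassGap Δ ∧ HasLatticeMassGap r sch Δ)) → ((∀ (f : Fin 2 → SchwartzMap (EuclideanSpace ℝ (Fin 4)) ℝ) (F : SchwartzMap (Fin 2 → (EuclideanSpace ℝ (Fin 4))) ℂ)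 (F₀ F₁ : SchwartzMap (Fin 1 → (EuclideanSpace ℝ (Fin 4))) ℂ), IsTensorOf F (fun i => ofRealTest (f i)) → IsOffDiagonal F → IsTensorOf F₀ (fun _ => ofRealTest (f 0)) → IsTensorOf F₁ (fun _ => ofRealTest (f 1)) → S₁ 2 F = S₁ 1 F₀ * S₁ 1 F₁) ∨ (∃ M : ℝ, ∃ᶠ k in Filter.atTop, |sch.c r.curvature k| ≤ M)) → ∃ (C η s₁ : ℝ), 0 < η ∧ 0 < s₁ ∧ (∀ (s : ℝ), 0 < s → s < s₁ → ∃ (r₀ A B : ℝ), 0 < r₀ ∧ 0 ≤ A ∧ 0 ≤ B ∧ A + B ≤ C * s ^ (η - 10) ∧ (∀ (r : ℝ), 0 < r → r ≤ r₀ → ∀ (f : Fin 2 → SchwartzMap (EuclideanSpace ℝ (Fin 4)) ℝ) (F : SchwartzMap (Fin 2 → (EuclideanSpace ℝ (Fin 4))) ℂ) (M₀ M₁ : ℝ), IsTensorOf F (fun i => ofRealTest (f i)) → tsupport ((f 0 : SchwartzMap (EuclideanSpace ℝ (Fin 4)) ℝ) : (EuclideanSpace ℝ (Fin 4)) → ℝ)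 ⊆ Metric.closedBall (EuclideanSpace.single (0 : Fin 4) (-s)) r → tsupport ((f 1 : SchwartzMap (EuclideanSpace ℝ (Fin 4)) ℝ) : (EuclideanSpace ℝ (Fin 4)) → ℝ) ⊆ Metric.closedBall (EuclideanSpace.single (0 : Fin 4) s) r → (∀ x, |f 0 x| ≤ M₀) → (∀ x, |f 1 x| ≤ M₁) → ‖S₁ 2 F‖ ≤ A * (∫ x : (EuclideanSpace ℝ (Fin 4)), |f 0 x|) * (∫ x : (EuclideanSpace ℝ (Fin 4)), |f 1 x|) + B * r ^ 8 * M₀ * M₁))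

/-- **L′ · SmearedToLocalDecay** (provable now): `W₁` + the smeared lattice window bound of the scheme ⇒ T (lattice tie at
`n = 2, 1` along the good subsequence, `S₁ 1 = κ∫`, lattice point count `R_k(f) ≤ (3ρ)⁴ ‖f‖∞`; as in B₁ without the per-pair step). [folklore] -/
def SmearedToLocalDecay : Prop :=
  open Literature.MathematicalPhysics.QuantumLattice Literature.MathematicalPhysics.AQFT Literature.MathematicalPhysics.QuantumFieldTheory in ∀ (G : Type) [Group G] [TopologicalSpace G] [IsTopologicalGroup G] [CompactSpace G] [MeasurableSpace G] [BorelSpace G], IsCompactSimpleLieGroup G → ∀ (r : LatticeRep G) (sch : SpeciesScheme (YMSpecies G)) (S₁ : SchwingerFamily (EuclideanSpace ℝ (Fin 4))), ((∀ (n : ℕ), n ≠ 0 → ∀ (f : Fin n → SchwartzMap (EuclideanSpace ℝ (Fin 4)) ℝ) (F : SchwartzMap (Fin n → (EuclideanSpace ℝ (Fin 4))) ℂ), IsTensorOf F (fun i => ofRealTest (f i)) → IsOffDiagonal F → Filter.Tendsto (fun k : ℕ => ((latticeSchwinger r.ρ sch (fun s => s.F) k n (fun _ => r.curvature) f : ℝ)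 : ℂ)) Filter.atTop (nhds (S₁ n F))) ∧ (S₁.toLabelled.IsNormalized ∧ S₁.toLabelled.IsHermitian ∧ S₁.toLabelled.HasLinearGrowth ∧ S₁.toLabelled.IsReflectionPositive ∧ S₁.toLabelled.IsSymmetric ∧ S₁.toLabelled.HasClusterProperty) ∧ (∀ (n : ℕ) (a : (EuclideanSpace ℝ (Fin 4))) (F : SchwartzMap (Fin n → (EuclideanSpace ℝ (Fin 4))) ℂ), IsOffDiagonal F → S₁ n (translateMulti a F) = S₁ n F) ∧ (∀ (R : (EuclideanSpace ℝ (Fin 4)) ≃ₗᵢ[ℝ] (EuclideanSpace ℝ (Fin 4))), LinearMap.det (R.toLinearEquiv : (EuclideanSpace ℝ (Fin 4)) →ₗ[ℝ] (EuclideanSpace ℝ (Fin 4))) = 1 → (∀ i : Fin 4, ∃ j : Fin 4, R (EuclideanSpace.single i 1) = EuclideanSpace.single j 1 ∨ R (EuclideanSpace.single i 1) = -EuclideanSpace.single j 1) → ∀ (n : ℕ) (F : SchwartzMap (Fin n → (EuclideanSpace ℝ (Fin 4))) ℂ), IsOffDiagonal F → S₁ n (linActMulti R F) = S₁ n F) ∧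 (∃ Δ : ℝ, 0 < Δ ∧ S₁.toLabelled.HasMassGap Δ ∧ HasLatticeMassGap r sch Δ)) → (∃ (C η θ R₀ : ℝ), 0 < η ∧ 0 < θ ∧ ∃ᶠ k in Filter.atTop, ∀ (s ρ : ℝ), 0 < s → sch.a k * R₀ ≤ s → s ≤ θ → 0 < ρ → ρ ≤ s / 2 → ∀ (f : Fin 2 → SchwartzMap (EuclideanSpace ℝ (Fin 4)) ℝ), tsupport ((f 0 : SchwartzMap (EuclideanSpace ℝ (Fin 4)) ℝ) : (EuclideanSpace ℝ (Fin 4)) → ℝ) ⊆ Metric.closedBall (EuclideanSpace.single (0 : Fin 4) (-s)) ρ → tsupport ((f 1 : SchwartzMap (EuclideanSpace ℝ (Fin 4)) ℝ) : (EuclideanSpace ℝ (Fin 4)) → ℝ) ⊆ Metric.closedBall (EuclideanSpace.single (0 : Fin 4) s) ρ → |latticeSchwinger r.ρ sch (fun s => s.F) k 2 (fun _ => r.curvature) f - latticeSchwinger r.ρ sch (fun s => s.F) k 1 (fun _ => r.curvature) (fun _ => f 0) * latticeSchwinger r.ρ sch (fun s => s.F) k 1 (fun _ => r.curvature) (fun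 _ => f 1)| ≤ C * s ^ (η - 10) * ((sch.a k) ^ 4 * ∑ x ∈ Literature.Probability.LatticeModels.box 4 (sch.L k), |f 0 (sch.a k • siteToE x)|) * ((sch.a k) ^ 4 * ∑ x ∈ Literature.Probability.LatticeModels.box 4 (sch.L k), |f 1 (sch.a k • siteToE x)|)) → ∃ (C η s₁ : ℝ), 0 < η ∧ 0 < s₁ ∧ (∀ (s : ℝ), 0 < s → s < s₁ → ∃ (r₀ A B : ℝ), 0 < r₀ ∧ 0 ≤ A ∧ 0 ≤ B ∧ A + B ≤ C * s ^ (η - 10) ∧ (∀ (r : ℝ), 0 < r → r ≤ r₀ → ∀ (f : Fin 2 → SchwartzMap (EuclideanSpace ℝ (Fin 4)) ℝ) (F : SchwartzMap (Fin 2 → (EuclideanSpace ℝ (Fin 4))) ℂ) (M₀ M₁ : ℝ), IsTensorOf F (fun i => ofRealTest (f i)) → tsupport ((f 0 : SchwartzMap (EuclideanSpace ℝ (Fin 4)) ℝ) : (EuclideanSpace ℝ (Fin 4)) → ℝ) ⊆ Metric.closedBall (EuclideanSpace.single (0 : Fin 4) (-s)) r → tsupport ((f 1 : SchwartzMap (EuclideanSpace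 ℝ (Fin 4)) ℝ) : (EuclideanSpace ℝ (Fin 4)) → ℝ) ⊆ Metric.closedBall (EuclideanSpace.single (0 : Fin 4) s) r → (∀ x, |f 0 x| ≤ M₀) → (∀ x, |f 1 x| ≤ M₁) → ‖S₁ 2 F‖ ≤ A * (∫ x : (EuclideanSpace ℝ (Fin 4)), |f 0 x|) * (∫ x : (EuclideanSpace ℝ (Fin 4)), |f 1 x|) + B * r ^ 8 * M₀ * M₁))

/-- **E^sm · SmearedLatticeWindowBound** (YM-specific; the ONE OPEN stub of v15, sign-free): for non-factorising `W₁`-data with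
`|c_k| → ∞` there are `C, η > 0, θ > 0, R₀` such that, frequently in `k`, for all physical scales `s` with `a_k R₀ ≤ s ≤ θ`, radii
`0 < ρ ≤ s/2` and real Schwartz `f₀, f₁` supported in the `ρ`-balls about `−s e₀`, `+s e₀`:
`|LS₂(f₀,f₁) − LS₁(f₀) LS₁(f₁)| ≤ C s^(η−10) · R_k(f₀) · R_k(f₁)`, `R_k(f) = a_k⁴ Σ_{x ∈ box_k} |f(a_k x)|`, where `LSₙ` are the
scheme's renormalised lattice `n`-point functions of the curvature species (they carry `c_k`). A short-distance bound on the
SMEARED renormalised truncated plaquette two-point function of 4D lattice Yang–Mills through the scaling window (asymptotic freedom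
predicts `η = 2`); implied by the pointwise E‴₁ (J), needs no reflection positivity, and is the form a multiscale (Bałaban-type)
expansion delivers. [JaffeWitten2000 §6.5 fn. 2; Balaban1989LargeFieldII; MagnenRivasseauSeneor1993] -/
def SmearedLatticeWindowBound : Prop :=
  open Literature.MathematicalPhysics.QuantumLattice Literature.MathematicalPhysics.AQFT Literature.MathematicalPhysics.QuantumFieldTheory in ∀ (G : Type) [Group G] [TopologicalSpace G] [IsTopologicalGroup G] [CompactSpace G] [MeasurableSpace G] [BorelSpace G], IsCompactSimpleLieGroup G → ∀ (r : LatticeRep G) (sch : SpeciesScheme (YMSpecies G)) (S₁ : SchwingerFamily (EuclideanSpace ℝ (Fin 4))), ((∀ (n : ℕ), n ≠ 0 → ∀ (f : Fin n → SchwartzMap (EuclideanSpace ℝ (Fin 4)) ℝ) (F : SchwartzMap (Fin n → (EuclideanSpace ℝ (Fin 4))) ℂ), IsTensorOf F (fun i => ofRealTest (f i)) → IsOffDiagonal F → Filter.Tendsto (fun k : ℕ => ((latticeSchwinger r.ρ sch (fun s => s.F) k n (fun _ => r.curvature) f : ℝ) : ℂ)) Filter.atTop (nhds (S₁ n F)))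 ∧ (S₁.toLabelled.IsNormalized ∧ S₁.toLabelled.IsHermitian ∧ S₁.toLabelled.HasLinearGrowth ∧ S₁.toLabelled.IsReflectionPositive ∧ S₁.toLabelled.IsSymmetric ∧ S₁.toLabelled.HasClusterProperty) ∧ (∀ (n : ℕ) (a : (EuclideanSpace ℝ (Fin 4))) (F : SchwartzMap (Fin n → (EuclideanSpace ℝ (Fin 4))) ℂ), IsOffDiagonal F → S₁ n (translateMulti a F) = S₁ n F) ∧ (∀ (R : (EuclideanSpace ℝ (Fin 4)) ≃ₗᵢ[ℝ] (EuclideanSpace ℝ (Fin 4))), LinearMap.det (R.toLinearEquiv : (EuclideanSpace ℝ (Fin 4)) →ₗ[ℝ] (EuclideanSpace ℝ (Fin 4))) = 1 → (∀ i : Fin 4, ∃ j : Fin 4, R (EuclideanSpace.single i 1) = EuclideanSpace.single j 1 ∨ R (EuclideanSpace.single i 1) = -EuclideanSpace.single j 1) → ∀ (n : ℕ) (F : SchwartzMap (Fin n → (EuclideanSpace ℝ (Fin 4))) ℂ), IsOffDiagonal F → S₁ n (linActMulti R F) = S₁ n F) ∧ (∃ Δ : ℝ, 0 < Δ ∧ S₁.toLabelled.HasMassGap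 Δ ∧ HasLatticeMassGap r sch Δ)) → (∃ (f : Fin 2 → SchwartzMap (EuclideanSpace ℝ (Fin 4)) ℝ) (F : SchwartzMap (Fin 2 → (EuclideanSpace ℝ (Fin 4))) ℂ) (F₀ F₁ : SchwartzMap (Fin 1 → (EuclideanSpace ℝ (Fin 4))) ℂ), IsTensorOf F (fun i => ofRealTest (f i)) ∧ IsOffDiagonal F ∧ IsTensorOf F₀ (fun _ => ofRealTest (f 0)) ∧ IsTensorOf F₁ (fun _ => ofRealTest (f 1)) ∧ S₁ 2 F ≠ S₁ 1 F₀ * S₁ 1 F₁) → Filter.Tendsto (fun k : ℕ => |sch.c r.curvature k|) Filter.atTop Filter.atTop → (∃ (C η θ R₀ : ℝ), 0 < η ∧ 0 < θ ∧ ∃ᶠ k in Filter.atTop, ∀ (s ρ : ℝ), 0 < s → sch.a k * R₀ ≤ s → s ≤ θ → 0 < ρ → ρ ≤ s / 2 → ∀ (f : Fin 2 → SchwartzMap (EuclideanSpace ℝ (Fin 4)) ℝ), tsupport ((f 0 : SchwartzMap (EuclideanSpace ℝ (Fin 4)) ℝ) : (EuclideanSpace ℝ (Fin 4)) → ℝ)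 ⊆ Metric.closedBall (EuclideanSpace.single (0 : Fin 4) (-s)) ρ → tsupport ((f 1 : SchwartzMap (EuclideanSpace ℝ (Fin 4)) ℝ) : (EuclideanSpace ℝ (Fin 4)) → ℝ) ⊆ Metric.closedBall (EuclideanSpace.single (0 : Fin 4) s) ρ → |latticeSchwinger r.ρ sch (fun s => s.F) k 2 (fun _ => r.curvature) f - latticeSchwinger r.ρ sch (fun s => s.F) k 1 (fun _ => r.curvature) (fun _ => f 0) * latticeSchwinger r.ρ sch (fun s => s.F) k 1 (fun _ => r.curvature) (fun _ => f 1)| ≤ C * s ^ (η - 10) * ((sch.a k) ^ 4 * ∑ x ∈ Literature.Probability.LatticeModels.box 4 (sch.L k), |f 0 (sch.a k • siteToE x)|) * ((sch.a k) ^ 4 * ∑ x ∈ Literature.Probability.LatticeModels.box 4 (sch.L k), |f 1 (sch.a k • siteToE x)|))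

/-- **J · SmearedOfPointwise** (provable now, per scheme): the one-variable pointwise window bound (E‴₁'s conclusion) implies the
smeared window bound (pair form by lifted torus translation invariance `LatticeWindowPairOfOne`, then `abs_truncated_le_of_cov_le` on
the window `s ≤ a_k‖x − y‖ ≤ 3s`). [folklore] -/
def SmearedOfPointwise : Prop :=
  open Literature.MathematicalPhysics.QuantumLattice Literature.MathematicalPhysics.AQFT Literature.MathematicalPhysics.QuantumFieldTheory in ∀ (G : Type) [Group G] [TopologicalSpace G] [IsTopologicalGroup G] [CompactSpace G] [MeasurableSpace G] [BorelSpace G] (r : LatticeRep G) (sch : SpeciesScheme (YMSpecies G)), (∃ (C η θ R₀ : ℝ), 0 < η ∧ 0 < θ ∧ ∃ᶠ k in Filter.atTop, ∀ z : Literature.Probability.LatticeModels.Site 4, z ∈ Literature.Probability.LatticeModels.box 4 (sch.L k) → z ≠ 0 → R₀ ≤ ‖siteToE z‖ → sch.a k * ‖siteToE z‖ ≤ θ → (sch.c r.curvature k) ^ 2 * |(∫ U, r.curvature.F (torusLift (sch.side k) U) * r.curvature.F (configShift (-z) (torusLift (sch.side k) U)) ∂(wilsonMeasure r.ρ (sch.β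 k) : MeasureTheory.Measure (GaugeConfig 4 (sch.side k) G))) - (∫ U, r.curvature.F (torusLift (sch.side k) U) ∂(wilsonMeasure r.ρ (sch.β k) : MeasureTheory.Measure (GaugeConfig 4 (sch.side k) G))) * (∫ U, r.curvature.F (configShift (-z) (torusLift (sch.side k) U)) ∂(wilsonMeasure r.ρ (sch.β k) : MeasureTheory.Measure (GaugeConfig 4 (sch.side k) G)))| ≤ C * (sch.a k * ‖siteToE z‖) ^ (η - 10)) → (∃ (C η θ R₀ : ℝ), 0 < η ∧ 0 < θ ∧ ∃ᶠ k in Filter.atTop, ∀ (s ρ : ℝ), 0 < s → sch.a k * R₀ ≤ s → s ≤ θ → 0 < ρ → ρ ≤ s / 2 → ∀ (f : Fin 2 → SchwartzMap (EuclideanSpace ℝ (Fin 4)) ℝ), tsupport ((f 0 : SchwartzMap (EuclideanSpace ℝ (Fin 4)) ℝ) : (EuclideanSpace ℝ (Fin 4)) → ℝ) ⊆ Metric.closedBall (EuclideanSpace.single (0 : Fin 4) (-s)) ρ → tsupport ((f 1 : SchwartzMap (EuclideanSpace ℝ (Fin 4)) ℝ) : (EuclideanSpace ℝ (Fin 4))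 → ℝ) ⊆ Metric.closedBall (EuclideanSpace.single (0 : Fin 4) s) ρ → |latticeSchwinger r.ρ sch (fun s => s.F) k 2 (fun _ => r.curvature) f - latticeSchwinger r.ρ sch (fun s => s.F) k 1 (fun _ => r.curvature) (fun _ => f 0) * latticeSchwinger r.ρ sch (fun s => s.F) k 1 (fun _ => r.curvature) (fun _ => f 1)| ≤ C * s ^ (η - 10) * ((sch.a k) ^ 4 * ∑ x ∈ Literature.Probability.LatticeModels.box 4 (sch.L k), |f 0 (sch.a k • siteToE x)|) * ((sch.a k) ^ 4 * ∑ x ∈ Literature.Probability.LatticeModels.box 4 (sch.L k), |f 1 (sch.a k • siteToE x)|))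

/-! ## Registered stubs `Stub.<Name>` (`sorry` lives only here) -/

namespace Stub

/-- Registered stub E^sm (OPEN; the UV core, sign-free smeared lattice currency). -/
theorem SmearedLatticeWindowBound : open Literature.MathematicalPhysics.QuantumLattice Literature.MathematicalPhysics.AQFT Literature.MathematicalPhysics.QuantumFieldTheory in ∀ (G : Type) [Group G] [TopologicalSpace G] [IsTopologicalGroup G] [CompactSpace G] [MeasurableSpace G] [BorelSpace G], IsCompactSimpleLieGroup G → ∀ (r : LatticeRep G) (sch : SpeciesScheme (YMSpecies G)) (S₁ : SchwingerFamily (EuclideanSpace ℝ (Fin 4))), ((∀ (n : ℕ), n ≠ 0 → ∀ (f : Fin n → SchwartzMap (EuclideanSpace ℝ (Fin 4)) ℝ) (F : SchwartzMap (Fin n → (EuclideanSpace ℝ (Fin 4))) ℂ), IsTensorOf F (fun i => ofRealTest (f i)) → IsOffDiagonal F → Filter.Tendsto (fun k : ℕ => ((latticeSchwinger r.ρ sch (fun s => s.F) k n (fun _ => r.curvature) f : ℝ) : ℂ)) Filter.atTop (nhds (S₁ n F))) ∧ (S₁.toLabelled.IsNormalized ∧ S₁.toLabelled.IsHermitian ∧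 S₁.toLabelled.HasLinearGrowth ∧ S₁.toLabelled.IsReflectionPositive ∧ S₁.toLabelled.IsSymmetric ∧ S₁.toLabelled.HasClusterProperty) ∧ (∀ (n : ℕ) (a : (EuclideanSpace ℝ (Fin 4))) (F : SchwartzMap (Fin n → (EuclideanSpace ℝ (Fin 4))) ℂ), IsOffDiagonal F → S₁ n (translateMulti a F) = S₁ n F) ∧ (∀ (R : (EuclideanSpace ℝ (Fin 4)) ≃ₗᵢ[ℝ] (EuclideanSpace ℝ (Fin 4))), LinearMap.det (R.toLinearEquiv : (EuclideanSpace ℝ (Fin 4)) →ₗ[ℝ] (EuclideanSpace ℝ (Fin 4))) = 1 → (∀ i : Fin 4, ∃ j : Fin 4, R (EuclideanSpace.single i 1) = EuclideanSpace.single j 1 ∨ R (EuclideanSpace.single i 1) = -EuclideanSpace.single j 1) → ∀ (n : ℕ) (F : SchwartzMap (Fin n → (EuclideanSpace ℝ (Fin 4))) ℂ), IsOffDiagonal F → S₁ n (linActMulti R F) = S₁ n F) ∧ (∃ Δ : ℝ, 0 < Δ ∧ S₁.toLabelled.HasMassGap Δ ∧ HasLatticeMassGap r sch Δ)) → (∃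 (f : Fin 2 → SchwartzMap (EuclideanSpace ℝ (Fin 4)) ℝ) (F : SchwartzMap (Fin 2 → (EuclideanSpace ℝ (Fin 4))) ℂ) (F₀ F₁ : SchwartzMap (Fin 1 → (EuclideanSpace ℝ (Fin 4))) ℂ), IsTensorOf F (fun i => ofRealTest (f i)) ∧ IsOffDiagonal F ∧ IsTensorOf F₀ (fun _ => ofRealTest (f 0)) ∧ IsTensorOf F₁ (fun _ => ofRealTest (f 1)) ∧ S₁ 2 F ≠ S₁ 1 F₀ * S₁ 1 F₁) → Filter.Tendsto (fun k : ℕ => |sch.c r.curvature k|) Filter.atTop Filter.atTop → (∃ (C η θ R₀ : ℝ), 0 < η ∧ 0 < θ ∧ ∃ᶠ k in Filter.atTop, ∀ (s ρ : ℝ), 0 < s → sch.a k * R₀ ≤ s → s ≤ θ → 0 < ρ → ρ ≤ s / 2 → ∀ (f : Fin 2 → SchwartzMap (EuclideanSpace ℝ (Fin 4)) ℝ), tsupport ((f 0 : SchwartzMap (EuclideanSpace ℝ (Fin 4)) ℝ) : (EuclideanSpace ℝ (Fin 4)) → ℝ) ⊆ Metric.closedBall (EuclideanSpace.single (0 : Fin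 4) (-s)) ρ → tsupport ((f 1 : SchwartzMap (EuclideanSpace ℝ (Fin 4)) ℝ) : (EuclideanSpace ℝ (Fin 4)) → ℝ) ⊆ Metric.closedBall (EuclideanSpace.single (0 : Fin 4) s) ρ → |latticeSchwinger r.ρ sch (fun s => s.F) k 2 (fun _ => r.curvature) f - latticeSchwinger r.ρ sch (fun s => s.F) k 1 (fun _ => r.curvature) (fun _ => f 0) * latticeSchwinger r.ρ sch (fun s => s.F) k 1 (fun _ => r.curvature) (fun _ => f 1)| ≤ C * s ^ (η - 10) * ((sch.a k) ^ 4 * ∑ x ∈ Literature.Probability.LatticeModels.box 4 (sch.L k), |f 0 (sch.a k • siteToE x)|) * ((sch.a k) ^ 4 * ∑ x ∈ Literature.Probability.LatticeModels.box 4 (sch.L k), |f 1 (sch.a k • siteToE x)|)) := by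
  sorry

end Stub

/-! ## The composition, v15 core (kernel-checked; no `sorry` below this line): FIRST theorem concluding the crux -/

/-- **The crux, by name** — record theorems below conclude this ALIAS, so that exactly the skeleton theorems
(`CurvatureKernelBound_of`, `CurvatureKernelBound_proof`) conclude the crux constant itself (the skeleton checker picks among those). -/
def Crux : Prop :=
  Summit.QuantumFields.YangMills.Theses.PencilRigidity.CurvatureKernelBound


/-- From `¬ Tendsto u atTop atTop` to a frequently-bounded sequence. [folklore] -/
theorem exists_frequently_le_of_not_tendsto {u : ℕ → ℝ} (h : ¬ Filter.Tendsto u Filter.atTop Filter.atTop) :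
    ∃ M : ℝ, ∃ᶠ k in Filter.atTop, u k ≤ M := by
  rw [Filter.tendsto_atTop] at h
  push Not at h
  obtain ⟨M, hM⟩ := h
  exact ⟨M, hM.mono fun k hk => le_of_lt hk⟩

/-- From `¬ (∃ M, ∃ᶠ k, u k ≤ M)` to `Tendsto u atTop atTop`. [folklore] -/
theorem tendsto_of_not_exists_frequently_le {u : ℕ → ℝ} (h : ¬ ∃ M : ℝ, ∃ᶠ k in Filter.atTop, u k ≤ M) :
    Filter.Tendsto u Filter.atTop Filter.atTop := by
  by_contra h'
  exact h (exists_frequently_le_of_not_tendsto h')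

/-- **T from its branches**: factorising or frequently-bounded `c_k` by B₂′; the scaling branch by L′ fed with E^sm. -/
theorem twoPointLocalDecay_of (hB : SemiDegenerateLocalDecay) (hL : SmearedToLocalDecay)
    (hE : SmearedLatticeWindowBound) : TwoPointLocalDecay := by
  intro G _ _ _ _ _ _ hG r sch S₁ hW₁
  by_cases hdeg : (∀ (f : Fin 2 → SchwartzMap (EuclideanSpace ℝ (Fin 4)) ℝ) (F : SchwartzMap (Fin 2 → (EuclideanSpace ℝ (Fin 4))) ℂ) (F₀ F₁ : SchwartzMap (Fin 1 → (EuclideanSpace ℝ (Fin 4))) ℂ), IsTensorOf F (fun i => ofRealTest (f i)) → IsOffDiagonal F → IsTensorOf F₀ (fun _ => ofRealTest (f 0)) → IsTensorOf F₁ (fun _ => ofRealTest (f 1)) → S₁ 2 F = S₁ 1 F₀ * S₁ 1 F₁)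
  · exact hB G hG r sch S₁ hW₁ (Or.inl hdeg)
  · by_cases hbd : (∃ M : ℝ, ∃ᶠ k in Filter.atTop, |sch.c r.curvature k| ≤ M)
    · exact hB G hG r sch S₁ hW₁ (Or.inr hbd)
    · have hsc := tendsto_of_not_exists_frequently_le hbd
      push Not at hdeg
      obtain ⟨f, F, F₀, F₁, hF, hoff, hF₀, hF₁, hne⟩ := hdeg
      exact hL G hG r sch S₁ hW₁ (hE G hG r sch S₁ hW₁ ⟨f, F, F₀, F₁, hF, hoff, hF₀, hF₁, hne⟩ hsc)

/-- **`CurvatureKernelBound_of`** — the glue of the line, v16: the LANDED G `CurvatureKernelBoundReductionDFree` fed by the LANDED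
I₁ `KernelExistenceOfLocalDecay` and I₂ `AxialGrowthOfLocalDecay` applied to T, itself glued (`twoPointLocalDecay_of`) from the LANDED
B₂′ `SemiDegenerateLocalDecay`, L′ `SmearedToLocalDecay` and the ONE registered open stub E^sm `SmearedLatticeWindowBound`. -/
theorem CurvatureKernelBound_of (hE : SmearedLatticeWindowBound) :
    Summit.QuantumFields.YangMills.Theses.PencilRigidity.CurvatureKernelBound :=
  have hT : TwoPointLocalDecay :=
    twoPointLocalDecay_of Summit.QuantumFields.YangMills.Theorems.CurvatureKernel.SemiDegenerateLocalDecay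
      Summit.QuantumFields.YangMills.Theorems.CurvatureKernel.SmearedToLocalDecay hE
  Summit.QuantumFields.YangMills.Theorems.CurvatureKernel.CurvatureKernelBoundReductionDFree
    (Summit.QuantumFields.YangMills.Theorems.CurvatureKernel.KernelExistenceOfLocalDecay hT)
    (Summit.QuantumFields.YangMills.Theorems.CurvatureKernel.AxialGrowthOfLocalDecay hT)

/-- **I · crux from T** (glue over the landed G, with I₁ and I₂ as hypotheses — the v15 shape, kept for the record). -/
theorem curvatureKernelBound_of_twoPointLocalDecay (hI1 : KernelExistenceOfLocalDecay) (hI2 : AxialGrowthOfLocalDecay)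
    (hT : TwoPointLocalDecay) : Crux :=
  Summit.QuantumFields.YangMills.Theorems.CurvatureKernel.CurvatureKernelBoundReductionDFree (hI1 hT) (hI2 hT)

/-- **The v15 glue with all five inputs as hypotheses** (kept for the record). -/
theorem curvatureKernelBound_of_inputs (hI1 : KernelExistenceOfLocalDecay) (hI2 : AxialGrowthOfLocalDecay)
    (hB : SemiDegenerateLocalDecay) (hL : SmearedToLocalDecay) (hE : SmearedLatticeWindowBound) :
    Crux :=
  curvatureKernelBound_of_twoPointLocalDecay hI1 hI2 (twoPointLocalDecay_of hB hL hE)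

/-! ## The composition (kernel-checked; no `sorry` below this line) -/

/-- **E‴ (pair form) from E‴₁ (one variable)** by the landed glue. -/
theorem latticeWindowBound_of (hG1 : LatticeWindowPairOfOne) (hE31 : LatticeKernelWindowBound) : LatticeWindowBound := by
  intro G _ _ _ _ _ _ hG r sch S₁ hW₁ hnd hsc
  exact hG1 G r sch (hE31 G hG r sch S₁ hW₁ hnd hsc)

/-- **E″ from L3 and E‴**: the lattice window bound of the scaling branch, transferred to the continuum kernel. -/
theorem axialGrowthScaling_of (hL3 : LatticeWindowTransfer) (hE3 : LatticeWindowBound) : AxialGrowthScaling := by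
  intro G _ _ _ _ _ _ hG r sch S₁ hW₁ hnd hsc K hcont hrep
  exact hL3 G hG r sch S₁ hW₁ (hE3 G hG r sch S₁ hW₁ hnd hsc) K hcont hrep

/-- **E′ from its two sub-branches**: bounded renormalisation by the LANDED L2 (fed with the LANDED L1), `|c_k| → ∞` by E″. -/
theorem axialGrowthNondegenerate_of (hE'' : AxialGrowthScaling) : AxialGrowthNondegenerate := by
  intro G _ _ _ _ _ _ hG r sch S₁ hW₁ hnd K hcont hrep
  by_cases hsc : Filter.Tendsto (fun k : ℕ => |sch.c r.curvature k|) Filter.atTop Filter.atTop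
  · exact hE'' G hG r sch S₁ hW₁ hnd hsc K hcont hrep
  · exact Summit.QuantumFields.YangMills.Theorems.CurvatureKernel.BoundedRenormalisationAxialGrowth
      Summit.QuantumFields.YangMills.Theorems.CurvatureKernel.LatticeTruncatedTwoPointBound
      G hG r sch S₁ hW₁ (exists_frequently_le_of_not_tendsto hsc) K hcont hrep

/-- **E from its two branches**: factorising data by the LANDED S2 (via the LANDED S1), non-factorising data by E′. -/
theorem axialGrowth_of (hE' : AxialGrowthNondegenerate) : AxialGrowth := by
  intro G _ _ _ _ _ _ hG r sch S₁ hW₁ K hcont hrep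
  by_cases hdeg : ∀ (f : Fin 2 → SchwartzMap (EuclideanSpace ℝ (Fin 4)) ℝ)
      (F : SchwartzMap (Fin 2 → (EuclideanSpace ℝ (Fin 4))) ℂ) (F₀ F₁ : SchwartzMap (Fin 1 → (EuclideanSpace ℝ (Fin 4))) ℂ),
      IsTensorOf F (fun i => ofRealTest (f i)) → IsOffDiagonal F → IsTensorOf F₀ (fun _ => ofRealTest (f 0)) →
      IsTensorOf F₁ (fun _ => ofRealTest (f 1)) → S₁ 2 F = S₁ 1 F₀ * S₁ 1 F₁
  · exact Summit.QuantumFields.YangMills.Theorems.CurvatureKernel.DegenerateAxialGrowth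
      Summit.QuantumFields.YangMills.Theorems.CurvatureKernel.OffDiagonalVanishing S₁ hW₁.2.2.1 hdeg K hcont hrep
  · push Not at hdeg
    obtain ⟨f, F, F₀, F₁, hF, hoff, hF₀, hF₁, hne⟩ := hdeg
    exact hE' G hG r sch S₁ hW₁ ⟨f, F, F₀, F₁, hF, hoff, hF₀, hF₁, hne⟩ K hcont hrep

/-- **Kernel existence for `W₁`-data, D-FREE**: branch on factorisation and on bounded renormalisation; the scaling branch takes its
local bounds from E‴₁ through the landed one-variable-to-pair glue. -/
theorem kernelExistenceW1_of (hH : HalfSpaceKernel) (hR : LocalRepresentation) (hX : KernelExistence)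
    (hB1 : TwoPointLocalBoundScaling) (hB2 : TwoPointLocalBoundSemiDegenerate)
    (hG1 : LatticeWindowPairOfOne) (hE31 : LatticeKernelWindowBound) : KernelExistenceW1 := by
  intro G _ _ _ _ _ _ hG r sch S₁ hW₁
  have hLBF : ∃ (s₁ A₀ : ℝ) (p₀ : ℕ), 0 < s₁ ∧ 0 ≤ A₀ ∧ (∀ (s : ℝ), 0 < s → s < s₁ → ∃ (r₀ A B : ℝ), 0 < r₀ ∧ 0 ≤ A ∧ 0 ≤ B ∧ A + B ≤ A₀ * (1 + s⁻¹ ^ p₀) ∧ (∀ (r : ℝ), 0 < r → r ≤ r₀ → ∀ (f : Fin 2 → SchwartzMap (EuclideanSpace ℝ (Fin 4)) ℝ) (F : SchwartzMap (Fin 2 → (EuclideanSpace ℝ (Fin 4))) ℂ) (M₀ M₁ : ℝ), IsTensorOf F (fun i => ofRealTest (f i)) → tsupport ((f 0 : SchwartzMap (EuclideanSpace ℝ (Fin 4)) ℝ) : (EuclideanSpace ℝ (Fin 4)) → ℝ) ⊆ Metric.closedBall (EuclideanSpace.single (0 : Fin 4) (-s)) r → tsupport ((f 1 : SchwartzMap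 (EuclideanSpace ℝ (Fin 4)) ℝ) : (EuclideanSpace ℝ (Fin 4)) → ℝ) ⊆ Metric.closedBall (EuclideanSpace.single (0 : Fin 4) s) r → (∀ x, |f 0 x| ≤ M₀) → (∀ x, |f 1 x| ≤ M₁) → ‖S₁ 2 F‖ ≤ A * (∫ x : (EuclideanSpace ℝ (Fin 4)), |f 0 x|) * (∫ x : (EuclideanSpace ℝ (Fin 4)), |f 1 x|) + B * r ^ 8 * M₀ * M₁)) := by
    by_cases hdeg : (∀ (f : Fin 2 → SchwartzMap (EuclideanSpace ℝ (Fin 4)) ℝ) (F : SchwartzMap (Fin 2 → (EuclideanSpace ℝ (Fin 4))) ℂ) (F₀ F₁ : SchwartzMap (Fin 1 → (EuclideanSpace ℝ (Fin 4))) ℂ), IsTensorOf F (fun i => ofRealTest (f i)) → IsOffDiagonal F → IsTensorOf F₀ (fun _ => ofRealTest (f 0)) → IsTensorOf F₁ (fun _ => ofRealTest (f 1)) → S₁ 2 F = S₁ 1 F₀ * S₁ 1 F₁)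
    · exact hB2 G hG r sch S₁ hW₁ (Or.inl hdeg)
    · by_cases hbd : (∃ M : ℝ, ∃ᶠ k in Filter.atTop, |sch.c r.curvature k| ≤ M)
      · exact hB2 G hG r sch S₁ hW₁ (Or.inr hbd)
      · have hsc := tendsto_of_not_exists_frequently_le hbd
        push Not at hdeg
        obtain ⟨f, F, F₀, F₁, hF, hoff, hF₀, hF₁, hne⟩ := hdeg
        exact hB1 G hG r sch S₁ hW₁ (hG1 G r sch (hE31 G hG r sch S₁ hW₁ ⟨f, F, F₀, F₁, hF, hoff, hF₀, hF₁, hne⟩ hsc))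
  exact hX hH hR S₁ hW₁.2.1.2.2.2.1 hW₁.2.2.1 hW₁.2.2.2.1 hLBF

/-! ## The composition, v13 part (kernel-checked; no `sorry` below this line) -/

section AxisGlue

open Literature.Probability.LatticeModels (box mem_box)

/-- Every lattice site has a coordinate of maximal modulus: `z i = ±n`, `|z j| ≤ n` for all `j`. [folklore] -/
theorem exists_coord_abs_eq (z : Literature.Probability.LatticeModels.Site 4) :
    ∃ (n : ℕ) (i : Fin 4), (z i = n ∨ z i = -n) ∧ ∀ j, |z j| ≤ n := by
  obtain ⟨i, -, hi⟩ := Finset.exists_mem_eq_sup (Finset.univ : Finset (Fin 4)) Finset.univ_nonempty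
    (fun j => (z j).natAbs)
  refine ⟨(z i).natAbs, i, ?_, fun j => ?_⟩
  · rcases Int.natAbs_eq (z i) with h | h
    · exact Or.inl h
    · exact Or.inr h
  · have hj : (z j).natAbs ≤ Finset.univ.sup (fun j => (z j).natAbs) :=
      Finset.le_sup (f := fun j => (z j).natAbs) (Finset.mem_univ j)
    rw [hi] at hj
    rw [← Int.natCast_natAbs]
    exact_mod_cast hj

/-- A coordinate is bounded by the Euclidean norm of the embedded site. [folklore] -/
theorem abs_coord_le_norm_siteToE (z : Literature.Probability.LatticeModels.Site 4) (i : Fin 4) :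
    |(z i : ℝ)| ≤ ‖siteToE z‖ := by
  have h := PiLp.norm_apply_le (siteToE z) i
  rwa [siteToE_apply, Real.norm_eq_abs] at h

/-- The Euclidean norm of the embedded site is at most twice its sup norm (dimension four). [folklore] -/
theorem norm_siteToE_le_two_mul (z : Literature.Probability.LatticeModels.Site 4) {n : ℕ} (h : ∀ j, |z j| ≤ n) :
    ‖siteToE z‖ ≤ 2 * n := by
  rw [EuclideanSpace.norm_eq]
  have hs : ∑ j, ‖siteToE z j‖ ^ 2 ≤ ∑ _j : Fin 4, (n : ℝ) ^ 2 := Finset.sum_le_sum fun j _ => by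
    rw [siteToE_apply, Real.norm_eq_abs]
    have hj : |(z j : ℝ)| ≤ n := by
      have := h j
      rw [← Int.cast_abs]
      exact_mod_cast this
    exact pow_le_pow_left₀ (abs_nonneg _) hj 2
  calc Real.sqrt (∑ j, ‖siteToE z j‖ ^ 2) ≤ Real.sqrt (∑ _j : Fin 4, (n : ℝ) ^ 2) := Real.sqrt_le_sqrt hs
    _ = 2 * n := by
        rw [Finset.sum_const, Finset.card_univ, Fintype.card_fin, nsmul_eq_mul]
        rw [show ((4 : ℕ) : ℝ) * (n : ℝ) ^ 2 = (2 * n) ^ 2 by push_cast; ring]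
        exact Real.sqrt_sq (by positivity)

/-- Elementary: a window bound `C (a m)^(η−10)` at a lattice separation `m` with `a m ≤ θ` and `‖z‖/4 ≤ m·a/a…` is dominated by
`K (a‖z‖)^(η'−10)` with `η' = min η 1` and `K = max C 0 · θ^(η−η') · 4^(10−η')`. [folklore] -/
theorem window_bound_transfer {C η θ a s : ℝ} {m : ℕ} (ha : 0 < a) (hm : 0 < (m : ℝ))
    (hmθ : a * m ≤ θ) (hs : 0 < s) (hsm : s ≤ 4 * m) {X : ℝ} (hX : X ≤ C * (a * m) ^ (η - 10)) :
    X ≤ (max C 0 * θ ^ (η - min η 1) * (4 : ℝ) ^ (10 - min η 1)) * (a * s) ^ (min η 1 - 10) := by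
  set η' := min η 1 with hη'
  have ham : 0 < a * m := mul_pos ha hm
  have has : 0 < a * s := mul_pos ha hs
  have hθ : 0 < θ := lt_of_lt_of_le ham hmθ
  have h1 : X ≤ max C 0 * (a * m) ^ (η - 10) :=
    hX.trans (mul_le_mul_of_nonneg_right (le_max_left _ _) (Real.rpow_nonneg ham.le _))
  have hsplit : (a * m) ^ (η - 10) = (a * m) ^ (η - η') * (a * m) ^ (η' - 10) := by
    rw [← Real.rpow_add ham]; congr 1; ring
  have h2 : (a * m) ^ (η - η') ≤ θ ^ (η - η') :=
    Real.rpow_le_rpow ham.le hmθ (by simp [hη'])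
  have h3 : (a * m) ^ (η' - 10) ≤ (a * s / 4) ^ (η' - 10) := by
    apply Real.rpow_le_rpow_of_nonpos (by positivity)
    · rw [div_le_iff₀ (by norm_num : (0:ℝ) < 4)]; nlinarith
    · have : η' ≤ 1 := min_le_right _ _
      linarith
  have h4 : (a * s / 4) ^ (η' - 10) = (4 : ℝ) ^ (10 - η') * (a * s) ^ (η' - 10) := by
    rw [Real.div_rpow has.le (by norm_num), div_eq_inv_mul]
    congr 1
    rw [← Real.rpow_neg (by norm_num)]
    congr 1; ring
  calc X ≤ max C 0 * (a * m) ^ (η - 10) := h1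
    _ = max C 0 * ((a * m) ^ (η - η') * (a * m) ^ (η' - 10)) := by rw [hsplit]
    _ ≤ max C 0 * (θ ^ (η - η') * (a * s / 4) ^ (η' - 10)) := by
        apply mul_le_mul_of_nonneg_left _ (le_max_right _ _)
        exact mul_le_mul h2 h3 (Real.rpow_nonneg ham.le _) (Real.rpow_nonneg hθ.le _)
    _ = (max C 0 * θ ^ (η - η') * (4 : ℝ) ^ (10 - η')) * (a * s) ^ (η' - 10) := by rw [h4]; ring

/-- **E‴₁ from the axis-currency stubs** (v13 glue): split on the sign of the coupling along the scheme; on the branch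
`β_k ≥ 0` frequently, normalise the separation to the time axis (P), dominate the off-axis covariance by the two axis
covariances (A) and feed in the axis window bound (E⁗); on the branch `β_k < 0` eventually use N verbatim. -/
theorem latticeKernelWindowBound_of (hP : CovAxisNormalisation) (hA : AxisDomination) (hE4 : AxisWindowBound)
    (hN : NegativeCouplingWindowBound) : LatticeKernelWindowBound := by
  intro G _ _ _ _ _ _ hG r sch S₁ hW₁ hnd hsc
  by_cases hpos : ∃ᶠ k in Filter.atTop, 0 ≤ sch.β k
  swap
  · exact hN G hG r sch S₁ hW₁ hnd hsc (by simpa [Filter.not_frequently, not_le] using hpos)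
  obtain ⟨C, η, θ, R₀, hη, hθ, hfreq⟩ := hE4 G hG r sch S₁ hW₁ hnd hsc hpos
  set K : ℝ := max C 0 * θ ^ (η - min η 1) * (4 : ℝ) ^ (10 - min η 1) with hK
  refine ⟨2 * K, min η 1, θ / 2, 2 * max R₀ 0 + 6, lt_min hη one_pos, half_pos hθ, ?_⟩
  have hev : ∀ᶠ k in Filter.atTop, θ < sch.a k * sch.L k := sch.tendsto_L.eventually_gt_atTop θ
  refine (hfreq.and_eventually hev).mono ?_
  rintro k ⟨⟨hβk, hbd⟩, hkL⟩ z hz hz0 hR hθz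
  have ha : 0 < sch.a k := sch.a_pos k
  -- the sup-norm coordinate
  obtain ⟨n, i, hi, hle⟩ := exists_coord_abs_eq z
  have hn_le : (n : ℝ) ≤ ‖siteToE z‖ := by
    have h := abs_coord_le_norm_siteToE z i
    rcases hi with h' | h' <;> rw [h'] at h <;> simpa using h
  have hle2 : ‖siteToE z‖ ≤ 2 * n := norm_siteToE_le_two_mul z hle
  have hR0 : 0 ≤ max R₀ 0 := le_max_right _ _
  have hn3r : max R₀ 0 + 3 ≤ (n : ℝ) := by linarith
  have hn3 : 3 ≤ n := by exact_mod_cast (show ((3 : ℕ) : ℝ) ≤ n by push_cast; linarith)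
  have hnpos : 0 < (n : ℝ) := by exact_mod_cast (show 0 < n by omega)
  have hnL : n ≤ sch.L k := by
    have hzi := (mem_box.1 hz) i
    rcases hi with h' | h' <;> rw [h'] at hzi <;> omega
  -- normalise to the time axis and dominate
  obtain ⟨z', hz'0, hcov⟩ := hP G r (sch.β k) (sch.L k) z i n hi
  obtain ⟨hD1, hD2, hCS⟩ := hA G r (sch.β k) hβk (sch.L k) z' n hz'0 hn3 hnL
  -- the two axis separations
  have hm_ge : ∀ m : ℕ, n ≤ m + 1 → m ≤ n + 1 → R₀ ≤ (m : ℝ) ∧ sch.a k * (m : ℝ) ≤ θ ∧ m ≤ sch.L k ∧ 0 < (m : ℝ) ∧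
      ‖siteToE z‖ ≤ 4 * m := by
    intro m hm1 hm2
    have hm1r : (n : ℝ) ≤ m + 1 := by exact_mod_cast hm1
    have hm2r : (m : ℝ) ≤ n + 1 := by exact_mod_cast hm2
    have hmθ : sch.a k * (m : ℝ) ≤ θ := by nlinarith
    refine ⟨by linarith [le_max_left R₀ 0], hmθ, ?_, by linarith, by linarith⟩
    have : (m : ℝ) < sch.L k := by
      by_contra hcon
      push Not at hcon
      have : sch.a k * sch.L k ≤ sch.a k * m := mul_le_mul_of_nonneg_left hcon ha.le
      linarith
    exact_mod_cast this.le
  obtain ⟨hR1, hθ1, hL1, hpos1, hs1⟩ := hm_ge (2 * (n / 2)) (by omega) (by omega)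
  obtain ⟨hR2, hθ2, hL2, hpos2, hs2⟩ := hm_ge (2 * ((n + 1) / 2)) (by omega) (by omega)
  obtain ⟨hB1, -⟩ := hbd (2 * (n / 2)) hR1 hθ1 hL1
  obtain ⟨-, hB2⟩ := hbd (2 * ((n + 1) / 2)) hR2 hθ2 hL2
  have hnormpos : 0 < ‖siteToE z‖ := by
    have : siteToE z ≠ 0 := fun h => hz0 ((Summit.QuantumFields.YangMills.Theorems.CurvatureKernel.LatticeWindow.siteToE_eq_zero_iff z).1 h)
    exact norm_pos_iff.2 this
  -- transfer each axis bound to the window shape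
  rw [abs_of_nonneg hD1] at hB1
  rw [abs_of_nonneg hD2] at hB2
  have hT1 := window_bound_transfer (C := C) (η := η) ha hpos1 hθ1 hnormpos hs1 hB1
  have hT2 := window_bound_transfer (C := C) (η := η) ha hpos2 hθ2 hnormpos hs2 hB2
  rw [← hK] at hT1 hT2
  -- combine with Cauchy–Schwarz
  set c2 : ℝ := (sch.c r.curvature k) ^ 2 with hc2
  have hc2nn : 0 ≤ c2 := sq_nonneg _
  have hKs : 0 ≤ K * (sch.a k * ‖siteToE z‖) ^ (min η 1 - 10) := by
    have : 0 ≤ K := by rw [hK]; positivity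
    exact mul_nonneg this (Real.rpow_nonneg (mul_nonneg ha.le (norm_nonneg _)) _)
  have key : c2 * |((∫ U, r.curvature.F (torusLift (2 * sch.L k + 1) U) * r.curvature.F (configShift (-z) (torusLift (2 * sch.L k + 1) U)) ∂(wilsonMeasure r.ρ (sch.β k) : MeasureTheory.Measure (GaugeConfig 4 (2 * sch.L k + 1) G))) - (∫ U, r.curvature.F (torusLift (2 * sch.L k + 1) U) ∂(wilsonMeasure r.ρ (sch.β k) : MeasureTheory.Measure (GaugeConfig 4 (2 * sch.L k + 1) G))) * (∫ U, r.curvature.F (configShift (-z) (torusLift (2 * sch.L k + 1) U)) ∂(wilsonMeasure r.ρ (sch.β k) : MeasureTheory.Measure (GaugeConfig 4 (2 * sch.L k + 1) G))))| ≤ 2 * K * (sch.a k * ‖siteToE z‖) ^ (min η 1 - 10) := by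
    rw [hcov]
    set X := ((∫ U, r.curvature.F (torusLift (2 * sch.L k + 1) U) * r.curvature.F (configShift (-z') (torusLift (2 * sch.L k + 1) U)) ∂(wilsonMeasure r.ρ (sch.β k) : MeasureTheory.Measure (GaugeConfig 4 (2 * sch.L k + 1) G))) - (∫ U, r.curvature.F (torusLift (2 * sch.L k + 1) U) ∂(wilsonMeasure r.ρ (sch.β k) : MeasureTheory.Measure (GaugeConfig 4 (2 * sch.L k + 1) G))) * (∫ U, r.curvature.F (configShift (-z') (torusLift (2 * sch.L k + 1) U)) ∂(wilsonMeasure r.ρ (sch.β k) : MeasureTheory.Measure (GaugeConfig 4 (2 * sch.L k + 1) G)))) with hX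
    have hsq : (c2 * |X|) ^ 2 ≤ (K * (sch.a k * ‖siteToE z‖) ^ (min η 1 - 10)) ^ 2 := by
      calc (c2 * |X|) ^ 2 = c2 * c2 * X ^ 2 := by rw [mul_pow, sq_abs]; ring
        _ ≤ c2 * c2 * (latticeConnectedCorr r.ρ (sch.β k) (2 * sch.L k + 1) r.curvature.F r.curvature.timeReflect.F (2 * ((n + 1) / 2)) * latticeConnectedCorr r.ρ (sch.β k) (2 * sch.L k + 1) r.curvature.timeReflect.F r.curvature.F (2 * (n / 2))) :=
            mul_le_mul_of_nonneg_left hCS (mul_nonneg hc2nn hc2nn)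
        _ = (c2 * latticeConnectedCorr r.ρ (sch.β k) (2 * sch.L k + 1) r.curvature.timeReflect.F r.curvature.F (2 * (n / 2))) * (c2 * latticeConnectedCorr r.ρ (sch.β k) (2 * sch.L k + 1) r.curvature.F r.curvature.timeReflect.F (2 * ((n + 1) / 2))) := by ring
        _ ≤ (K * (sch.a k * ‖siteToE z‖) ^ (min η 1 - 10)) * (K * (sch.a k * ‖siteToE z‖) ^ (min η 1 - 10)) :=
            mul_le_mul hT1 hT2 (mul_nonneg hc2nn hD2) hKs
        _ = (K * (sch.a k * ‖siteToE z‖) ^ (min η 1 - 10)) ^ 2 := by ring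
    have hfin : c2 * |X| ≤ K * (sch.a k * ‖siteToE z‖) ^ (min η 1 - 10) :=
      (pow_le_pow_iff_left₀ (mul_nonneg hc2nn (abs_nonneg _)) hKs two_ne_zero).1 hsq
    linarith
  exact key

end AxisGlue

/-- **The two inputs of the D-free reduction from E‴₁** (v12 content, repackaged so that only ONE theorem below concludes the crux
from hypotheses): kernel existence for `W₁`-data (H, R, X, B₁, B₂, landed glue, E‴₁) and E (from the landed S1, S2, L1, L2, L3 and E‴₁). -/
theorem reductionInputs_of_latticeKernelWindowBound (hE31 : LatticeKernelWindowBound) : KernelExistenceW1 ∧ AxialGrowth :=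
  ⟨kernelExistenceW1_of (Summit.QuantumFields.YangMills.Theorems.CurvatureKernel.HalfSpaceKernel Summit.QuantumFields.YangMills.Theorems.CurvatureKernel.PartitionBump) Summit.QuantumFields.YangMills.Theorems.CurvatureKernel.LocalRepresentation
      Summit.QuantumFields.YangMills.Theorems.CurvatureKernel.KernelExistence Summit.QuantumFields.YangMills.Theorems.CurvatureKernel.TwoPointLocalBoundScaling Summit.QuantumFields.YangMills.Theorems.CurvatureKernel.TwoPointLocalBoundSemiDegenerate
      Summit.QuantumFields.YangMills.Theorems.CurvatureKernel.LatticeWindowPairOfOne hE31,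
    axialGrowth_of (axialGrowthNondegenerate_of (axialGrowthScaling_of
      Summit.QuantumFields.YangMills.Theorems.CurvatureKernel.LatticeWindowTransfer
      (latticeWindowBound_of Summit.QuantumFields.YangMills.Theorems.CurvatureKernel.LatticeWindowPairOfOne hE31)))⟩

/-- **`CurvatureKernelBound_of`** — the glue of the line, v14: the D-free reduction G fed with the two inputs assembled from E‴₁, itself
GLUED from the LANDED F `OddTorusCovCauchySchwarz` (p127937), P `CovAxisNormalisation` (p128179), A `AxisDominationOfForm` (p128805) and the
two registered OPEN stubs E⁗ `AxisWindowBound`, N `NegativeCouplingWindowBound`. -/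
theorem curvatureKernelBound_of_v14 (hE4 : AxisWindowBound) (hN : NegativeCouplingWindowBound) :
    Crux :=
  have h := reductionInputs_of_latticeKernelWindowBound (latticeKernelWindowBound_of Summit.QuantumFields.YangMills.Theorems.CurvatureKernel.CovAxisNormalisation
    (Summit.QuantumFields.YangMills.Theorems.CurvatureKernel.AxisDominationOfForm Summit.QuantumFields.YangMills.Theorems.CurvatureKernel.OddTorusCovCauchySchwarz) hE4 hN)
  Summit.QuantumFields.YangMills.Theorems.CurvatureKernel.CurvatureKernelBoundReductionDFree h.1 h.2

/-- **E‴₁ alone still closes the crux** (v12's glue, kept for the record and for the existence-leg fold). -/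
theorem curvatureKernelBound_of_latticeKernelWindowBound (hE31 : LatticeKernelWindowBound) :
    Crux :=
  have h := reductionInputs_of_latticeKernelWindowBound hE31
  Summit.QuantumFields.YangMills.Theorems.CurvatureKernel.CurvatureKernelBoundReductionDFree h.1 h.2

/-- **Conversely** the crux implies E″ (landed `AxialGrowthNecessary`): the reshapes lose nothing. -/
theorem axialGrowthScaling_of_curvatureKernelBound
    (h : Summit.QuantumFields.YangMills.Theses.PencilRigidity.CurvatureKernelBound) : AxialGrowthScaling := by
  intro G _ _ _ _ _ _ hG r sch S₁ hW₁ _ _ K hcont hrep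
  exact Summit.QuantumFields.YangMills.Theorems.CurvatureKernel.AxialGrowthNecessary h G hG r sch S₁ hW₁ K hcont hrep

/-- **With NO route item in between, the crux lies between E‴₁ and E″**: `E‴₁ → crux` and `crux → E″`; and after v13,
`(F ∧ P ∧ A ∧ E⁗ ∧ N) → E‴₁`. -/
theorem curvatureKernelBound_of_latticeKernelWindowBound_dfree :
    (LatticeKernelWindowBound → Summit.QuantumFields.YangMills.Theses.PencilRigidity.CurvatureKernelBound) ∧
    (Summit.QuantumFields.YangMills.Theses.PencilRigidity.CurvatureKernelBound → AxialGrowthScaling) ∧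
    (OddTorusCovCauchySchwarz → CovAxisNormalisation → AxisDominationOfForm → AxisWindowBound →
      NegativeCouplingWindowBound → LatticeKernelWindowBound) :=
  ⟨curvatureKernelBound_of_latticeKernelWindowBound, axialGrowthScaling_of_curvatureKernelBound,
    fun hF hP hA hE4 hN => latticeKernelWindowBound_of hP (hA hF) hE4 hN⟩

/-! ## The composition, v15 part (kernel-checked; no `sorry` below this line) -/

/-- **The crux is EQUIVALENT to T** (I and N′). -/
theorem curvatureKernelBound_iff_twoPointLocalDecay (hI1 : KernelExistenceOfLocalDecay) (hI2 : AxialGrowthOfLocalDecay)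
    (hN : CruxToLocalDecay) :
    Summit.QuantumFields.YangMills.Theses.PencilRigidity.CurvatureKernelBound ↔ TwoPointLocalDecay :=
  ⟨hN, curvatureKernelBound_of_twoPointLocalDecay hI1 hI2⟩

/-- **E^sm from the pointwise E‴₁** (J, per scheme): the old residue implies the new one. -/
theorem smearedLatticeWindowBound_of_latticeKernelWindowBound (hJ : SmearedOfPointwise)
    (hE31 : LatticeKernelWindowBound) : SmearedLatticeWindowBound := by
  intro G _ _ _ _ _ _ hG r sch S₁ hW₁ hnd hsc
  exact hJ G r sch (hE31 G hG r sch S₁ hW₁ hnd hsc)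

/-- **The v14 entry is kept**: `(F ∧ P ∧ A ∧ E⁗ ∧ N) → E‴₁ → E^sm → crux` (F, P, A tree theorems). -/
theorem CurvatureKernelBound_of_axis (hI1 : KernelExistenceOfLocalDecay) (hI2 : AxialGrowthOfLocalDecay)
    (hB : SemiDegenerateLocalDecay) (hL : SmearedToLocalDecay)
    (hJ : SmearedOfPointwise) (hE4 : AxisWindowBound) (hN : NegativeCouplingWindowBound) :
    Crux :=
  curvatureKernelBound_of_inputs hI1 hI2 hB hL (smearedLatticeWindowBound_of_latticeKernelWindowBound hJ
    (latticeKernelWindowBound_of Summit.QuantumFields.YangMills.Theorems.CurvatureKernel.CovAxisNormalisation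
      (Summit.QuantumFields.YangMills.Theorems.CurvatureKernel.AxisDominationOfForm
        Summit.QuantumFields.YangMills.Theorems.CurvatureKernel.OddTorusCovCauchySchwarz) hE4 hN))

/-- **The sandwich after v15**: `E^sm → crux ↔ T`, `E‴₁ → E^sm`, `crux → E″`. -/
theorem curvatureKernelBound_sandwich (hI1 : KernelExistenceOfLocalDecay) (hI2 : AxialGrowthOfLocalDecay)
    (hN : CruxToLocalDecay) (hB : SemiDegenerateLocalDecay) (hL : SmearedToLocalDecay) (hJ : SmearedOfPointwise) :
    (SmearedLatticeWindowBound → Summit.QuantumFields.YangMills.Theses.PencilRigidity.CurvatureKernelBound) ∧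
    (Summit.QuantumFields.YangMills.Theses.PencilRigidity.CurvatureKernelBound ↔ TwoPointLocalDecay) ∧
    (LatticeKernelWindowBound → SmearedLatticeWindowBound) ∧
    (Summit.QuantumFields.YangMills.Theses.PencilRigidity.CurvatureKernelBound → AxialGrowthScaling) :=
  ⟨curvatureKernelBound_of_inputs hI1 hI2 hB hL, curvatureKernelBound_iff_twoPointLocalDecay hI1 hI2 hN,
    smearedLatticeWindowBound_of_latticeKernelWindowBound hJ, axialGrowthScaling_of_curvatureKernelBound⟩


/-- **v16: the crux is EQUIVALENT to T, unconditionally** (I₁ p130518, I₂ p131106, N′ p130438 are tree theorems). -/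
theorem curvatureKernelBound_iff_twoPointLocalDecay' :
    Summit.QuantumFields.YangMills.Theses.PencilRigidity.CurvatureKernelBound ↔ TwoPointLocalDecay :=
  curvatureKernelBound_iff_twoPointLocalDecay Summit.QuantumFields.YangMills.Theorems.CurvatureKernel.KernelExistenceOfLocalDecay
    Summit.QuantumFields.YangMills.Theorems.CurvatureKernel.AxialGrowthOfLocalDecay
    Summit.QuantumFields.YangMills.Theorems.CurvatureKernel.CruxToLocalDecay

/-- **v16: E^sm alone closes the crux** (all glue landed; alias of `CurvatureKernelBound_of`). -/
theorem curvatureKernelBound_of_smearedLatticeWindowBound (hE : SmearedLatticeWindowBound) :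
    Crux :=
  CurvatureKernelBound_of hE

/-- **v16 sandwich, unconditionally**: `E^sm → crux`, `crux ↔ T`, `E‴₁ → E^sm`, `(F ∧ P ∧ A ∧ E⁗ ∧ N) → E‴₁`, `crux → E″`. -/
theorem curvatureKernelBound_sandwich' :
    (SmearedLatticeWindowBound → Summit.QuantumFields.YangMills.Theses.PencilRigidity.CurvatureKernelBound) ∧
    (Summit.QuantumFields.YangMills.Theses.PencilRigidity.CurvatureKernelBound ↔ TwoPointLocalDecay) ∧
    (LatticeKernelWindowBound → SmearedLatticeWindowBound) ∧
    (AxisWindowBound → NegativeCouplingWindowBound → LatticeKernelWindowBound) ∧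
    (Summit.QuantumFields.YangMills.Theses.PencilRigidity.CurvatureKernelBound → AxialGrowthScaling) :=
  ⟨curvatureKernelBound_of_smearedLatticeWindowBound, curvatureKernelBound_iff_twoPointLocalDecay',
    smearedLatticeWindowBound_of_latticeKernelWindowBound Summit.QuantumFields.YangMills.Theorems.CurvatureKernel.SmearedOfPointwise,
    fun hE4 hN => latticeKernelWindowBound_of Summit.QuantumFields.YangMills.Theorems.CurvatureKernel.CovAxisNormalisation
      (Summit.QuantumFields.YangMills.Theorems.CurvatureKernel.AxisDominationOfForm Summit.QuantumFields.YangMills.Theorems.CurvatureKernel.OddTorusCovCauchySchwarz) hE4 hN,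
    axialGrowthScaling_of_curvatureKernelBound⟩


/-! ## v17 record statements (existence-leg folds and necessity; all LANDED) -/

/-- **Fold (T currency) · KernelConclusionOfWitnessLocalDecay** (LANDED p131920): ONE `W₁`-datum + its two-point local decay ⇒ the
conclusion of the crux for that family. The statement a planner folds into the existence leg. [folklore] -/
def KernelConclusionOfWitnessLocalDecay : Prop :=
  open Literature.MathematicalPhysics.QuantumLattice Literature.MathematicalPhysics.AQFT Literature.MathematicalPhysics.QuantumFieldTheory in ∀ (G : Type) [Group G] [TopologicalSpace G] [IsTopologicalGroup G] [CompactSpace G] [MeasurableSpace G] [BorelSpace G], IsCompactSimpleLieGroup G → ∀ (r : LatticeRep G) (sch : SpeciesScheme (YMSpecies G)) (S₁ : SchwingerFamily (EuclideanSpace ℝ (Fin 4))), ((∀ (n : ℕ), n ≠ 0 → ∀ (f : Fin n → SchwartzMap (EuclideanSpace ℝ (Fin 4)) ℝ) (F : SchwartzMap (Fin n → (EuclideanSpace ℝ (Fin 4))) ℂ), IsTensorOf F (fun i => ofRealTest (f i)) → IsOffDiagonal F → Filter.Tendsto (fun k : ℕ => ((latticeSchwinger r.ρ sch (fun s => s.F)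 k n (fun _ => r.curvature) f : ℝ) : ℂ)) Filter.atTop (nhds (S₁ n F))) ∧ (S₁.toLabelled.IsNormalized ∧ S₁.toLabelled.IsHermitian ∧ S₁.toLabelled.HasLinearGrowth ∧ S₁.toLabelled.IsReflectionPositive ∧ S₁.toLabelled.IsSymmetric ∧ S₁.toLabelled.HasClusterProperty) ∧ (∀ (n : ℕ) (a : (EuclideanSpace ℝ (Fin 4))) (F : SchwartzMap (Fin n → (EuclideanSpace ℝ (Fin 4))) ℂ), IsOffDiagonal F → S₁ n (translateMulti a F) = S₁ n F) ∧ (∀ (R : (EuclideanSpace ℝ (Fin 4)) ≃ₗᵢ[ℝ] (EuclideanSpace ℝ (Fin 4))), LinearMap.det (R.toLinearEquiv : (EuclideanSpace ℝ (Fin 4)) →ₗ[ℝ] (EuclideanSpace ℝ (Fin 4))) = 1 → (∀ i : Fin 4, ∃ j : Fin 4, R (EuclideanSpace.single i 1) = EuclideanSpace.single j 1 ∨ R (EuclideanSpace.single i 1) = -EuclideanSpace.single j 1) → ∀ (n : ℕ) (F : SchwartzMap (Fin n → (EuclideanSpace ℝ (Fin 4))) ℂ), IsOffDiagonal F → S₁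 n (linActMulti R F) = S₁ n F) ∧ (∃ Δ : ℝ, 0 < Δ ∧ S₁.toLabelled.HasMassGap Δ ∧ HasLatticeMassGap r sch Δ)) → (∃ (C η s₁ : ℝ), 0 < η ∧ 0 < s₁ ∧ (∀ (s : ℝ), 0 < s → s < s₁ → ∃ (r₀ A B : ℝ), 0 < r₀ ∧ 0 ≤ A ∧ 0 ≤ B ∧ A + B ≤ C * s ^ (η - 10) ∧ (∀ (r : ℝ), 0 < r → r ≤ r₀ → ∀ (f : Fin 2 → SchwartzMap (EuclideanSpace ℝ (Fin 4)) ℝ) (F : SchwartzMap (Fin 2 → (EuclideanSpace ℝ (Fin 4))) ℂ) (M₀ M₁ : ℝ), IsTensorOf F (fun i => ofRealTest (f i)) → tsupport ((f 0 : SchwartzMap (EuclideanSpace ℝ (Fin 4)) ℝ) : (EuclideanSpace ℝ (Fin 4)) → ℝ) ⊆ Metric.closedBall (EuclideanSpace.single (0 : Fin 4) (-s)) r → tsupport ((f 1 : SchwartzMap (EuclideanSpace ℝ (Fin 4)) ℝ) : (EuclideanSpace ℝ (Fin 4)) → ℝ) ⊆ Metric.closedBall (EuclideanSpace.single (0 :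 Fin 4) s) r → (∀ x, |f 0 x| ≤ M₀) → (∀ x, |f 1 x| ≤ M₁) → ‖S₁ 2 F‖ ≤ A * (∫ x : (EuclideanSpace ℝ (Fin 4)), |f 0 x|) * (∫ x : (EuclideanSpace ℝ (Fin 4)), |f 1 x|) + B * r ^ 8 * M₀ * M₁))) → ∃ (K : (EuclideanSpace ℝ (Fin 4)) → ℝ) (C η : ℝ), 0 < η ∧ ContinuousOn K {x : (EuclideanSpace ℝ (Fin 4)) | x ≠ 0} ∧ (∀ x : (EuclideanSpace ℝ (Fin 4)), x ≠ 0 → |K x| ≤ C * (1 + ‖x‖ ^ (η - 10))) ∧ ∀ F : SchwartzMap (Fin 2 → (EuclideanSpace ℝ (Fin 4))) ℂ, IsOffDiagonal F → MeasureTheory.Integrable (fun x : Fin 2 → (EuclideanSpace ℝ (Fin 4)) => (K (x 0 - x 1) : ℂ) * F x) ∧ S₁ 2 F = ∫ x : Fin 2 → (EuclideanSpace ℝ (Fin 4)), (K (x 0 - x 1) : ℂ) * F x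

/-- **Fold (smeared lattice currency) · KernelConclusionOfWitnessSmeared** (LANDED p131920): ONE `W₁`-datum + the smeared lattice window
bound of its scheme ⇒ the conclusion of the crux for that family (= the previous fold ∘ L′). [folklore] -/
def KernelConclusionOfWitnessSmeared : Prop :=
  open Literature.MathematicalPhysics.QuantumLattice Literature.MathematicalPhysics.AQFT Literature.MathematicalPhysics.QuantumFieldTheory in ∀ (G : Type) [Group G] [TopologicalSpace G] [IsTopologicalGroup G] [CompactSpace G] [MeasurableSpace G] [BorelSpace G], IsCompactSimpleLieGroup G → ∀ (r : LatticeRep G) (sch : SpeciesScheme (YMSpecies G)) (S₁ : SchwingerFamily (EuclideanSpace ℝ (Fin 4))), ((∀ (n : ℕ), n ≠ 0 → ∀ (f : Fin n → SchwartzMap (EuclideanSpace ℝ (Fin 4)) ℝ) (F : SchwartzMap (Fin n → (EuclideanSpace ℝ (Fin 4))) ℂ), IsTensorOf F (fun i => ofRealTest (f i)) → IsOffDiagonal F → Filter.Tendsto (fun k : ℕ => ((latticeSchwinger r.ρ sch (fun s => s.F) k n (fun _ => r.curvature) f : ℝ) : ℂ)) Filter.atTop (nhds (S₁ n F))) ∧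 (S₁.toLabelled.IsNormalized ∧ S₁.toLabelled.IsHermitian ∧ S₁.toLabelled.HasLinearGrowth ∧ S₁.toLabelled.IsReflectionPositive ∧ S₁.toLabelled.IsSymmetric ∧ S₁.toLabelled.HasClusterProperty) ∧ (∀ (n : ℕ) (a : (EuclideanSpace ℝ (Fin 4))) (F : SchwartzMap (Fin n → (EuclideanSpace ℝ (Fin 4))) ℂ), IsOffDiagonal F → S₁ n (translateMulti a F) = S₁ n F) ∧ (∀ (R : (EuclideanSpace ℝ (Fin 4)) ≃ₗᵢ[ℝ] (EuclideanSpace ℝ (Fin 4))), LinearMap.det (R.toLinearEquiv : (EuclideanSpace ℝ (Fin 4)) →ₗ[ℝ] (EuclideanSpace ℝ (Fin 4))) = 1 → (∀ i : Fin 4, ∃ j : Fin 4, R (EuclideanSpace.single i 1) = EuclideanSpace.single j 1 ∨ R (EuclideanSpace.single i 1) = -EuclideanSpace.single j 1) → ∀ (n : ℕ) (F : SchwartzMap (Fin n → (EuclideanSpace ℝ (Fin 4))) ℂ), IsOffDiagonal F → S₁ n (linActMulti R F) = S₁ n F) ∧ (∃ Δ : ℝ, 0 < Δ ∧ S₁.toLabelled.HasMassGap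 Δ ∧ HasLatticeMassGap r sch Δ)) → (∃ (C η θ R₀ : ℝ), 0 < η ∧ 0 < θ ∧ ∃ᶠ k in Filter.atTop, ∀ (s ρ : ℝ), 0 < s → sch.a k * R₀ ≤ s → s ≤ θ → 0 < ρ → ρ ≤ s / 2 → ∀ (f : Fin 2 → SchwartzMap (EuclideanSpace ℝ (Fin 4)) ℝ), tsupport ((f 0 : SchwartzMap (EuclideanSpace ℝ (Fin 4)) ℝ) : (EuclideanSpace ℝ (Fin 4)) → ℝ) ⊆ Metric.closedBall (EuclideanSpace.single (0 : Fin 4) (-s)) ρ → tsupport ((f 1 : SchwartzMap (EuclideanSpace ℝ (Fin 4)) ℝ) : (EuclideanSpace ℝ (Fin 4)) → ℝ) ⊆ Metric.closedBall (EuclideanSpace.single (0 : Fin 4) s) ρ → |latticeSchwinger r.ρ sch (fun s => s.F) k 2 (fun _ => r.curvature) f - latticeSchwinger r.ρ sch (fun s => s.F) k 1 (fun _ => r.curvature) (fun _ => f 0) * latticeSchwinger r.ρ sch (fun s => s.F) k 1 (fun _ => r.curvature) (fun _ => f 1)| ≤ C * s ^ (η - 10) * ((sch.a k) ^ 4 *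 ∑ x ∈ Literature.Probability.LatticeModels.box 4 (sch.L k), |f 0 (sch.a k • siteToE x)|) * ((sch.a k) ^ 4 * ∑ x ∈ Literature.Probability.LatticeModels.box 4 (sch.L k), |f 1 (sch.a k • siteToE x)|)) → ∃ (K : (EuclideanSpace ℝ (Fin 4)) → ℝ) (C η : ℝ), 0 < η ∧ ContinuousOn K {x : (EuclideanSpace ℝ (Fin 4)) | x ≠ 0} ∧ (∀ x : (EuclideanSpace ℝ (Fin 4)), x ≠ 0 → |K x| ≤ C * (1 + ‖x‖ ^ (η - 10))) ∧ ∀ F : SchwartzMap (Fin 2 → (EuclideanSpace ℝ (Fin 4))) ℂ, IsOffDiagonal F → MeasureTheory.Integrable (fun x : Fin 2 → (EuclideanSpace ℝ (Fin 4)) => (K (x 0 - x 1) : ℂ) * F x) ∧ S₁ 2 F = ∫ x : Fin 2 → (EuclideanSpace ℝ (Fin 4)), (K (x 0 - x 1) : ℂ) * F x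

/-- **Necessity, scale by scale · SmearedBoundEventuallyOfCrux** (LANDED p131636): the crux forces the smeared lattice bound with the
quantifiers in the order `∀ (s, ρ, f) ∀ᶠ k` (with `δ`-slack); E^sm asks for `∃ᶠ k ∀ (s, ρ, f)`. [folklore] -/
def SmearedBoundEventuallyOfCrux : Prop :=
  open Literature.MathematicalPhysics.QuantumLattice Literature.MathematicalPhysics.AQFT Literature.MathematicalPhysics.QuantumFieldTheory in Summit.QuantumFields.YangMills.Theses.PencilRigidity.CurvatureKernelBound → ∀ (G : Type) [Group G] [TopologicalSpace G] [IsTopologicalGroup G] [CompactSpace G] [MeasurableSpace G] [BorelSpace G], IsCompactSimpleLieGroup G → ∀ (r : LatticeRep G) (sch : SpeciesScheme (YMSpecies G)) (S₁ : SchwingerFamily (EuclideanSpace ℝ (Fin 4))), ((∀ (n : ℕ), n ≠ 0 → ∀ (f : Fin n → SchwartzMap (EuclideanSpace ℝ (Fin 4)) ℝ) (F : SchwartzMap (Fin n → (EuclideanSpace ℝ (Fin 4))) ℂ), IsTensorOf F (fun i => ofRealTest (f i)) → IsOffDiagonal F → Filter.Tendsto (fun k : ℕ => ((latticeSchwinger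 r.ρ sch (fun s => s.F) k n (fun _ => r.curvature) f : ℝ) : ℂ)) Filter.atTop (nhds (S₁ n F))) ∧ (S₁.toLabelled.IsNormalized ∧ S₁.toLabelled.IsHermitian ∧ S₁.toLabelled.HasLinearGrowth ∧ S₁.toLabelled.IsReflectionPositive ∧ S₁.toLabelled.IsSymmetric ∧ S₁.toLabelled.HasClusterProperty) ∧ (∀ (n : ℕ) (a : (EuclideanSpace ℝ (Fin 4))) (F : SchwartzMap (Fin n → (EuclideanSpace ℝ (Fin 4))) ℂ), IsOffDiagonal F → S₁ n (translateMulti a F) = S₁ n F) ∧ (∀ (R : (EuclideanSpace ℝ (Fin 4)) ≃ₗᵢ[ℝ] (EuclideanSpace ℝ (Fin 4))), LinearMap.det (R.toLinearEquiv : (EuclideanSpace ℝ (Fin 4)) →ₗ[ℝ] (EuclideanSpace ℝ (Fin 4))) = 1 → (∀ i : Fin 4, ∃ j : Fin 4, R (EuclideanSpace.single i 1) = EuclideanSpace.single j 1 ∨ R (EuclideanSpace.single i 1) = -EuclideanSpace.single j 1) → ∀ (n : ℕ) (F : SchwartzMap (Fin n → (EuclideanSpace ℝ (Fin 4))) ℂ),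 IsOffDiagonal F → S₁ n (linActMulti R F) = S₁ n F) ∧ (∃ Δ : ℝ, 0 < Δ ∧ S₁.toLabelled.HasMassGap Δ ∧ HasLatticeMassGap r sch Δ)) → ∃ (C η s₁ : ℝ), 0 < η ∧ 0 < s₁ ∧ ∀ (s : ℝ), 0 < s → s < s₁ → ∀ (ρ : ℝ), 0 < ρ → ρ ≤ s / 2 → ∀ (f : Fin 2 → SchwartzMap (EuclideanSpace ℝ (Fin 4)) ℝ) (M₀ M₁ : ℝ), tsupport ((f 0 : SchwartzMap (EuclideanSpace ℝ (Fin 4)) ℝ) : (EuclideanSpace ℝ (Fin 4)) → ℝ) ⊆ Metric.closedBall (EuclideanSpace.single (0 : Fin 4) (-s)) ρ → tsupport ((f 1 : SchwartzMap (EuclideanSpace ℝ (Fin 4)) ℝ) : (EuclideanSpace ℝ (Fin 4)) → ℝ) ⊆ Metric.closedBall (EuclideanSpace.single (0 : Fin 4) s) ρ → (∀ x, |f 0 x| ≤ M₀) → (∀ x, |f 1 x| ≤ M₁) → ∀ (δ : ℝ), 0 < δ → ∀ᶠ k in Filter.atTop, |latticeSchwinger r.ρ sch (fun s => s.F) k 2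 (fun _ => r.curvature) f - latticeSchwinger r.ρ sch (fun s => s.F) k 1 (fun _ => r.curvature) (fun _ => f 0) * latticeSchwinger r.ρ sch (fun s => s.F) k 1 (fun _ => r.curvature) (fun _ => f 1)| ≤ C * s ^ (η - 10) * ((∫ x : (EuclideanSpace ℝ (Fin 4)), |f 0 x|) * (∫ x : (EuclideanSpace ℝ (Fin 4)), |f 1 x|) + ρ ^ 8 * M₀ * M₁) + δ

/-- **v17 record**: the folds and the necessity are tree theorems. -/
theorem folds_and_necessity :
    KernelConclusionOfWitnessLocalDecay ∧ KernelConclusionOfWitnessSmeared ∧ SmearedBoundEventuallyOfCrux :=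
  ⟨Summit.QuantumFields.YangMills.Theorems.CurvatureKernel.KernelConclusionOfWitnessLocalDecay,
    Summit.QuantumFields.YangMills.Theorems.CurvatureKernel.KernelConclusionOfWitnessSmeared,
    Summit.QuantumFields.YangMills.Theorems.CurvatureKernel.SmearedBoundEventuallyOfCrux⟩

/-- **v17 record**: `crux ↔ T` is the tree theorem `CurvatureKernelBoundIffLocalDecay` (p131429). -/
theorem curvatureKernelBound_iff_twoPointLocalDecay_tree :
    Summit.QuantumFields.YangMills.Theses.PencilRigidity.CurvatureKernelBound ↔ TwoPointLocalDecay :=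
  Summit.QuantumFields.YangMills.Theorems.CurvatureKernel.CurvatureKernelBoundIffLocalDecay

/-- **The skeleton** (v17): the crux modulo the ONE registered open stub E^sm (everything else is a tree theorem). -/
theorem CurvatureKernelBound_proof :
    Summit.QuantumFields.YangMills.Theses.PencilRigidity.CurvatureKernelBound :=
  CurvatureKernelBound_of Stub.SmearedLatticeWindowBound

end Summit.QuantumFields.YangMills.Cruxes.CurvatureKernelBound.SixteenChartsAnalyticKernel
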